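import Literature.Probability.RandomPlanarGeometry.YangBaxterSAWSquareLattice
import Literature.Barriers.CriticalPhenomena.PlaquetteWalkWeightRigidityPrinted
import Literature.Barriers.CriticalPhenomena.PlaquetteWalkSignGauge
import HarnessLib

/-!
# Glazman–Manolescu, Lemma 2.1 on a GENERAL finite face domain with a GENERAL (outer) root — C-B2

Topic `Literature/Probability/RandomPlanarGeometry`; companion of `YangBaxterSAWGrouping.lean` and
`YangBaxterSAWExcursion.lean`, which prove the vertex relation (CR) of the parafermionic observable
of the Yang–Baxter self-avoiding walk (A. Glazman, I. Manolescu, arXiv:1708.00395, **Lemma 2.1**;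
proof = A. Glazman, ECP 20 (2015), Lemma 3.1) for the rectangles `Rect_{T,L}(Θ)` rooted at the
origin `0`. The printed lemma is stated for the rectangle only because the paper needs nothing
else; its proof ("walks in the same group differ only inside the rhombus … the total contribution
of each group is zero") is local, except for ONE global input used silently: the excursion of a
walk outside a rhombus, closed through the rhombus, does not wind around the starting point of the
walk — true because walks start on the (outer) boundary of the domain.

This file carries out the same proof for an ARBITRARY finite set of faces `D ⊂ ℤ²` and an
ARBITRARY root mid-edge `a` that is not interior to `D` (`RootedFace D a r`: `r ∈ D` and not both
faces of `a` lie in `D`), isolating that global input as the hypothesis `RootUnwound D a`, and then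
DISCHARGES it for every root on the outer boundary:

* `ΩG D a r`, `YBWalk.firstHitG`, … : the grouping combinatorics of `YangBaxterSAWGrouping.lean`
  verbatim with `(Rect_{T,L}, 0)` replaced by `(D, a)` (names suffixed `G`; the classes `A`, `B1`,
  `B2a`, `B2b`, the bijections `extA`/`baseA`, `ext₃`/`base₂`, the reversal `rev`);
* `ExcursionWindingGen D a` (the excursion windings) and
  `lem21_of_excursionWindingGen : ExcursionWindingGen D a → (CR at every r with RootedFace D a r)`
  for the observable `parafermionOn D a Θ z = Σ_{γ ⊂ D : a → z} w_Θ(γ) e^{−i(5/8)wind_Θ(γ)}`;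
* the Hopf-Umlaufsatz argument of `YangBaxterSAWExcursion.lean` verbatim for `(D, a)`, giving
  `excursionWindingGen_of_rootUnwound : RootUnwound D a → ExcursionWindingGen D a`, where
  `RootUnwound D a` says that the excursion polygon `J` of every walk of class `B2a` from `a` has
  winding angle `0` around the midpoint of `a`;
* discharges of `RootUnwound`: `rootUnwound_of_supportingRoot` (the domain lies in the closed
  half-plane inward of the line carrying `a`; half-plane lemma) and **`rootUnwound_of_outerRoot`**:
  `OuterRoot D a := ∃ n g, ExteriorChain D a n g` — faces `g 0, …, g n ∉ D`, `a` a side of `g 0`,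
  consecutive faces sharing a corner (king moves: the connectivity of the complement dual to the
  edge-connectivity of the walks), `g n` beyond `D` (all of `D` strictly on one side); i.e. the
  exterior face of `a` lies in the unbounded king-component of `ℤ² ∖ D`. Proof: the winding angle
  of `J` vanishes at the centre of `g n` (half-plane) and is transported centre → shared corner →
  centre along the chain and finally to `midPt a`, every plaquette of the secant homotopy being
  valid because the vertices of `J` are inner points of faces of `D` — at squared distance `≥ 9`
  from exterior face centres, `≥ 5` from lattice corners, `≥ 1` from edge midpoints — and the
  steps of `J` have squared length `≤ 4` (`distSq_pJpt_succ_le`, `sdot_pJpt_of_far`,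
  `AJ_ctr_eq_AJ_corner`, `AJ_root_eq_AJ_ctr`, `AJ_ctr_eq_zero_of_beyond`);
* **`lem21_of_outerRoot`**: (CR) at every rhombus of every finite `D`, for every outer root and
  all angle sequences `Θ` with values in `[π/3, 2π/3]`; consistency: `outerRoot_rect_origin`,
  `parafermionOn_rect`, and an `example : GlazmanManolescu2019_lem21` re-deriving the tree's named
  Lemma 2.1 from the general theorem;
* the square frame: `sqParafermionOn`, `sqRelation_of_outerRoot` —
  `F_sq(z_E) − F_sq(z_W) = e^{i(3θ_k/8 + 5π/16)} (F_sq(z_S) − F_sq(z_N))` (the tree's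
  `sqParafermion_relation` is the case `(Rect_{T,L}, 0)`), `sqRelation_const_of_outerRoot`;
* the bridge to the barrier catalogue's vocabulary (`Literature.Barriers.CriticalPhenomena.
  PlaquetteWalk`): `weightL_printedWeights` (`weightL (printedWeights θ) γ = w_θ(γ)`, via the
  Fig. 1 shape theorem `kindsL_shape` and `not_two_straight`), `tFiveEighths_zpow_eq`
  (`t^{q(γ)} = e^{−i(5/8)wind_{π/2}(γ)}`), `gmObservable_printed_eq`
  (`gmObservable (printedWeights θ) e^{−5iπ/16} Dl a = sqParafermionOn (dom Dl) a θ`), and the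
  lane's conjecture **C-B2** as a theorem: `vertexFunctional_printed_eq_zero` /
  `PlaquetteWalkYBIdentityOuter_holds` — for every `θ ∈ [π/3, 2π/3]`, every finite face list
  `Dl`, every OUTER root `a`, every face `f₀ ∈ Dl`:
  `vertexFunctional (printedWeights θ) tFiveEighths (1, r(θ), −1, −r(θ)) Dl a f₀ = 0`,
  `r(θ) = ybRatio θ = e^{i(3θ/8+5π/16)}`.

Status in print: the generality is implicit in [GM] ("for each rhombus of `Rect_{T,L}(Θ)`", the
domain playing no role in the proof) and explicit in Duminil-Copin–Smirnov's hexagonal-lattice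
Lemma 1 ("for every vertex `v ∈ V(Ω)`" of an arbitrary domain `Ω`, root `a ∈ ∂Ω`)
[cite: DuminilCopinSmirnov2012, Lemma 1]; for the square lattice with Yang–Baxter weights see also
[cite: Glazman2015WeightedSAW, Lemma 3.1] and [cite: GlazmanManolescu2019, Lemma 2.1]. New here: the
kernel text for general `(D, a)`, the explicit outer-root hypothesis with its combinatorial
discharge (no Jordan curve theorem: two-base-point Hopf + plaquette transport along an exterior
king-chain), and the identification with the barrier catalogue's free-weight observable. The
hypothesis is sharp in kind: for roots on the boundary of a HOLE of `D` the identity fails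
(venture lane «pcv-sawmu», HOME/STRUCTURE.md C-B2: "hole-rooted tables are the known exception",
C-I item 1: 124/1192 nonzero rows, all hole-rooted).

Written for the venture lane «pcv-sawmu» (Tier B, conjecture C-B2 «YB identity on general domains»).
-/

noncomputable section
open scoped ENNReal
open Real

namespace Literature.Probability.RandomPlanarGeometry.SAW.YangBaxter

/-- **A rhombus of the domain, seen from a non-interior root**: `r ∈ D`, and the root mid-edge `a`
does not have both of its faces in `D` (so a walk from `a` that starts on `∂r` enters `r`).
[cite: GlazmanManolescu2019, §2.1 (walks start on the boundary of the domain)] -/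
structure RootedFace (D : Set Face) (a : MidEdge) (r : Face) : Prop where
  /-- the rhombus belongs to the domain -/
  mem : r ∈ D
  /-- the root is not an interior mid-edge of the domain -/
  root : ¬(a.faces.1 ∈ D ∧ a.faces.2 ∈ D)

namespace YBWalk

section Rect

variable {D : Set Face} {a : MidEdge} {r : Face} {sE : Side} (γ : YBWalk D a (r.side sE))

/-- The last index is a hit. [folklore] -/
private theorem length_mem_hitIdxG : γ.arcs.length ∈ γ.hitIdx r := (mem_hitIdx γ r).2 ⟨le_rfl, sE, γ.nth_length⟩

/-- There is a hit. [folklore] -/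
private theorem hitIdx_nonemptyG : (γ.hitIdx r).Nonempty := ⟨_, γ.length_mem_hitIdxG⟩

/-- The index of the first crossing of a side of `r`. [folklore] -/
def firstHitG : ℕ := (γ.hitIdx r).min' γ.hitIdx_nonemptyG

/-- The first hit is a hit. [folklore] -/
private theorem firstHit_memG : γ.firstHitG ∈ γ.hitIdx r := Finset.min'_mem _ _

/-- The first hit is an index of the walk. [folklore] -/
private theorem firstHit_leG : γ.firstHitG ≤ γ.arcs.length := ((mem_hitIdx γ r).1 γ.firstHit_memG).1

/-- No hit before the first hit. [folklore] -/
private theorem not_mem_hitIdx_of_lt_firstHitG {i : ℕ} (h : i < γ.firstHitG) : i ∉ γ.hitIdx r :=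
  fun hi => (Finset.min'_le _ _ hi).not_gt h

/-- The first hit is the least hit. [folklore] -/
private theorem firstHit_le_of_memG {i : ℕ} (hi : i ∈ γ.hitIdx r) : γ.firstHitG ≤ i := Finset.min'_le _ _ hi

/-- The side of `r` first crossed. [folklore] -/
def firstSideG : Side := Classical.choose ((mem_hitIdx γ r).1 γ.firstHit_memG).2

/-- The mid-edge at the first hit is the first side. [folklore] -/
private theorem nth_firstHitG : γ.nth γ.firstHitG = r.side γ.firstSideG := Classical.choose_spec ((mem_hitIdx γ r).1 γ.firstHit_memG).2

variable (hr : RootedFace D a r)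
include hr

/-- **After the first crossing of `∂r` the walk enters `r`** (if it continues). [folklore] -/
private theorem arcFace_firstHitG (h : γ.firstHitG < γ.arcs.length) : arcFace (γ.nth γ.firstHitG, γ.nth (γ.firstHitG + 1)) = some r := by
  rcases Nat.eq_zero_or_pos γ.firstHitG with h0 | hpos
  · -- the walk starts on `∂r`: its first arc lies in `r`, the other face of the root not being in `D`
    have hs := γ.nth_firstHitG
    rw [h0, nth_zero] at hs
    obtain ⟨f, hfD, hf⟩ := γ.arc_nth h
    rw [h0] at hf ⊢
    rw [nth_zero] at hf ⊢
    obtain ⟨-, h1, -⟩ := MidEdge.commonFace_eq_some hf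
    have hr' := (Face.exists_side_eq_iff r a).1 ⟨_, hs.symm⟩
    have h1' : f = a.faces.1 ∨ f = a.faces.2 := by simpa using h1
    have hfr : f = r := by
      rcases h1' with h1 | h1 <;> rcases hr' with h2 | h2
      · exact h1.trans h2.symm
      · exact absurd ⟨by rw [← h1]; exact hfD, by rw [← h2]; exact hr.mem⟩ hr.root
      · exact absurd ⟨by rw [← h2]; exact hr.mem, by rw [← h1]; exact hfD⟩ hr.root
      · exact h1.trans h2.symm
    rw [hf, hfr]
  · exact arcFace_eq_of_first_hit hpos h γ.nth_firstHitG (γ.not_mem_hitIdx_of_lt_firstHitG (by omega))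

omit hr in
/-- No arc before the first crossing lies in `r`. [folklore] -/
private theorem arcFace_ne_of_lt_firstHitG {i : ℕ} (hi : i < γ.firstHitG) (hi' : i < γ.arcs.length) :
    arcFace (γ.nth i, γ.nth (i + 1)) ≠ some r :=
  fun h => γ.not_mem_hitIdx_of_lt_firstHitG hi (mem_hitIdx_of_arcFace hi' h).1

/-- The side through which the walk leaves `r` after its first arc in `r`. [folklore] -/
def exitSideG (h : γ.firstHitG < γ.arcs.length) : Side :=
  Classical.choose (Classical.choose_spec (exists_sides_of_arcFace (γ.arcFace_firstHitG hr h)))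

/-- The mid-edge after the first hit is the exit side, which differs from the first side. [folklore] -/
private theorem exitSide_specG (h : γ.firstHitG < γ.arcs.length) :
    γ.nth (γ.firstHitG + 1) = r.side (γ.exitSideG hr h) ∧ γ.exitSideG hr h ≠ γ.firstSideG := by
  obtain ⟨hne, h1, h2, -⟩ := Classical.choose_spec (Classical.choose_spec (exists_sides_of_arcFace (γ.arcFace_firstHitG hr h)))
  have e := r.side_injective (h1.trans γ.nth_firstHitG)
  exact ⟨h2.symm, fun h' => hne (e.trans h'.symm)⟩

/-- The exit index is a hit. [folklore] -/
private theorem firstHit_succ_memG (h : γ.firstHitG < γ.arcs.length) : γ.firstHitG + 1 ∈ γ.hitIdx r :=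
  (mem_hitIdx γ r).2 ⟨by omega, _, (γ.exitSide_specG hr h).1⟩

/-- The hits after the exit. [folklore] -/
def laterHitsG : Finset ℕ := (γ.hitIdx r).filter fun i => γ.firstHitG + 1 < i

omit hr in
/-- Membership in the later hits. [folklore] -/
private theorem mem_laterHitsG {i : ℕ} : i ∈ γ.laterHitsG ↔ i ∈ γ.hitIdx r ∧ γ.firstHitG + 1 < i := Finset.mem_filter

omit hr in
/-- A walk of class `B2` has a later hit. [folklore] -/
private theorem laterHits_nonemptyG (h : γ.firstHitG + 1 < γ.arcs.length) : γ.laterHitsG.Nonempty :=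
  ⟨γ.arcs.length, (γ.mem_laterHitsG).2 ⟨γ.length_mem_hitIdxG, h⟩⟩

/-- **The index of the return to `∂r`** after the excursion. [folklore] -/
def returnHitG (h : γ.firstHitG + 1 < γ.arcs.length) : ℕ := γ.laterHitsG.min' (γ.laterHits_nonemptyG h)

omit hr in
/-- The return index is a hit after the exit. [folklore] -/
private theorem returnHit_memG (h : γ.firstHitG + 1 < γ.arcs.length) : γ.returnHitG h ∈ γ.hitIdx r ∧ γ.firstHitG + 1 < γ.returnHitG h :=
  (γ.mem_laterHitsG).1 (Finset.min'_mem _ _)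

omit hr in
/-- The return index is an index of the walk. [folklore] -/
private theorem returnHit_leG (h : γ.firstHitG + 1 < γ.arcs.length) : γ.returnHitG h ≤ γ.arcs.length :=
  ((mem_hitIdx γ r).1 (γ.returnHit_memG h).1).1

omit hr in
/-- No hit strictly between the exit and the return. [folklore] -/
private theorem not_mem_hitIdx_of_betweenG (h : γ.firstHitG + 1 < γ.arcs.length) {i : ℕ} (h1 : γ.firstHitG + 1 < i)
    (h2 : i < γ.returnHitG h) : i ∉ γ.hitIdx r :=
  fun hi => (Finset.min'_le _ _ ((γ.mem_laterHitsG).2 ⟨hi, h1⟩)).not_gt h2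

/-- The side of `r` crossed at the return. [folklore] -/
def returnSideG (h : γ.firstHitG + 1 < γ.arcs.length) : Side :=
  Classical.choose ((mem_hitIdx γ r).1 (γ.returnHit_memG h).1).2

omit hr in
/-- The mid-edge at the return is the return side. [folklore] -/
private theorem nth_returnHitG (h : γ.firstHitG + 1 < γ.arcs.length) : γ.nth (γ.returnHitG h) = r.side (γ.returnSideG h) :=
  Classical.choose_spec ((mem_hitIdx γ r).1 (γ.returnHit_memG h).1).2

/-- **The excursion stays outside `r`**: no arc strictly between the exit and the return lies in
`r`. [folklore] -/
private theorem arcFace_ne_of_excursionG (h : γ.firstHitG + 1 < γ.arcs.length) {i : ℕ} (h1 : γ.firstHitG < i)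
    (h2 : i < γ.returnHitG h) : arcFace (γ.nth i, γ.nth (i + 1)) ≠ some r := by
  intro hin
  have hi : i < γ.arcs.length := lt_of_lt_of_le h2 (γ.returnHit_leG h)
  obtain ⟨m1, m2⟩ := mem_hitIdx_of_arcFace hi hin
  -- `i` is a hit in `(firstHitG, returnHitG)`, hence `i = firstHitG + 1`; then the arcs `firstHitG` and
  -- `firstHitG + 1` both lie in `r`
  rcases Nat.lt_or_ge (γ.firstHitG + 1) i with hlt | hge
  · exact γ.not_mem_hitIdx_of_betweenG h hlt h2 m1
  · have hi0 : i = γ.firstHitG + 1 := by omega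
    subst hi0
    have := γ.chain_nth (i := γ.firstHitG) (by omega)
    rw [γ.arcFace_firstHitG hr (by omega), show γ.firstHitG + 2 = γ.firstHitG + 1 + 1 by ring, hin] at this
    exact this rfl

/-- The excursion has at least two arcs. [folklore] -/
private theorem firstHit_add_three_le_returnHitG (h : γ.firstHitG + 1 < γ.arcs.length) : γ.firstHitG + 3 ≤ γ.returnHitG h := by
  by_contra hlt
  have heq : γ.returnHitG h = γ.firstHitG + 2 := by have := (γ.returnHit_memG h).2; omega
  -- then the arc `firstHitG + 1` joins two sides of `r`, hence lies in `r`
  have e1 := (γ.exitSide_specG hr (by omega)).1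
  have e2 := γ.nth_returnHitG h
  rw [heq] at e2
  have hst : γ.exitSideG hr (by omega) ≠ γ.returnSideG h := by
    intro hh
    have := γ.nth_inj (i := γ.firstHitG + 1) (j := γ.firstHitG + 2) (by omega) (by have := γ.returnHit_leG h; omega)
      (by rw [e1, e2, hh])
    omega
  refine γ.arcFace_ne_of_excursionG hr h (i := γ.firstHitG + 1) (by omega) (by omega) ?_
  rw [e1, show γ.firstHitG + 1 + 1 = γ.firstHitG + 2 by ring, e2]
  exact arcFace_side_side r _ _ hst

/-- The sides at the first crossing, the exit and the return are distinct. [folklore] -/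
private theorem sides_distinctG (h : γ.firstHitG + 1 < γ.arcs.length) :
    γ.exitSideG hr (by omega) ≠ γ.firstSideG ∧ γ.returnSideG h ≠ γ.firstSideG ∧ γ.returnSideG h ≠ γ.exitSideG hr (by omega) := by
  have hR := γ.returnHit_leG h
  have hR' := (γ.returnHit_memG h).2
  refine ⟨(γ.exitSide_specG hr (by omega)).2, fun hh => ?_, fun hh => ?_⟩
  · have := γ.nth_inj (i := γ.returnHitG h) (j := γ.firstHitG) hR (by omega)
      (by rw [γ.nth_returnHitG, γ.nth_firstHitG, hh])
    omega
  · have := γ.nth_inj (i := γ.returnHitG h) (j := γ.firstHitG + 1) hR (by omega)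
      (by rw [γ.nth_returnHitG, (γ.exitSide_specG hr (by omega)).1, hh])
    omega

/-- **The walk re-enters `r` at the return** (if it continues). [folklore] -/
private theorem arcFace_returnHitG (h : γ.firstHitG + 1 < γ.arcs.length) (h' : γ.returnHitG h < γ.arcs.length) :
    arcFace (γ.nth (γ.returnHitG h), γ.nth (γ.returnHitG h + 1)) = some r :=
  arcFace_eq_of_first_hit (by have := (γ.returnHit_memG h).2; omega) h' (γ.nth_returnHitG h)
    (γ.not_mem_hitIdx_of_betweenG h (by have := γ.firstHit_add_three_le_returnHitG hr h; omega) (by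
      have := (γ.returnHit_memG h).2; omega))

/-- The fourth side: where the walk leaves `r` after re-entering. [folklore] -/
def fourthSideG (h : γ.firstHitG + 1 < γ.arcs.length) (h' : γ.returnHitG h < γ.arcs.length) : Side :=
  Classical.choose (Classical.choose_spec (exists_sides_of_arcFace (γ.arcFace_returnHitG hr h h')))

/-- The mid-edge after the return is the fourth side, which differs from the return side. [folklore] -/
private theorem fourthSide_specG (h : γ.firstHitG + 1 < γ.arcs.length) (h' : γ.returnHitG h < γ.arcs.length) :
    γ.nth (γ.returnHitG h + 1) = r.side (γ.fourthSideG hr h h') ∧ γ.fourthSideG hr h h' ≠ γ.returnSideG h := by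
  obtain ⟨hne, h1, h2, -⟩ :=
    Classical.choose_spec (Classical.choose_spec (exists_sides_of_arcFace (γ.arcFace_returnHitG hr h h')))
  have e := r.side_injective (h1.trans (γ.nth_returnHitG h))
  exact ⟨h2.symm, fun h'' => hne (e.trans h''.symm)⟩

/-- **After re-entering, the walk stops at the fourth side**: all four sides are used. [folklore] -/
private theorem returnHit_add_one_eqG (h : γ.firstHitG + 1 < γ.arcs.length) (h' : γ.returnHitG h < γ.arcs.length) :
    γ.returnHitG h + 1 = γ.arcs.length := by
  by_contra hne
  have hlt : γ.returnHitG h + 1 < γ.arcs.length := by omega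
  -- five hits with five distinct mid-edges on the four sides of `r`
  have hR' := (γ.returnHit_memG h).2
  let idx : Fin 5 → ℕ := ![γ.firstHitG, γ.firstHitG + 1, γ.returnHitG h, γ.returnHitG h + 1, γ.arcs.length]
  let sd : Fin 5 → Side := ![γ.firstSideG, γ.exitSideG hr (by omega), γ.returnSideG h, γ.fourthSideG hr h h', sE]
  have hnth : ∀ m, γ.nth (idx m) = r.side (sd m) := by
    intro m
    fin_cases m
    · exact γ.nth_firstHitG
    · exact (γ.exitSide_specG hr (by omega)).1
    · exact γ.nth_returnHitG h
    · exact (γ.fourthSide_specG hr h h').1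
    · exact γ.nth_length
  have hidx : Function.Injective idx := by
    intro m m' e
    fin_cases m <;> fin_cases m' <;> simp [idx] at e ⊢ <;> omega
  have hle : ∀ m, idx m ≤ γ.arcs.length := by
    intro m; fin_cases m <;> simp [idx] <;> omega
  have hsd : Function.Injective sd := by
    intro m m' e
    apply hidx
    exact γ.nth_inj (hle m) (hle m') (by rw [hnth, hnth, e])
  have := Fintype.card_le_of_injective sd hsd
  simp [Fintype.card_fin] at this
  have h4 : Fintype.card Side = 4 := rfl
  omega

end Rect



end YBWalk



/-! ## The grouping argument (proof of Lemma 2.1 from the local relations and the excursion windings) -/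

namespace YBWalk

section Prefix

variable {D : Set Face} {a : MidEdge} {r : Face} {sE sE' : Side} (γ : YBWalk D a (r.side sE))
  (δ : YBWalk D a (r.side sE'))

/-- Walks agreeing up to an index beyond the first hit of one of them have the same first hit.
[folklore] -/
private theorem firstHit_eq_of_agreeG {m : ℕ} (hmγ : m ≤ γ.arcs.length) (hmδ : m ≤ δ.arcs.length)
    (hagree : ∀ i ≤ m, δ.nth i = γ.nth i) (hfh : γ.firstHitG ≤ m) : δ.firstHitG = γ.firstHitG := by
  have h1 : γ.firstHitG ∈ δ.hitIdx r := by
    obtain ⟨-, s, hs⟩ := (mem_hitIdx γ r).1 γ.firstHit_memG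
    exact (mem_hitIdx δ r).2 ⟨by omega, s, by rw [hagree _ hfh, hs]⟩
  have h2 := δ.firstHit_le_of_memG h1
  have h3 : δ.firstHitG ∈ γ.hitIdx r := by
    obtain ⟨-, s, hs⟩ := (mem_hitIdx δ r).1 δ.firstHit_memG
    exact (mem_hitIdx γ r).2 ⟨by omega, s, by rw [← hagree _ (by omega), hs]⟩
  have h4 := γ.firstHit_le_of_memG h3
  omega

/-- Walks agreeing beyond the first hit have the same first side. [folklore] -/
private theorem firstSide_eq_of_agreeG {m : ℕ} (hmγ : m ≤ γ.arcs.length) (hmδ : m ≤ δ.arcs.length)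
    (hagree : ∀ i ≤ m, δ.nth i = γ.nth i) (hfh : γ.firstHitG ≤ m) : δ.firstSideG = γ.firstSideG := by
  have e := firstHit_eq_of_agreeG γ δ hmγ hmδ hagree hfh
  apply r.side_injective
  rw [← γ.nth_firstHitG, ← δ.nth_firstHitG, e, hagree _ hfh]

/-- Walks agreeing beyond the exit have the same exit side. [folklore] -/
private theorem exitSide_eq_of_agreeG (hr : RootedFace D a r) {m : ℕ} (hmγ : m ≤ γ.arcs.length) (hmδ : m ≤ δ.arcs.length)
    (hagree : ∀ i ≤ m, δ.nth i = γ.nth i) (hfh : γ.firstHitG + 1 ≤ m) (hγ : γ.firstHitG < γ.arcs.length)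
    (hδ : δ.firstHitG < δ.arcs.length) : δ.exitSideG hr hδ = γ.exitSideG hr hγ := by
  have e := firstHit_eq_of_agreeG γ δ hmγ hmδ hagree (by omega)
  apply r.side_injective
  rw [← (γ.exitSide_specG hr hγ).1, ← (δ.exitSide_specG hr hδ).1, e, hagree _ hfh]

/-- Walks agreeing beyond the return have the same return index. [folklore] -/
private theorem returnHit_eq_of_agreeG {m : ℕ} (hmγ : m ≤ γ.arcs.length) (hmδ : m ≤ δ.arcs.length)
    (hagree : ∀ i ≤ m, δ.nth i = γ.nth i) (hγ : γ.firstHitG + 1 < γ.arcs.length)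
    (hδ : δ.firstHitG + 1 < δ.arcs.length) (hrh : γ.returnHitG hγ ≤ m) : δ.returnHitG hδ = γ.returnHitG hγ := by
  have e := firstHit_eq_of_agreeG γ δ hmγ hmδ hagree (by have := (γ.returnHit_memG hγ).2; omega)
  obtain ⟨hmem, hgt⟩ := γ.returnHit_memG hγ
  have h1 : γ.returnHitG hγ ∈ δ.laterHitsG := by
    obtain ⟨-, s, hs⟩ := (mem_hitIdx γ r).1 hmem
    exact (δ.mem_laterHitsG).2 ⟨(mem_hitIdx δ r).2 ⟨by omega, s, by rw [hagree _ hrh, hs]⟩, by omega⟩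
  have h2 : δ.returnHitG hδ ≤ γ.returnHitG hγ := Finset.min'_le _ _ h1
  obtain ⟨hmem', hgt'⟩ := δ.returnHit_memG hδ
  have h3 : δ.returnHitG hδ ∈ γ.laterHitsG := by
    obtain ⟨-, s, hs⟩ := (mem_hitIdx δ r).1 hmem'
    exact (γ.mem_laterHitsG).2 ⟨(mem_hitIdx γ r).2 ⟨by omega, s, by rw [← hagree _ (by omega), hs]⟩, by omega⟩
  have h4 : γ.returnHitG hγ ≤ δ.returnHitG hδ := Finset.min'_le _ _ h3
  omega

/-- Walks agreeing beyond the return have the same return side. [folklore] -/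
private theorem returnSide_eq_of_agreeG {m : ℕ} (hmγ : m ≤ γ.arcs.length) (hmδ : m ≤ δ.arcs.length)
    (hagree : ∀ i ≤ m, δ.nth i = γ.nth i) (hγ : γ.firstHitG + 1 < γ.arcs.length)
    (hδ : δ.firstHitG + 1 < δ.arcs.length) (hrh : γ.returnHitG hγ ≤ m) : δ.returnSideG hδ = γ.returnSideG hγ := by
  have e := returnHit_eq_of_agreeG γ δ hmγ hmδ hagree hγ hδ hrh
  apply r.side_injective
  rw [← γ.nth_returnHitG, ← δ.nth_returnHitG, e, hagree _ hrh]

end Prefix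

end YBWalk

section CR

open Classical

variable {D : Set Face} {a : MidEdge} {r : Face}

/-- The walks from the origin ending on a side of `r`, labelled by that side. [folklore] -/
abbrev ΩG (D : Set Face) (a : MidEdge) (r : Face) : Type := Σ s : Side, YBWalk D a (r.side s)

namespace ΩG

variable (ω : ΩG D a r)

/-- The walk `ω` stops at its first crossing of `∂r` (class `A`; a predicate on labelled walks, the
walk being an explicit argument). [folklore] -/
private def IsA (ω : ΩG D a r) : Prop := ω.2.firstHitG = ω.2.arcs.length

/-- The walk `ω` stops right after its first arc in `r` (class `B1`; a predicate on labelled walks).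
[folklore] -/
private def IsB1 (ω : ΩG D a r) : Prop := ω.2.firstHitG + 1 = ω.2.arcs.length

/-- The walk `ω` continues after its first arc in `r` (class `B2`; a predicate on labelled walks).
[folklore] -/
private def IsB2 (ω : ΩG D a r) : Prop := ω.2.firstHitG + 1 < ω.2.arcs.length

/-- The three classes exhaust the walks ending on `∂r`. [folklore] -/
private theorem isA_or : ω.IsA ∨ ω.IsB1 ∨ ω.IsB2 := by
  have := ω.2.firstHit_leG; unfold IsA IsB1 IsB2; omega

/-- A walk of class `A` first crosses `∂r` at its end. [folklore] -/
private theorem firstSide_of_isA (h : ω.IsA) : ω.2.firstSideG = ω.1 := by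
  apply r.side_injective
  rw [← ω.2.nth_firstHitG, show ω.2.firstHitG = ω.2.arcs.length from h, ω.2.nth_length]

/-- A walk of class `A` has no arc in `r` and crosses `∂r` only at its end. [folklore] -/
private theorem nth_ne_side_of_isA (h : ω.IsA) {i : ℕ} (hi : i < ω.2.arcs.length) (s : Side) : ω.2.nth i ≠ r.side s := by
  intro e
  have := ω.2.firstHit_le_of_memG ((YBWalk.mem_hitIdx _ r).2 ⟨hi.le, s, e⟩)
  unfold IsA at h; omega

/-- A walk of class `A` has no arc in `r`. [folklore] -/
private theorem arcFace_ne_of_isA (h : ω.IsA) {i : ℕ} (hi : i < ω.2.arcs.length) :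
    arcFace (ω.2.nth i, ω.2.nth (i + 1)) ≠ some r :=
  ω.2.arcFace_ne_of_lt_firstHitG (by unfold IsA at h; omega) hi

/-- **Extension of a walk of class `A` by an arc of `r`** to the side `z₁` (junk: `ω` itself when
not applicable). [folklore] -/
def extA (hr : RootedFace D a r) (z₁ : Side) : ΩG D a r :=
  if h : ω.IsA ∧ z₁ ≠ ω.1 then
    ⟨z₁, ω.2.snoc (r.side z₁) r (arcFace_side_side r ω.1 z₁ (Ne.symm h.2)) hr.mem
      (by
        rw [ω.2.mem_mids_iff_nth]
        rintro ⟨i, hi, e⟩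
        rcases hi.lt_or_eq with hi | rfl
        · exact ω.nth_ne_side_of_isA h.1 hi z₁ e
        · rw [ω.2.nth_length] at e; exact h.2 (r.side_injective e).symm)
      (by
        intro i hi e
        have := ω.arcFace_ne_of_isA h.1 (i := i) (by omega)
        rw [hi, ω.2.nth_length] at this
        exact this e)
      (fun _ i hi hSN => ω.arcFace_ne_of_isA h.1 hi (arcFace_of_isSN hSN))
      (fun _ i hi hWE => ω.arcFace_ne_of_isA h.1 hi (arcFace_of_isWE hWE))⟩
  else ω

/-- The label of the one-arc extension. [folklore] -/
private theorem extA_fst (hr : RootedFace D a r) {z₁ : Side} (h : ω.IsA) (hz : z₁ ≠ ω.1) : (ω.extA hr z₁).1 = z₁ := by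
  rw [extA, dif_pos ⟨h, hz⟩]

/-- The arcs of the one-arc extension. [folklore] -/
private theorem extA_snd_arcs (hr : RootedFace D a r) {z₁ : Side} (h : ω.IsA) (hz : z₁ ≠ ω.1) :
    (ω.extA hr z₁).2.arcs = ω.2.arcs ++ [(r.side ω.1, r.side z₁)] := by
  rw [extA, dif_pos ⟨h, hz⟩]; dsimp only; apply YBWalk.snoc_arcs

/-- The one-arc extension has one more arc. [folklore] -/
private theorem extA_snd_length (hr : RootedFace D a r) {z₁ : Side} (h : ω.IsA) (hz : z₁ ≠ ω.1) :
    (ω.extA hr z₁).2.arcs.length = ω.2.arcs.length + 1 := by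
  rw [ω.extA_snd_arcs hr h hz, List.length_append, List.length_singleton]

/-- The one-arc extension agrees with the walk. [folklore] -/
private theorem extA_snd_nth (hr : RootedFace D a r) {z₁ : Side} (h : ω.IsA) (hz : z₁ ≠ ω.1) {i : ℕ} (hi : i ≤ ω.2.arcs.length) :
    (ω.extA hr z₁).2.nth i = ω.2.nth i := by
  rw [extA, dif_pos ⟨h, hz⟩]; dsimp only; apply YBWalk.snoc_nth; exact hi

/-- The one-arc extension is of class `B1`. [folklore] -/
private theorem extA_isB1 (hr : RootedFace D a r) {z₁ : Side} (h : ω.IsA) (hz : z₁ ≠ ω.1) : (ω.extA hr z₁).IsB1 := by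
  unfold IsB1
  rw [YBWalk.firstHit_eq_of_agreeG ω.2 (ω.extA hr z₁).2 le_rfl (by rw [ω.extA_snd_length hr h hz]; omega)
    (fun i hi => ω.extA_snd_nth hr h hz hi) ω.2.firstHit_leG, ω.extA_snd_length hr h hz]
  unfold IsA at h; omega

/-- Two labelled walks with the same label and the same mid-edges are equal. [folklore] -/
private theorem ext_of_mids {ω ω' : ΩG D a r} (h1 : ω.1 = ω'.1) (h2 : ω.2.mids = ω'.2.mids) : ω = ω' := by
  obtain ⟨s, γ⟩ := ω
  obtain ⟨s', γ'⟩ := ω'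
  simp only at h1
  subst h1
  simp only [Sigma.mk.injEq, heq_eq_eq, true_and]
  exact YBWalk.ext h2


/-- A walk of class `B1` ends at its exit side. [folklore] -/
private theorem exitSide_of_isB1 (hr : RootedFace D a r) (h : ω.IsB1) : ω.2.exitSideG hr (by unfold IsB1 at h; omega) = ω.1 := by
  apply r.side_injective
  rw [← (ω.2.exitSide_specG hr _).1, show ω.2.firstHitG + 1 = ω.2.arcs.length from h, ω.2.nth_length]

/-- The first side of a walk of class `B1` is not its end. [folklore] -/
private theorem firstSide_ne_of_isB1 (hr : RootedFace D a r) (h : ω.IsB1) : ω.2.firstSideG ≠ ω.1 := by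
  have h2 := (ω.2.exitSide_specG hr (by unfold IsB1 at h; omega)).2
  rw [ω.exitSide_of_isB1 hr h] at h2
  exact h2.symm

/-- **The walk of class `A` under a walk of class `B1`**: drop the last arc. [folklore] -/
def baseA : ΩG D a r :=
  if h : ω.IsB1 then
    ⟨ω.2.firstSideG, (ω.2.dropLast (by unfold IsB1 at h; omega)).cast rfl (by
      rw [← ω.2.nth_firstHitG]; congr 1; unfold IsB1 at h; omega)⟩
  else ω

/-- The label of the base walk. [folklore] -/
private theorem baseA_fst (h : ω.IsB1) : (ω.baseA).1 = ω.2.firstSideG := by rw [baseA, dif_pos h]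

/-- The base walk has one arc less. [folklore] -/
private theorem baseA_snd_length (h : ω.IsB1) : (ω.baseA).2.arcs.length = ω.2.arcs.length - 1 := by
  rw [baseA, dif_pos h]; dsimp only
  rw [YBWalk.length_arcs, YBWalk.cast_mids, ← YBWalk.length_arcs]; apply YBWalk.dropLast_length

/-- The base walk agrees with the walk. [folklore] -/
private theorem baseA_snd_nth (h : ω.IsB1) {i : ℕ} (hi : i ≤ ω.2.arcs.length - 1) : (ω.baseA).2.nth i = ω.2.nth i := by
  rw [baseA, dif_pos h]; dsimp only
  rw [YBWalk.nth, YBWalk.cast_mids, ← YBWalk.nth]; apply YBWalk.dropLast_nth; exact hi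

/-- The base walk is of class `A`. [folklore] -/
private theorem baseA_isA (h : ω.IsB1) : (ω.baseA).IsA := by
  unfold IsA
  rw [YBWalk.firstHit_eq_of_agreeG ω.2 (ω.baseA).2 (m := ω.2.arcs.length - 1) (by omega)
    (by rw [ω.baseA_snd_length h]) (fun i hi => ω.baseA_snd_nth h hi) (by unfold IsB1 at h; omega),
    ω.baseA_snd_length h]
  unfold IsB1 at h; omega

/-- Extending the base walk gives back the walk. [folklore] -/
private theorem extA_baseA (hr : RootedFace D a r) (h : ω.IsB1) : (ω.baseA).extA hr ω.1 = ω := by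
  have hA := ω.baseA_isA h
  have hz : ω.1 ≠ (ω.baseA).1 := by rw [ω.baseA_fst h]; exact (ω.firstSide_ne_of_isB1 hr h).symm
  apply ext_of_mids
  · exact (ω.baseA).extA_fst hr hA hz
  · apply YBWalk.mids_ext_nth
    · rw [(ω.baseA).extA_snd_length hr hA hz, ω.baseA_snd_length h]; unfold IsB1 at h; omega
    · intro i hi
      rcases hi.lt_or_eq with hi | rfl
      · rw [(ω.baseA).extA_snd_nth hr hA hz (by rw [ω.baseA_snd_length h]; omega),
          ω.baseA_snd_nth h (by omega)]
      · have hlen : ((ω.baseA).extA hr ω.1).2.arcs.length = ω.2.arcs.length := by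
          rw [(ω.baseA).extA_snd_length hr hA hz, ω.baseA_snd_length h]; unfold IsB1 at h; omega
        have e1 := ((ω.baseA).extA hr ω.1).2.nth_length
        rw [hlen] at e1
        exact (e1.trans (congrArg r.side ((ω.baseA).extA_fst hr hA hz))).trans ω.2.nth_length.symm

/-- The base of the extension is the walk. [folklore] -/
private theorem baseA_extA (hr : RootedFace D a r) {z₁ : Side} (h : ω.IsA) (hz : z₁ ≠ ω.1) : (ω.extA hr z₁).baseA = ω := by
  have hB := ω.extA_isB1 hr h hz
  apply ext_of_mids
  · rw [(ω.extA hr z₁).baseA_fst hB, YBWalk.firstSide_eq_of_agreeG ω.2 (ω.extA hr z₁).2 le_rfl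
      (by rw [ω.extA_snd_length hr h hz]; omega) (fun i hi => ω.extA_snd_nth hr h hz hi) ω.2.firstHit_leG,
      ω.firstSide_of_isA h]
  · apply YBWalk.mids_ext_nth
    · rw [(ω.extA hr z₁).baseA_snd_length hB, ω.extA_snd_length hr h hz]; rfl
    · intro i hi
      rw [(ω.extA hr z₁).baseA_snd_nth hB (by rw [ω.extA_snd_length hr h hz]; omega), ω.extA_snd_nth hr h hz hi]

/-! #### Class `B2`: the excursion, the return, the involution -/

/-- The walk `ω` returns to `∂r` and stops there (class `B2a`; a predicate on labelled walks — e.g. the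
trivial walk is of class `A`, not `B2a`). [folklore] -/
private def IsB2a (ω : ΩG D a r) : Prop := ∃ h : ω.IsB2, ω.2.returnHitG h = ω.2.arcs.length

/-- The walk `ω` returns to `∂r`, re-enters `r` and stops at the fourth side (class `B2b`; a predicate
on labelled walks). [folklore] -/
private def IsB2b (ω : ΩG D a r) : Prop := ∃ h : ω.IsB2, ω.2.returnHitG h < ω.2.arcs.length

/-- Class `B2` splits into `B2a` and `B2b`. [folklore] -/
private theorem isB2a_or (h : ω.IsB2) : ω.IsB2a ∨ ω.IsB2b := by
  have := ω.2.returnHit_leG h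
  rcases this.lt_or_eq with h' | h'
  · exact Or.inr ⟨h, h'⟩
  · exact Or.inl ⟨h, h'⟩

/-- A walk of class `B2a` ends at its return side. [folklore] -/
private theorem returnSide_of_isB2a (h : ω.IsB2a) : ω.2.returnSideG h.1 = ω.1 := by
  apply r.side_injective
  rw [← ω.2.nth_returnHitG h.1, h.2, ω.2.nth_length]

/-- In class `B2a`, the only arc in `r` is the first one. [folklore] -/
private theorem arcFace_ne_of_isB2a (hr : RootedFace D a r) (h : ω.IsB2a) {i : ℕ} (hi : i < ω.2.arcs.length) (hne : i ≠ ω.2.firstHitG) :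
    arcFace (ω.2.nth i, ω.2.nth (i + 1)) ≠ some r := by
  rcases Nat.lt_or_gt_of_ne hne with hlt | hgt
  · exact ω.2.arcFace_ne_of_lt_firstHitG hlt hi
  · exact ω.2.arcFace_ne_of_excursionG hr h.1 hgt (by rw [h.2]; exact hi)

/-- In class `B2a`, `r` carries exactly the first arc. [folklore] -/
private theorem kindsIn_of_isB2a (hr : RootedFace D a r) (h : ω.IsB2a) :
    ω.2.kindsIn r = [arcKind ω.2.firstSideG (ω.2.exitSideG hr (by have := h.1; unfold IsB2 at this; omega))] := by
  have hfh : ω.2.firstHitG < ω.2.arcs.length := by have := h.1; unfold IsB2 at this; omega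
  rw [YBWalk.kindsIn_eq]
  -- split the arcs at the first hit
  conv_lhs => rw [YBWalk.list_eq_take_cons_drop ω.2.arcs hfh, List.filterMap_append, List.filterMap_append]
  have h0 : ∀ p ∈ ω.2.arcs.take ω.2.firstHitG ++ ω.2.arcs.drop (ω.2.firstHitG + 1), kindF r p = none := by
    intro p hp
    rw [List.mem_append] at hp
    rcases hp with hp | hp
    · obtain ⟨i, hi, rfl⟩ := List.mem_iff_getElem.1 hp
      rw [List.length_take] at hi
      rw [List.getElem_take, ω.2.arcs_getElem_eq_nth (by omega)]
      exact kindF_of_ne (ω.arcFace_ne_of_isB2a hr h (by omega) (by omega))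
    · obtain ⟨i, hi, rfl⟩ := List.mem_iff_getElem.1 hp
      rw [List.length_drop] at hi
      rw [List.getElem_drop, ω.2.arcs_getElem_eq_nth (by omega)]
      exact kindF_of_ne (ω.arcFace_ne_of_isB2a hr h (by omega) (by omega))
  rw [List.filterMap_eq_nil_iff.2 fun p hp => h0 p (List.mem_append_left _ hp),
    List.filterMap_eq_nil_iff.2 fun p hp => h0 p (List.mem_append_right _ hp),
    ω.2.arcs_getElem_eq_nth hfh, ω.2.nth_firstHitG, (ω.2.exitSide_specG hr hfh).1]
  simp [kindF_side_side r (ω.2.exitSide_specG hr hfh).2.symm]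

/-- **The involution**: reverse the part of the walk after its first crossing of `∂r`. [folklore] -/
def rev (hr : RootedFace D a r) : ΩG D a r :=
  if h : ω.IsB2a then
    ⟨ω.2.exitSideG hr (by have := h.1; unfold IsB2 at this; omega),
      (ω.2.revSuffix ω.2.firstHitG (by have := h.1; unfold IsB2 at this; omega) r
        (by
          rw [ω.2.nth_firstHitG]
          refine arcFace_side_side r _ _ fun e => ?_
          have := (ω.2.sides_distinctG hr h.1).2.1
          rw [ω.returnSide_of_isB2a h] at this
          exact this e.symm)
        hr.mem (fun i hi hne => ω.arcFace_ne_of_isB2a hr h hi hne)).cast rfl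
        (ω.2.exitSide_specG hr _).1⟩
  else ω

/-- The reversed walk ends at the exit side. [folklore] -/
private theorem rev_fst (hr : RootedFace D a r) (h : ω.IsB2a) : (ω.rev hr).1 = ω.2.exitSideG hr (by have := h.1; unfold IsB2 at this; omega) := by
  rw [rev, dif_pos h]

/-- Reversal keeps the number of arcs. [folklore] -/
private theorem rev_snd_length (hr : RootedFace D a r) (h : ω.IsB2a) : (ω.rev hr).2.arcs.length = ω.2.arcs.length := by
  rw [rev, dif_pos h]; dsimp only
  rw [YBWalk.length_arcs, YBWalk.cast_mids, ← YBWalk.length_arcs]; apply YBWalk.revSuffix_length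

/-- `nth` of the reversed walk. [folklore] -/
private theorem rev_snd_nth (hr : RootedFace D a r) (h : ω.IsB2a) {i : ℕ} (hi : i ≤ ω.2.arcs.length) :
    (ω.rev hr).2.nth i = if i ≤ ω.2.firstHitG then ω.2.nth i else ω.2.nth (ω.2.arcs.length + ω.2.firstHitG + 1 - i) := by
  rw [rev, dif_pos h]; dsimp only
  rw [YBWalk.nth, YBWalk.cast_mids, ← YBWalk.nth]; apply YBWalk.revSuffix_nth; exact hi

/-- The arcs of the reversed walk. [folklore] -/
private theorem rev_snd_arcs (hr : RootedFace D a r) (h : ω.IsB2a) :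
    (ω.rev hr).2.arcs = ω.2.arcs.take ω.2.firstHitG ++ [(ω.2.nth ω.2.firstHitG, r.side ω.1)] ++
      ((ω.2.arcs.drop (ω.2.firstHitG + 1)).reverse.map Prod.swap) := by
  rw [rev, dif_pos h]; dsimp only
  rw [YBWalk.arcs, YBWalk.cast_mids, ← YBWalk.arcs]; apply YBWalk.revSuffix_arcs

/-- Reversal has no fixed point. [folklore] -/
private theorem rev_ne (hr : RootedFace D a r) (h : ω.IsB2a) : ω.rev hr ≠ ω := by
  intro e
  have h1 := congrArg Sigma.fst e
  rw [ω.rev_fst hr h] at h1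
  have := (ω.2.sides_distinctG hr h.1).2.2
  rw [ω.returnSide_of_isB2a h] at this
  exact this h1.symm

/-- Reversal keeps the first hit. [folklore] -/
private theorem rev_firstHit (hr : RootedFace D a r) (h : ω.IsB2a) : (ω.rev hr).2.firstHitG = ω.2.firstHitG :=
  YBWalk.firstHit_eq_of_agreeG ω.2 (ω.rev hr).2 (m := ω.2.firstHitG) ω.2.firstHit_leG
    (by rw [ω.rev_snd_length hr h]; exact ω.2.firstHit_leG)
    (fun i hi => by rw [ω.rev_snd_nth hr h (hi.trans ω.2.firstHit_leG), if_pos hi]) le_rfl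

/-- Reversal keeps the first side. [folklore] -/
private theorem rev_firstSide (hr : RootedFace D a r) (h : ω.IsB2a) : (ω.rev hr).2.firstSideG = ω.2.firstSideG :=
  YBWalk.firstSide_eq_of_agreeG ω.2 (ω.rev hr).2 (m := ω.2.firstHitG) ω.2.firstHit_leG
    (by rw [ω.rev_snd_length hr h]; exact ω.2.firstHit_leG)
    (fun i hi => by rw [ω.rev_snd_nth hr h (hi.trans ω.2.firstHit_leG), if_pos hi]) le_rfl

/-- The reversed walk is of class `B2`. [folklore] -/
private theorem rev_isB2 (hr : RootedFace D a r) (h : ω.IsB2a) : (ω.rev hr).IsB2 := by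
  unfold IsB2; rw [ω.rev_firstHit hr h, ω.rev_snd_length hr h]; exact h.1

/-- The reversed walk returns to `∂r` only at its end. [folklore] -/
private theorem rev_returnHit (hr : RootedFace D a r) (h : ω.IsB2a) : (ω.rev hr).2.returnHitG (ω.rev_isB2 hr h) = (ω.rev hr).2.arcs.length := by
  have hB := ω.rev_isB2 hr h
  apply le_antisymm ((ω.rev hr).2.returnHit_leG _)
  by_contra hlt
  push Not at hlt
  obtain ⟨hmem, hgt⟩ := (ω.rev hr).2.returnHit_memG hB
  rw [ω.rev_firstHit hr h] at hgt
  rw [ω.rev_snd_length hr h] at hlt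
  obtain ⟨-, s, hs⟩ := (YBWalk.mem_hitIdx _ r).1 hmem
  rw [ω.rev_snd_nth hr h hlt.le, if_neg (by omega)] at hs
  -- an interior index of the excursion would be a hit of `ω`
  have hi : ω.2.firstHitG + 1 < ω.2.arcs.length + ω.2.firstHitG + 1 - (ω.rev hr).2.returnHitG hB := by omega
  have hi' : ω.2.arcs.length + ω.2.firstHitG + 1 - (ω.rev hr).2.returnHitG hB < ω.2.returnHitG h.1 := by
    rw [h.2]; omega
  exact ω.2.not_mem_hitIdx_of_betweenG h.1 hi hi' ((YBWalk.mem_hitIdx _ r).2 ⟨by omega, s, hs⟩)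

/-- The reversed walk is of class `B2a`. [folklore] -/
private theorem rev_isB2a (hr : RootedFace D a r) (h : ω.IsB2a) : (ω.rev hr).IsB2a := ⟨ω.rev_isB2 hr h, ω.rev_returnHit hr h⟩

/-- The exit side of the reversed walk is the return side. [folklore] -/
private theorem rev_exitSide (hr : RootedFace D a r) (h : ω.IsB2a) :
    (ω.rev hr).2.exitSideG hr (by have := (ω.rev_isB2 hr h); unfold IsB2 at this; omega) = ω.1 := by
  apply r.side_injective
  rw [← ((ω.rev hr).2.exitSide_specG hr _).1, ω.rev_firstHit hr h,
    ω.rev_snd_nth hr h (by have := h.1; unfold IsB2 at this; omega), if_neg (by omega),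
    show ω.2.arcs.length + ω.2.firstHitG + 1 - (ω.2.firstHitG + 1) = ω.2.arcs.length by omega, ω.2.nth_length]

/-- **Reversal is an involution.** [folklore] -/
private theorem rev_rev (hr : RootedFace D a r) (h : ω.IsB2a) : (ω.rev hr).rev hr = ω := by
  have h' := ω.rev_isB2a hr h
  apply ext_of_mids
  · rw [(ω.rev hr).rev_fst hr h', ω.rev_exitSide hr h]
  · apply YBWalk.mids_ext_nth
    · rw [(ω.rev hr).rev_snd_length hr h', ω.rev_snd_length hr h]
    · intro i hi
      rw [(ω.rev hr).rev_snd_nth hr h' (by rw [ω.rev_snd_length hr h]; exact hi), ω.rev_firstHit hr h,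
        ω.rev_snd_length hr h]
      by_cases hi' : i ≤ ω.2.firstHitG
      · rw [if_pos hi', ω.rev_snd_nth hr h hi, if_pos hi']
      · rw [if_neg hi', ω.rev_snd_nth hr h (by omega), if_neg (by omega)]
        congr 1; omega

/-! #### Class `B2b` over class `B2a`: the second arc in `r` -/

/-- The hits of a walk of class `B2a`. [folklore] -/
private theorem hit_cases_of_isB2a (h : ω.IsB2a) {i : ℕ} (hi : i ∈ ω.2.hitIdx r) :
    i = ω.2.firstHitG ∨ i = ω.2.firstHitG + 1 ∨ i = ω.2.arcs.length := by
  have h1 := ω.2.firstHit_le_of_memG hi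
  have h2 := ((YBWalk.mem_hitIdx _ r).1 hi).1
  by_contra hne
  push Not at hne
  have hlt : ω.2.firstHitG + 1 < i := by omega
  exact ω.2.not_mem_hitIdx_of_betweenG h.1 hlt (by rw [h.2]; omega) hi





/-- The first arc of the walk in `r` is not straight. [folklore] -/
private def IsNS (hr : RootedFace D a r) : Prop :=
  ∃ h : ω.IsB2a, arcKind ω.2.firstSideG (ω.2.exitSideG hr (by have := h.1; unfold IsB2 at this; omega)) ≠ .straight

/-- The fourth side for a walk of class `B2a`. [folklore] -/
def z₃ (hr : RootedFace D a r) (h : ω.IsB2a) : Side :=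
  Side.fourth ω.2.firstSideG (ω.2.exitSideG hr (by have := h.1; unfold IsB2 at this; omega)) ω.1

/-- The fourth side differs from the first three. [folklore] -/
private theorem z₃_spec (hr : RootedFace D a r) (h : ω.IsB2a) :
    ω.z₃ hr h ≠ ω.2.firstSideG ∧ ω.z₃ hr h ≠ ω.2.exitSideG hr (by have := h.1; unfold IsB2 at this; omega) ∧
      ω.z₃ hr h ≠ ω.1 := by
  have hd := ω.2.sides_distinctG hr h.1
  rw [ω.returnSide_of_isB2a h] at hd
  obtain ⟨h1, h2, h3, -⟩ := Side.fourth_spec hd.1.symm hd.2.1.symm hd.2.2.symm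
  exact ⟨h1, h2, h3⟩

/-- **Extension of a walk of class `B2a` by the second arc of `r`** (when the first one is not
straight; junk otherwise). [folklore] -/
def ext₃ (hr : RootedFace D a r) : ΩG D a r :=
  if h : ω.IsNS hr then
    ⟨ω.z₃ hr h.1, ω.2.snoc (r.side (ω.z₃ hr h.1)) r (arcFace_side_side r _ _ (ω.z₃_spec hr h.1).2.2.symm) hr.mem
      (by
        rw [ω.2.mem_mids_iff_nth]
        rintro ⟨i, hi, e⟩
        have hsp := ω.z₃_spec hr h.1
        rcases ω.hit_cases_of_isB2a h.1 ((YBWalk.mem_hitIdx _ r).2 ⟨hi, _, e⟩) with rfl | rfl | rfl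
        · rw [ω.2.nth_firstHitG] at e; exact hsp.1 (r.side_injective e).symm
        · rw [(ω.2.exitSide_specG hr (by omega)).1] at e; exact hsp.2.1 (r.side_injective e).symm
        · rw [ω.2.nth_length] at e; exact hsp.2.2 (r.side_injective e).symm)
      (by
        intro i hi
        have := ω.arcFace_ne_of_isB2a hr h.1 (i := i) (by omega) (by have := h.1.1; unfold IsB2 at this; omega)
        rwa [hi, ω.2.nth_length] at this)
      (by
        intro _ i hi hSN
        have hin := arcFace_of_isSN hSN
        have : i = ω.2.firstHitG := by
          by_contra hne; exact ω.arcFace_ne_of_isB2a hr h.1 hi hne hin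
        subst this
        rw [ω.2.nth_firstHitG, (ω.2.exitSide_specG hr hi).1] at hSN
        exact h.2 (arcKind_of_isSN hSN))
      (by
        intro _ i hi hWE
        have hin := arcFace_of_isWE hWE
        have : i = ω.2.firstHitG := by
          by_contra hne; exact ω.arcFace_ne_of_isB2a hr h.1 hi hne hin
        subst this
        rw [ω.2.nth_firstHitG, (ω.2.exitSide_specG hr hi).1] at hWE
        exact h.2 (arcKind_of_isWE hWE))⟩
  else ω

/-- The label of the two-arc extension. [folklore] -/
private theorem ext₃_fst (hr : RootedFace D a r) (h : ω.IsNS hr) : (ω.ext₃ hr).1 = ω.z₃ hr h.1 := by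
  rw [ext₃, dif_pos h]

/-- The arcs of the two-arc extension. [folklore] -/
private theorem ext₃_snd_arcs (hr : RootedFace D a r) (h : ω.IsNS hr) :
    (ω.ext₃ hr).2.arcs = ω.2.arcs ++ [(r.side ω.1, r.side (ω.z₃ hr h.1))] := by
  rw [ext₃, dif_pos h]; dsimp only; apply YBWalk.snoc_arcs

/-- The two-arc extension has one more arc. [folklore] -/
private theorem ext₃_snd_length (hr : RootedFace D a r) (h : ω.IsNS hr) :
    (ω.ext₃ hr).2.arcs.length = ω.2.arcs.length + 1 := by
  rw [ω.ext₃_snd_arcs hr h, List.length_append, List.length_singleton]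

/-- The two-arc extension agrees with the walk. [folklore] -/
private theorem ext₃_snd_nth (hr : RootedFace D a r) (h : ω.IsNS hr) {i : ℕ} (hi : i ≤ ω.2.arcs.length) :
    (ω.ext₃ hr).2.nth i = ω.2.nth i := by
  rw [ext₃, dif_pos h]; dsimp only; apply YBWalk.snoc_nth; exact hi

/-- The two-arc extension is of class `B2b`. [folklore] -/
private theorem ext₃_isB2b (hr : RootedFace D a r) (h : ω.IsNS hr) : (ω.ext₃ hr).IsB2b := by
  have hB2 : ω.2.firstHitG + 1 < ω.2.arcs.length := h.1.1
  have hagree := fun i hi => ω.ext₃_snd_nth hr h (i := i) hi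
  have hl := ω.ext₃_snd_length hr h
  have e1 := YBWalk.firstHit_eq_of_agreeG ω.2 (ω.ext₃ hr).2 le_rfl (by rw [hl]; omega) hagree ω.2.firstHit_leG
  have hB2' : (ω.ext₃ hr).IsB2 := by unfold IsB2; rw [e1, hl]; omega
  refine ⟨hB2', ?_⟩
  rw [YBWalk.returnHit_eq_of_agreeG ω.2 (ω.ext₃ hr).2 le_rfl (by rw [hl]; omega) hagree hB2 hB2' (ω.2.returnHit_leG _),
    h.1.2, hl]
  omega

/-- A walk of class `B2b` ends at its fourth side. [folklore] -/
private theorem fourthSide_of_isB2b (hr : RootedFace D a r) (h : ω.IsB2b) : ω.2.fourthSideG hr h.1 h.2 = ω.1 := by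
  apply r.side_injective
  rw [← (ω.2.fourthSide_specG hr h.1 h.2).1, ω.2.returnHit_add_one_eqG hr h.1 h.2, ω.2.nth_length]

/-- In class `B2b` the two arcs in `r` are not straight. [folklore] -/
private theorem not_straight_of_isB2b (hr : RootedFace D a r) (h : ω.IsB2b) :
    arcKind ω.2.firstSideG (ω.2.exitSideG hr (by have := h.1; unfold IsB2 at this; omega)) ≠ .straight := by
  intro hs
  have hfh : ω.2.firstHitG < ω.2.arcs.length := by have := h.1; unfold IsB2 at this; omega
  have hd := ω.2.sides_distinctG hr h.1
  have h4 := (ω.2.fourthSide_specG hr h.1 h.2).2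
  -- the fourth side differs from the first three
  have hR := ω.2.returnHit_leG h.1
  have hR' := (ω.2.returnHit_memG h.1).2
  have e4 := (ω.2.fourthSide_specG hr h.1 h.2).1
  have hlt := h.2
  have h40 : ω.2.fourthSideG hr h.1 h.2 ≠ ω.2.firstSideG := fun hh => by
    have := ω.2.nth_inj (i := ω.2.returnHitG h.1 + 1) (j := ω.2.firstHitG) (by omega) (by omega)
      (by rw [e4, ω.2.nth_firstHitG, hh])
    omega
  have h41 : ω.2.fourthSideG hr h.1 h.2 ≠ ω.2.exitSideG hr hfh := fun hh => by
    have := ω.2.nth_inj (i := ω.2.returnHitG h.1 + 1) (j := ω.2.firstHitG + 1) (by omega) (by omega)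
      (by rw [e4, (ω.2.exitSide_specG hr hfh).1, hh])
    omega
  rcases straight_compl hd.1.symm hd.2.1.symm h40.symm hd.2.2.symm h41.symm h4.symm hs r with ⟨hWE, hSN⟩ | ⟨hSN, hWE⟩
  · refine ω.2.nc_nth hfh h.2 r ?_ ?_
    · rwa [ω.2.nth_firstHitG, (ω.2.exitSide_specG hr hfh).1]
    · rwa [ω.2.nth_returnHitG, e4]
  · refine ω.2.nc_nth h.2 hfh r ?_ ?_
    · rwa [ω.2.nth_returnHitG, e4]
    · rwa [ω.2.nth_firstHitG, (ω.2.exitSide_specG hr hfh).1]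

/-- **The walk of class `B2a` under a walk of class `B2b`**: drop the last arc. [folklore] -/
def base₂ (hr : RootedFace D a r) : ΩG D a r :=
  if h : ω.IsB2b then
    ⟨ω.2.returnSideG h.1, (ω.2.dropLast (by have := h.2; omega)).cast rfl (by
      rw [← ω.2.nth_returnHitG h.1]; congr 1
      have := ω.2.returnHit_add_one_eqG hr h.1 h.2; omega)⟩
  else ω

/-- The label of the base walk of class `B2a`. [folklore] -/
private theorem base₂_fst (hr : RootedFace D a r) (h : ω.IsB2b) : (ω.base₂ hr).1 = ω.2.returnSideG h.1 := by
  rw [base₂, dif_pos h]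

/-- The base walk has one arc less. [folklore] -/
private theorem base₂_snd_length (hr : RootedFace D a r) (h : ω.IsB2b) : (ω.base₂ hr).2.arcs.length = ω.2.arcs.length - 1 := by
  rw [base₂, dif_pos h]; dsimp only
  rw [YBWalk.length_arcs, YBWalk.cast_mids, ← YBWalk.length_arcs]; apply YBWalk.dropLast_length

/-- The base walk agrees with the walk. [folklore] -/
private theorem base₂_snd_nth (hr : RootedFace D a r) (h : ω.IsB2b) {i : ℕ} (hi : i ≤ ω.2.arcs.length - 1) :
    (ω.base₂ hr).2.nth i = ω.2.nth i := by
  rw [base₂, dif_pos h]; dsimp only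
  rw [YBWalk.nth, YBWalk.cast_mids, ← YBWalk.nth]; apply YBWalk.dropLast_nth; exact hi

/-- The base walk ends at the return. [folklore] -/
private theorem base₂_length_eq (hr : RootedFace D a r) (h : ω.IsB2b) : (ω.base₂ hr).2.arcs.length = ω.2.returnHitG h.1 := by
  rw [ω.base₂_snd_length hr h]; have := ω.2.returnHit_add_one_eqG hr h.1 h.2; omega

/-- The base walk has the same first hit. [folklore] -/
private theorem base₂_firstHit (hr : RootedFace D a r) (h : ω.IsB2b) : (ω.base₂ hr).2.firstHitG = ω.2.firstHitG :=
  YBWalk.firstHit_eq_of_agreeG ω.2 (ω.base₂ hr).2 (m := ω.2.arcs.length - 1) (by omega)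
    (by rw [ω.base₂_snd_length hr h]) (fun i hi => ω.base₂_snd_nth hr h hi)
    (by have := h.1; unfold IsB2 at this; omega)

/-- The base walk is of class `B2`. [folklore] -/
private theorem base₂_isB2 (hr : RootedFace D a r) (h : ω.IsB2b) : (ω.base₂ hr).IsB2 := by
  unfold IsB2
  rw [ω.base₂_firstHit hr h, ω.base₂_length_eq hr h]
  have := ω.2.firstHit_add_three_le_returnHitG hr h.1; omega

/-- The base walk has the same return index. [folklore] -/
private theorem base₂_returnHit (hr : RootedFace D a r) (h : ω.IsB2b) :
    (ω.base₂ hr).2.returnHitG (ω.base₂_isB2 hr h) = ω.2.returnHitG h.1 :=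
  YBWalk.returnHit_eq_of_agreeG ω.2 (ω.base₂ hr).2 (m := ω.2.arcs.length - 1) (by omega)
    (by rw [ω.base₂_snd_length hr h]) (fun i hi => ω.base₂_snd_nth hr h hi) h.1 _
    (by have := ω.2.returnHit_add_one_eqG hr h.1 h.2; omega)

/-- The base walk is of class `B2a`. [folklore] -/
private theorem base₂_isB2a (hr : RootedFace D a r) (h : ω.IsB2b) : (ω.base₂ hr).IsB2a :=
  ⟨ω.base₂_isB2 hr h, by rw [ω.base₂_returnHit hr h, ω.base₂_length_eq hr h]⟩

/-- The base walk has the same first side. [folklore] -/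
private theorem base₂_firstSide (hr : RootedFace D a r) (h : ω.IsB2b) : (ω.base₂ hr).2.firstSideG = ω.2.firstSideG :=
  YBWalk.firstSide_eq_of_agreeG ω.2 (ω.base₂ hr).2 (m := ω.2.arcs.length - 1) (by omega)
    (by rw [ω.base₂_snd_length hr h]) (fun i hi => ω.base₂_snd_nth hr h hi)
    (by have := h.1; unfold IsB2 at this; omega)

/-- The base walk has the same exit side. [folklore] -/
private theorem base₂_exitSide (hr : RootedFace D a r) (h : ω.IsB2b) :
    (ω.base₂ hr).2.exitSideG hr (by have := ω.base₂_isB2 hr h; unfold IsB2 at this; omega) =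
      ω.2.exitSideG hr (by have := h.1; unfold IsB2 at this; omega) :=
  YBWalk.exitSide_eq_of_agreeG ω.2 (ω.base₂ hr).2 hr (m := ω.2.arcs.length - 1) (by omega)
    (by rw [ω.base₂_snd_length hr h]) (fun i hi => ω.base₂_snd_nth hr h hi)
    (by have := h.1; unfold IsB2 at this; omega) _ _

/-- The first arc of the base walk is not straight. [folklore] -/
private theorem base₂_isNS (hr : RootedFace D a r) (h : ω.IsB2b) : (ω.base₂ hr).IsNS hr := by
  refine ⟨ω.base₂_isB2a hr h, ?_⟩
  rw [ω.base₂_firstSide hr h, ω.base₂_exitSide hr h]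
  exact ω.not_straight_of_isB2b hr h

/-- The fourth side of the base walk is the end of the walk. [folklore] -/
private theorem base₂_z₃ (hr : RootedFace D a r) (h : ω.IsB2b) : (ω.base₂ hr).z₃ hr (ω.base₂_isB2a hr h) = ω.1 := by
  unfold z₃
  rw [ω.base₂_firstSide hr h, ω.base₂_exitSide hr h, ω.base₂_fst hr h]
  have hfh : ω.2.firstHitG < ω.2.arcs.length := by have := h.1; unfold IsB2 at this; omega
  have hd := ω.2.sides_distinctG hr h.1
  have h4 := (ω.2.fourthSide_specG hr h.1 h.2).2
  have hR := ω.2.returnHit_leG h.1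
  have hR' := (ω.2.returnHit_memG h.1).2
  have e4 := (ω.2.fourthSide_specG hr h.1 h.2).1
  have hlt := h.2
  have h40 : ω.2.fourthSideG hr h.1 h.2 ≠ ω.2.firstSideG := fun hh => by
    have := ω.2.nth_inj (i := ω.2.returnHitG h.1 + 1) (j := ω.2.firstHitG) (by omega) (by omega)
      (by rw [e4, ω.2.nth_firstHitG, hh])
    omega
  have h41 : ω.2.fourthSideG hr h.1 h.2 ≠ ω.2.exitSideG hr hfh := fun hh => by
    have := ω.2.nth_inj (i := ω.2.returnHitG h.1 + 1) (j := ω.2.firstHitG + 1) (by omega) (by omega)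
      (by rw [e4, (ω.2.exitSide_specG hr hfh).1, hh])
    omega
  have key := (Side.fourth_spec hd.1.symm hd.2.1.symm hd.2.2.symm).2.2.2 _ h40 h41 h4
  -- `fourthSideG = ω.1`
  have e := ω.fourthSide_of_isB2b hr h
  rw [e] at key
  exact key.symm

/-- Extending the base walk gives back the walk. [folklore] -/
private theorem ext₃_base₂ (hr : RootedFace D a r) (h : ω.IsB2b) : (ω.base₂ hr).ext₃ hr = ω := by
  have hN := ω.base₂_isNS hr h
  have hlen : ((ω.base₂ hr).ext₃ hr).2.arcs.length = ω.2.arcs.length := by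
    rw [(ω.base₂ hr).ext₃_snd_length hr hN, ω.base₂_snd_length hr h]; have := h.2; omega
  apply ext_of_mids
  · rw [(ω.base₂ hr).ext₃_fst hr hN, ω.base₂_z₃ hr h]
  · apply YBWalk.mids_ext_nth _ _ hlen
    intro i hi
    rcases hi.lt_or_eq with hi | rfl
    · rw [(ω.base₂ hr).ext₃_snd_nth hr hN (by rw [ω.base₂_snd_length hr h]; omega), ω.base₂_snd_nth hr h (by omega)]
    · have e1 := ((ω.base₂ hr).ext₃ hr).2.nth_length
      rw [hlen] at e1
      exact (e1.trans (congrArg r.side (((ω.base₂ hr).ext₃_fst hr hN).trans (ω.base₂_z₃ hr h)))).trans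
        ω.2.nth_length.symm

/-- The base of the extension is the walk. [folklore] -/
private theorem base₂_ext₃ (hr : RootedFace D a r) (h : ω.IsNS hr) : (ω.ext₃ hr).base₂ hr = ω := by
  have hB := ω.ext₃_isB2b hr h
  have hagree := fun i hi => ω.ext₃_snd_nth hr h (i := i) hi
  have hl := ω.ext₃_snd_length hr h
  apply ext_of_mids
  · rw [(ω.ext₃ hr).base₂_fst hr hB,
      YBWalk.returnSide_eq_of_agreeG ω.2 (ω.ext₃ hr).2 le_rfl (by rw [hl]; omega) hagree h.1.1 hB.1
        (ω.2.returnHit_leG _), ω.returnSide_of_isB2a h.1]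
  · apply YBWalk.mids_ext_nth
    · rw [(ω.ext₃ hr).base₂_snd_length hr hB, hl]; rfl
    · intro i hi
      rw [(ω.ext₃ hr).base₂_snd_nth hr hB (by rw [hl]; omega), hagree i hi]

end ΩG

namespace ΩG

variable (ω : ΩG D a r) (Θ : ℤ → ℝ)

/-- The summand of the vertex relation: `c(z) · (complex weight)`. [folklore] -/
def g : ℂ := crCoef (Θ r.1) ω.1 * ω.2.paraWeight Θ

/-- In class `A`, `r` carries no arc. [folklore] -/
private theorem kindsIn_of_isA (h : ω.IsA) : ω.2.kindsIn r = [] := by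
  rw [YBWalk.kindsIn_eq, List.filterMap_eq_nil_iff]
  intro p hp
  obtain ⟨i, hi, rfl⟩ := (ω.2.mem_arcs_iff_nth).1 hp
  exact kindF_of_ne (ω.arcFace_ne_of_isA h hi)

/-- **Weight of the one-arc extension**: `w · u(z₀z₁) · e^{-iσ(W + t(z₀z₁))}`. [folklore] -/
private theorem paraWeight_extA (hr : RootedFace D a r) {z₁ : Side} (h : ω.IsA) (hz : z₁ ≠ ω.1) :
    (ω.extA hr z₁).2.paraWeight Θ =
      ω.2.paraWeight Θ * (arcWeight (Θ r.1) ω.1 z₁ : ℂ) * phase (arcTurn (Θ r.1) ω.1 z₁) := by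
  have harcs := ω.extA_snd_arcs hr h hz
  have hface : arcFace (r.side ω.1, r.side z₁) = some r := arcFace_side_side r _ _ hz.symm
  rw [(ω.extA hr z₁).2.paraWeight_eq Θ r, ω.2.paraWeight_eq Θ r,
    YBWalk.extWeight_of_snoc ω.2 (ω.extA hr z₁).2 r harcs hface,
    YBWalk.kindsIn_of_snoc ω.2 (ω.extA hr z₁).2 r harcs hface,
    YBWalk.winding_of_snoc ω.2 (ω.extA hr z₁).2 harcs, ω.kindsIn_of_isA h,
    arcKindOf_eq hface rfl rfl, arcTurnOf_side_side Θ r hz.symm, phase_add]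
  simp [List.reduceOption, localWeight, arcWeight]
  ring

/-! #### Weights in class `B2a` -/

section B2a

variable (hr : RootedFace D a r)

/-- The winding of the prefix before the first crossing. [folklore] -/
def WP : ℝ := ((ω.2.arcs.take ω.2.firstHitG).map (arcTurnOf Θ)).sum

/-- The winding of the excursion (everything after the first arc in `r`). [folklore] -/
def WE : ℝ := ((ω.2.arcs.drop (ω.2.firstHitG + 1)).map (arcTurnOf Θ)).sum

/-- In class `B2a` the walk continues after its first hit. [folklore] -/
private theorem fh_lt (h : ω.IsB2a) : ω.2.firstHitG < ω.2.arcs.length := by have := h.1; unfold IsB2 at this; omega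

/-- The first arc in `r`, as a pair of sides. [folklore] -/
private theorem arcs_fh (h : ω.IsB2a) :
    ω.2.arcs[ω.2.firstHitG]'(ω.fh_lt h) = (r.side ω.2.firstSideG, r.side (ω.2.exitSideG hr (ω.fh_lt h))) := by
  rw [ω.2.arcs_getElem_eq_nth, ω.2.nth_firstHitG, (ω.2.exitSide_specG hr _).1]

/-- **Weight in class `B2a`.** [folklore] -/
private theorem paraWeight_of_isB2a (h : ω.IsB2a) :
    ω.2.paraWeight Θ = (ω.2.extWeight Θ r : ℂ) * (arcWeight (Θ r.1) ω.2.firstSideG (ω.2.exitSideG hr (ω.fh_lt h)) : ℂ) *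
      phase (ω.WP Θ + arcTurn (Θ r.1) ω.2.firstSideG (ω.2.exitSideG hr (ω.fh_lt h)) + ω.WE Θ) := by
  rw [ω.2.paraWeight_eq Θ r, ω.kindsIn_of_isB2a hr h, ω.2.winding_orig_split ω.2.firstHitG (ω.fh_lt h) Θ, ω.arcs_fh hr h,
    arcTurnOf_side_side Θ r (ω.2.exitSide_specG hr _).2.symm]
  rfl

/-- Reversal keeps the exterior weight. [folklore] -/
private theorem rev_extWeight (h : ω.IsB2a) : (ω.rev hr).2.extWeight Θ r = ω.2.extWeight Θ r :=
  YBWalk.extWeight_of_revSuffix ω.2 (ω.rev hr).2 r ω.2.firstHitG _ (ω.rev_snd_arcs hr h)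
    (by
      rw [ω.2.nth_firstHitG]
      refine arcFace_side_side r _ _ fun e => ?_
      have := (ω.2.sides_distinctG hr h.1).2.1
      rw [ω.returnSide_of_isB2a h] at this
      exact this e.symm)
    (ω.fh_lt h) (by rw [ω.arcs_fh hr h]; exact arcFace_side_side r _ _ (ω.2.exitSide_specG hr _).2.symm) Θ

/-- Reversal keeps the winding of the prefix. [folklore] -/
private theorem rev_WP (h : ω.IsB2a) : (ω.rev hr).WP Θ = ω.WP Θ := by
  unfold WP
  rw [ω.rev_firstHit hr h, ω.rev_snd_arcs hr h, List.append_assoc,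
    List.take_append_of_le_length (by simpa using (ω.fh_lt h).le), List.take_take, min_self]

/-- **Reversal negates the winding of the excursion.** [folklore] -/
private theorem rev_WE (h : ω.IsB2a) : (ω.rev hr).WE Θ = -ω.WE Θ := by
  unfold WE
  rw [ω.rev_firstHit hr h, ω.rev_snd_arcs hr h,
    List.drop_append_of_le_length (by simp; exact (ω.fh_lt h).le)]
  have hl : (ω.2.arcs.take ω.2.firstHitG ++ [(ω.2.nth ω.2.firstHitG, r.side ω.1)]).length = ω.2.firstHitG + 1 := by
    simp; exact (ω.fh_lt h).le
  rw [List.drop_eq_nil_of_le (by rw [hl]), List.nil_append, YBWalk.sum_map_arcTurnOf_swap]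

/-- The first side of a walk of class `B2a` is not its end. [folklore] -/
private theorem firstSide_ne_fst (h : ω.IsB2a) : ω.2.firstSideG ≠ ω.1 := by
  intro e
  have := ω.2.nth_inj (i := ω.2.firstHitG) (j := ω.2.arcs.length) ω.2.firstHit_leG le_rfl
    (by rw [ω.2.nth_firstHitG, e, ω.2.nth_length])
  have := ω.fh_lt h; omega

/-- **Weight of the reversed walk.** [folklore] -/
private theorem paraWeight_rev (h : ω.IsB2a) :
    (ω.rev hr).2.paraWeight Θ = (ω.2.extWeight Θ r : ℂ) * (arcWeight (Θ r.1) ω.2.firstSideG ω.1 : ℂ) *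
      phase (ω.WP Θ + arcTurn (Θ r.1) ω.2.firstSideG ω.1 - ω.WE Θ) := by
  have h' := ω.rev_isB2a hr h
  rw [(ω.rev hr).paraWeight_of_isB2a Θ hr h', ω.rev_extWeight Θ hr h, ω.rev_WP Θ hr h, ω.rev_WE Θ hr h,
    ω.rev_firstSide hr h, ω.rev_exitSide hr h]
  ring_nf


/-- Reversal keeps the fourth side. [folklore] -/
private theorem rev_z₃ (h : ω.IsB2a) : (ω.rev hr).z₃ hr (ω.rev_isB2a hr h) = ω.z₃ hr h := by
  unfold z₃
  rw [ω.rev_firstSide hr h, ω.rev_exitSide hr h, ω.rev_fst hr h, Side.fourth_swap]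

/-- The first arc of the reversed walk is `z₀ → z₂`. [folklore] -/
private theorem rev_isNS_iff (h : ω.IsB2a) : (ω.rev hr).IsNS hr ↔ arcKind ω.2.firstSideG ω.1 ≠ .straight := by
  constructor
  · rintro ⟨h', hns⟩
    rwa [ω.rev_firstSide hr h, ω.rev_exitSide hr h] at hns
  · intro hns
    refine ⟨ω.rev_isB2a hr h, ?_⟩
    rwa [ω.rev_firstSide hr h, ω.rev_exitSide hr h]

/-- **Weight of the two-arc extension.** [folklore] -/
private theorem paraWeight_ext₃ (h : ω.IsNS hr) :
    (ω.ext₃ hr).2.paraWeight Θ = (ω.2.extWeight Θ r : ℂ) *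
      (pairWeight (Θ r.1) ω.2.firstSideG (ω.2.exitSideG hr (ω.fh_lt h.1)) ω.1 (ω.z₃ hr h.1) : ℂ) *
      phase (ω.WP Θ + arcTurn (Θ r.1) ω.2.firstSideG (ω.2.exitSideG hr (ω.fh_lt h.1)) + ω.WE Θ +
        arcTurn (Θ r.1) ω.1 (ω.z₃ hr h.1)) := by
  have harcs := ω.ext₃_snd_arcs hr h
  have hz := (ω.z₃_spec hr h.1).2.2
  have hface : arcFace (r.side ω.1, r.side (ω.z₃ hr h.1)) = some r := arcFace_side_side r _ _ hz.symm
  rw [(ω.ext₃ hr).2.paraWeight_eq Θ r,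
    YBWalk.extWeight_of_snoc ω.2 (ω.ext₃ hr).2 r harcs hface,
    YBWalk.kindsIn_of_snoc ω.2 (ω.ext₃ hr).2 r harcs hface,
    YBWalk.winding_of_snoc ω.2 (ω.ext₃ hr).2 harcs, ω.kindsIn_of_isB2a hr h.1,
    ω.2.winding_orig_split ω.2.firstHitG (ω.fh_lt h.1) Θ, ω.arcs_fh hr h.1,
    arcTurnOf_side_side Θ r (ω.2.exitSide_specG hr _).2.symm,
    arcKindOf_eq hface rfl rfl, arcTurnOf_side_side Θ r hz.symm]
  simp only [List.reduceOption, List.filterMap_cons, List.filterMap_nil, id, List.singleton_append, pairWeight, WP, WE]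

/-- The term of the second member of the group (zero when that member does not exist). [folklore] -/
def T₃ : ℂ := if ω.IsNS hr then (ω.ext₃ hr).g Θ else 0

/-- **The second member's term in closed form** (the weight vanishes exactly when the member does
not exist). [folklore] -/
private theorem T₃_eq (h : ω.IsB2a) :
    ω.T₃ Θ hr = crCoef (Θ r.1) (ω.z₃ hr h) * ((ω.2.extWeight Θ r : ℂ) *
      (pairWeight (Θ r.1) ω.2.firstSideG (ω.2.exitSideG hr (ω.fh_lt h)) ω.1 (ω.z₃ hr h) : ℂ) *
      phase (ω.WP Θ + arcTurn (Θ r.1) ω.2.firstSideG (ω.2.exitSideG hr (ω.fh_lt h)) + ω.WE Θ +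
        arcTurn (Θ r.1) ω.1 (ω.z₃ hr h))) := by
  unfold T₃
  by_cases hns : ω.IsNS hr
  · rw [if_pos hns, g, ω.paraWeight_ext₃ Θ hr hns, ω.ext₃_fst hr hns]
  · rw [if_neg hns]
    have hs : arcKind ω.2.firstSideG (ω.2.exitSideG hr (ω.fh_lt h)) = .straight := by
      by_contra hne; exact hns ⟨h, hne⟩
    rw [pairWeight, hs, localWeight_straight_cons]
    simp

/-- The grouped term of a walk of class `B2a`: itself and its two-arc extension. [folklore] -/
def G : ℂ := ω.g Θ + ω.T₃ Θ hr

end B2a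

end ΩG

/-- **The excursion windings, general domain and root** (the topological input of the grouping
argument; Hopf's Umlaufsatz for the simple closed curve formed by an excursion of a self-avoiding
walk outside a rhombus `r` and the chord of `r` between its ends). For a walk of the face domain `D`
from the root mid-edge `a` ending on `∂r` exactly at its first return to `∂r` (class `B2a`: first
crossing of `∂r` at the side `z₀`, one arc of `r` to the side `z₁`, then an excursion in `D ∖ r`
back to the side `z₂` where it stops), the winding of the excursion is the tabulated value
`excursionWinding θ_r z₀ z₁ z₂`. (The tree's `ExcursionWindingGen D a` is the case
`D = Rect_{T,L}`, `a = 0`.) [cite: GlazmanManolescu2019, Lemma 2.1 (proof); Glazman2015WeightedSAW, Lemma 3.1 (proof)] -/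
def ExcursionWindingGen (D : Set Face) (a : MidEdge) : Prop :=
  ∀ (Θ : ℤ → ℝ), (∀ k, Θ k ∈ Set.Icc (π / 3) (2 * π / 3)) →
    ∀ (r : Face) (hr : RootedFace D a r) (ω : ΩG D a r) (h : ω.IsB2a),
      ω.WE Θ = excursionWinding (Θ r.1) ω.2.firstSideG (ω.2.exitSideG hr (ω.fh_lt h)) ω.1

namespace ΩG

variable (ω : ΩG D a r) (Θ : ℤ → ℝ) (hr : RootedFace D a r)

/-- **The group of an excursion sums to zero**: the four walks sharing the prefix and the
excursion (in either direction) cancel, by the second local relation. [cite: GlazmanManolescu2019, Lemma 2.1 (proof)] -/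
theorem G_add_G_rev (hW : ExcursionWindingGen D a) (hΘ : ∀ k, Θ k ∈ Set.Icc (π / 3) (2 * π / 3))
    (h : ω.IsB2a) : ω.G Θ hr + (ω.rev hr).G Θ hr = 0 := by
  have h' := ω.rev_isB2a hr h
  have hX := hW Θ hΘ r hr ω h
  have hd := ω.2.sides_distinctG hr h.1
  rw [ω.returnSide_of_isB2a h] at hd
  have hz := ω.z₃_spec hr h
  have key := groupTwo_gen (Θ r.1) ω.2.firstSideG (ω.2.exitSideG hr (ω.fh_lt h)) ω.1 (ω.z₃ hr h)
    hd.1.symm hd.2.1.symm hz.1.symm hd.2.2.symm hz.2.1.symm hz.2.2.symm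
  unfold bracket at key
  rw [G, G, g, g, ω.T₃_eq Θ hr h, (ω.rev hr).T₃_eq Θ hr h', ω.paraWeight_of_isB2a Θ hr h,
    ω.paraWeight_rev Θ hr h, ω.rev_extWeight Θ hr h, ω.rev_WP Θ hr h, ω.rev_WE Θ hr h, ω.rev_z₃ hr h,
    ω.rev_firstSide hr h, ω.rev_exitSide hr h, ω.rev_fst hr h, hX]
  have e1 : ∀ a b : ℝ, phase (ω.WP Θ + a + b) = phase (ω.WP Θ) * phase (a + b) := fun a b => by
    rw [add_assoc, phase_add]
  have e2 : ∀ a b c : ℝ, phase (ω.WP Θ + a + b + c) = phase (ω.WP Θ) * phase (a + b + c) := fun a b c => by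
    rw [add_assoc, add_assoc, phase_add, add_assoc]
  have e3 : ∀ a b : ℝ, phase (ω.WP Θ + a - b) = phase (ω.WP Θ) * phase (a - b) := fun a b => by
    rw [add_sub_assoc, phase_add]
  have e4 : ∀ a b c : ℝ, phase (ω.WP Θ + a + -b + c) = phase (ω.WP Θ) * phase (a - b + c) := fun a b c => by
    rw [show ω.WP Θ + a + -b + c = ω.WP Θ + (a - b + c) by ring, phase_add]
  rw [e1, e2, e3, e4]
  linear_combination (ω.2.extWeight Θ r : ℂ) * phase (ω.WP Θ) * key

end ΩG

/-! #### Finite domains: the observable and the sums -/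

/-- Walks of a finite face domain between two mid-edges form a finite type (the tree has the
instance for rectangles). [folklore] -/
noncomputable instance (priority := low) YBWalk.fintypeOfFinite {D : Set Face} [Finite D] {a z : MidEdge} :
    Fintype (YBWalk D a z) := Fintype.ofFinite _

/-- **The parafermionic observable of a finite face domain `D` rooted at the mid-edge `a`**:
`F(z) = Σ_{γ ⊂ D : a → z} w_Θ(γ) e^{-i(5/8)·wind_Θ(γ)}` (a finite sum; the tree's `parafermion T L`
is the case `D = Rect_{T,L}`, `a = 0`). [cite: GlazmanManolescu2019, §2.1, eq. (2.1)] -/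
def parafermionOn (D : Set Face) [Finite D] (a : MidEdge) (Θ : ℤ → ℝ) (z : MidEdge) : ℂ :=
  ∑ γ : YBWalk D a z, γ.paraWeight Θ

namespace ΩG

variable [Finite D] (ω : ΩG D a r) (Θ : ℤ → ℝ) (hr : RootedFace D a r)

/-! #### The sums -/

variable (D a r)

/-- The walks of class `A`. [folklore] -/
def setA : Finset (ΩG D a r) := Finset.univ.filter fun ω => ω.IsA
/-- The walks of class `B1`. [folklore] -/
def setB1 : Finset (ΩG D a r) := Finset.univ.filter fun ω => ω.IsB1
/-- The walks of class `B2a`. [folklore] -/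
def setB2a : Finset (ΩG D a r) := Finset.univ.filter fun ω => ω.IsB2a
/-- The walks of class `B2b`. [folklore] -/
def setB2b : Finset (ΩG D a r) := Finset.univ.filter fun ω => ω.IsB2b

variable {D a r}

omit [Finite D] in
/-- Classes `A` and `B1` are disjoint. [folklore] -/
private theorem not_isB1_of_isA (h : ω.IsA) : ¬ω.IsB1 := by unfold IsA IsB1 at *; omega
omit [Finite D] in
/-- Classes `A` and `B2` are disjoint. [folklore] -/
private theorem not_isB2_of_isA (h : ω.IsA) : ¬ω.IsB2 := by unfold IsA IsB2 at *; omega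
omit [Finite D] in
/-- Classes `B1` and `B2` are disjoint. [folklore] -/
private theorem not_isB2_of_isB1 (h : ω.IsB1) : ¬ω.IsB2 := by unfold IsB1 IsB2 at *; omega
omit [Finite D] in
/-- Classes `B2a` and `B2b` are disjoint. [folklore] -/
private theorem not_isB2b_of_isB2a (h : ω.IsB2a) : ¬ω.IsB2b := fun h' => by have := h.2; have := h'.2; omega

/-- **The total splits over the four classes.** [folklore] -/
private theorem sum_split (F : ΩG D a r → ℂ) :
    ∑ ω, F ω = ∑ ω ∈ setA D a r, F ω + ∑ ω ∈ setB1 D a r, F ω + ∑ ω ∈ setB2a D a r, F ω + ∑ ω ∈ setB2b D a r, F ω := by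
  have hB1 : setB1 D a r = (Finset.univ.filter fun ω : ΩG D a r => ¬ω.IsA).filter fun ω => ω.IsB1 := by
    ext ω; simp only [setB1, Finset.mem_filter, Finset.mem_univ, true_and]
    exact ⟨fun h => ⟨fun hA => ω.not_isB1_of_isA hA h, h⟩, fun h => h.2⟩
  have hB2a : setB2a D a r =
      ((Finset.univ.filter fun ω : ΩG D a r => ¬ω.IsA).filter fun ω => ¬ω.IsB1).filter fun ω => ω.IsB2a := by
    ext ω; simp only [setB2a, Finset.mem_filter, Finset.mem_univ, true_and]
    exact ⟨fun h => ⟨⟨fun hA => ω.not_isB2_of_isA hA h.1, fun hB => ω.not_isB2_of_isB1 hB h.1⟩, h⟩, fun h => h.2⟩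
  have hB2b : setB2b D a r =
      ((Finset.univ.filter fun ω : ΩG D a r => ¬ω.IsA).filter fun ω => ¬ω.IsB1).filter fun ω => ¬ω.IsB2a := by
    ext ω; simp only [setB2b, Finset.mem_filter, Finset.mem_univ, true_and]
    constructor
    · intro h
      exact ⟨⟨fun hA => ω.not_isB2_of_isA hA h.1, fun hB => ω.not_isB2_of_isB1 hB h.1⟩, fun h' => ω.not_isB2b_of_isB2a h' h⟩
    · rintro ⟨⟨hA, hB1⟩, hB2a⟩
      rcases ω.isA_or with h | h | h
      · exact absurd h hA
      · exact absurd h hB1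
      · rcases ω.isB2a_or h with h' | h'
        · exact absurd h' hB2a
        · exact h'
  rw [hB1, hB2a, hB2b, setA, add_assoc, add_assoc, Finset.sum_filter_add_sum_filter_not,
    Finset.sum_filter_add_sum_filter_not, Finset.sum_filter_add_sum_filter_not]

/-- **Class `B1` re-indexed over class `A`.** [folklore] -/
private theorem sum_B1 (F : ΩG D a r → ℂ) :
    ∑ ω ∈ setB1 D a r, F ω = ∑ ω ∈ setA D a r, ∑ z₁ ∈ Finset.univ.erase ω.1, F (ω.extA hr z₁) := by
  rw [← Finset.sum_sigma (setA D a r) (fun ω => Finset.univ.erase ω.1) (fun p => F (p.1.extA hr p.2))]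
  refine Finset.sum_nbij' (fun ω => ⟨ω.baseA, ω.1⟩) (fun p => p.1.extA hr p.2) ?_ ?_ ?_ ?_ ?_
  · intro ω hω
    simp only [setB1, Finset.mem_filter, Finset.mem_univ, true_and] at hω
    simp only [Finset.mem_sigma, setA, Finset.mem_filter, Finset.mem_univ, true_and, Finset.mem_erase, ne_eq]
    exact ⟨ω.baseA_isA hω, fun e => ω.firstSide_ne_of_isB1 hr hω ((ω.baseA_fst hω).symm.trans e.symm), trivial⟩
  · rintro ⟨P, z₁⟩ hp
    simp only [Finset.mem_sigma, setA, Finset.mem_filter, Finset.mem_univ, true_and, Finset.mem_erase] at hp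
    simp only [setB1, Finset.mem_filter, Finset.mem_univ, true_and]
    exact P.extA_isB1 hr hp.1 hp.2.1
  · intro ω hω
    simp only [setB1, Finset.mem_filter, Finset.mem_univ, true_and] at hω
    exact ω.extA_baseA hr hω
  · rintro ⟨P, z₁⟩ hp
    simp only [Finset.mem_sigma, setA, Finset.mem_filter, Finset.mem_univ, true_and, Finset.mem_erase] at hp
    simp only [Sigma.mk.injEq]
    refine ⟨P.baseA_extA hr hp.1 hp.2.1, ?_⟩
    rw [P.extA_fst hr hp.1 hp.2.1]
  · intro ω hω
    simp only [setB1, Finset.mem_filter, Finset.mem_univ, true_and] at hω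
    simp only
    rw [ω.extA_baseA hr hω]

/-- **The first group sums to zero.** [cite: GlazmanManolescu2019, Lemma 2.1 (proof)] -/
theorem sum_A_add_sum_B1 (hr : RootedFace D a r) (hΘ : ∀ k, Θ k ∈ Set.Icc (π / 3) (2 * π / 3)) :
    ∑ ω ∈ setA D a r, ω.g Θ + ∑ ω ∈ setB1 D a r, ω.g Θ = 0 := by
  rw [sum_B1 hr, ← Finset.sum_add_distrib]
  refine Finset.sum_eq_zero fun ω hω => ?_
  simp only [setA, Finset.mem_filter, Finset.mem_univ, true_and] at hω
  have hθ : weightDen (Θ r.1) ≠ 0 := (weightDen_neg (hΘ r.1)).ne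
  have key := groupOne_gen (Θ r.1) hθ ω.1
  have e : ∀ z₁ ∈ Finset.univ.erase ω.1, (ω.extA hr z₁).g Θ =
      ω.2.paraWeight Θ * (crCoef (Θ r.1) z₁ * (arcWeight (Θ r.1) ω.1 z₁ : ℂ) * phase (arcTurn (Θ r.1) ω.1 z₁)) := by
    intro z₁ hz
    have hz' : z₁ ≠ ω.1 := Finset.ne_of_mem_erase hz
    rw [g, ω.paraWeight_extA Θ hr hω hz', ω.extA_fst hr hω hz']; ring
  rw [Finset.sum_congr rfl e, ← Finset.mul_sum, g]
  linear_combination ω.2.paraWeight Θ * key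

/-- **Class `B2b` re-indexed over class `B2a`.** [folklore] -/
private theorem sum_B2b (F : ΩG D a r → ℂ) :
    ∑ ω ∈ setB2b D a r, F ω = ∑ ω ∈ setB2a D a r, if ω.IsNS hr then F (ω.ext₃ hr) else 0 := by
  rw [← Finset.sum_filter]
  refine Finset.sum_nbij' (fun ω => ω.base₂ hr) (fun ω => ω.ext₃ hr) ?_ ?_ ?_ ?_ ?_
  · intro ω hω
    simp only [setB2b, Finset.mem_filter, Finset.mem_univ, true_and] at hω
    simp only [Finset.mem_filter, setB2a, Finset.mem_univ, true_and]
    exact ⟨ω.base₂_isB2a hr hω, ω.base₂_isNS hr hω⟩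
  · intro ω hω
    simp only [Finset.mem_filter, setB2a, Finset.mem_univ, true_and] at hω
    simp only [setB2b, Finset.mem_filter, Finset.mem_univ, true_and]
    exact ω.ext₃_isB2b hr hω.2
  · intro ω hω
    simp only [setB2b, Finset.mem_filter, Finset.mem_univ, true_and] at hω
    exact ω.ext₃_base₂ hr hω
  · intro ω hω
    simp only [Finset.mem_filter, setB2a, Finset.mem_univ, true_and] at hω
    exact ω.base₂_ext₃ hr hω.2
  · intro ω hω
    simp only [setB2b, Finset.mem_filter, Finset.mem_univ, true_and] at hω
    rw [ω.ext₃_base₂ hr hω]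

/-- **The second group sums to zero.** [cite: GlazmanManolescu2019, Lemma 2.1 (proof)] -/
theorem sum_B2a_add_sum_B2b (hr : RootedFace D a r) (hW : ExcursionWindingGen D a) (hΘ : ∀ k, Θ k ∈ Set.Icc (π / 3) (2 * π / 3)) :
    ∑ ω ∈ setB2a D a r, ω.g Θ + ∑ ω ∈ setB2b D a r, ω.g Θ = 0 := by
  rw [sum_B2b hr, ← Finset.sum_add_distrib]
  change ∑ ω ∈ setB2a D a r, ω.G Θ hr = 0
  refine Finset.sum_involution (fun ω _ => ω.rev hr) ?_ ?_ ?_ ?_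
  · intro ω hω
    simp only [setB2a, Finset.mem_filter, Finset.mem_univ, true_and] at hω
    exact ω.G_add_G_rev Θ hr hW hΘ hω
  · intro ω hω _
    simp only [setB2a, Finset.mem_filter, Finset.mem_univ, true_and] at hω
    exact ω.rev_ne hr hω
  · intro ω hω
    simp only [setB2a, Finset.mem_filter, Finset.mem_univ, true_and] at hω ⊢
    exact ω.rev_isB2a hr hω
  · intro ω hω
    simp only [setB2a, Finset.mem_filter, Finset.mem_univ, true_and] at hω
    exact ω.rev_rev hr hω

/-- **The vertex relation as a vanishing sum.** [cite: GlazmanManolescu2019, Lemma 2.1] -/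
theorem sum_g_eq_zero (hr : RootedFace D a r) (hW : ExcursionWindingGen D a) (hΘ : ∀ k, Θ k ∈ Set.Icc (π / 3) (2 * π / 3)) :
    ∑ ω : ΩG D a r, ω.g Θ = 0 := by
  rw [sum_split, add_assoc, sum_A_add_sum_B1 Θ hr hΘ, sum_B2a_add_sum_B2b Θ hr hW hΘ, add_zero]

end ΩG

/-- **Lemma 2.1 on a general finite face domain with a general non-interior root, from the local
relations and the excursion windings**: for every rhombus `r ∈ D`,
`F(z_E) − F(z_W) = e^{iθ_r}(F(z_S) − F(z_N))` for the observable `F = parafermionOn D a Θ`.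
[cite: GlazmanManolescu2019, Lemma 2.1] -/
theorem lem21_of_excursionWindingGen [Finite D] (hW : ExcursionWindingGen D a) (Θ : ℤ → ℝ)
    (hΘ : ∀ k, Θ k ∈ Set.Icc (π / 3) (2 * π / 3)) (r : Face) (hr : RootedFace D a r) :
    parafermionOn D a Θ (r.side .E) - parafermionOn D a Θ (r.side .W) =
      Complex.exp ((Θ r.1 : ℝ) * Complex.I) * (parafermionOn D a Θ (r.side .S) - parafermionOn D a Θ (r.side .N)) := by
  have key := ΩG.sum_g_eq_zero (D := D) (a := a) (r := r) Θ hr hW hΘ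
  rw [Fintype.sum_sigma] at key
  simp only [ΩG.g] at key
  have hu : (Finset.univ : Finset Side) = {Side.W, Side.E, Side.S, Side.N} := by decide
  rw [hu, Finset.sum_insert (by decide), Finset.sum_insert (by decide), Finset.sum_insert (by decide),
    Finset.sum_singleton] at key
  simp only [← Finset.mul_sum] at key
  rw [← parafermionOn, ← parafermionOn, ← parafermionOn, ← parafermionOn] at key
  simp only [crCoef] at key
  linear_combination key

end CR

open Complex

/-! ## The winding of an excursion (generalised from `YangBaxterSAWExcursion.lean`) -/

namespace ΩG

section Excursion

variable {D : Set Face} {a : MidEdge} {r : Face} (ω : ΩG D a r)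

/-- In class `B2a` the excursion has at least two arcs. [folklore] -/
private theorem three_le (hr : RootedFace D a r) (h : ω.IsB2a) : ω.2.firstHitG + 3 ≤ ω.2.arcs.length := by
  have := ω.2.firstHit_add_three_le_returnHitG hr h.1; rw [h.2] at this; exact this

/-- The first arc in `r`: its face and sides in the polyline bookkeeping. [folklore] -/
private theorem fc_fh (hr : RootedFace D a r) (h : ω.IsB2a) : ω.2.fc ω.2.firstHitG = r ∧ ω.2.sIn ω.2.firstHitG = ω.2.firstSideG ∧
    ω.2.sOut ω.2.firstHitG = ω.2.exitSideG hr (ω.fh_lt h) := by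
  have hfh := ω.fh_lt h
  have hface := (YBWalk.arcFace_arcAt hfh).1
  rw [YBWalk.arcAt_eq hfh] at hface
  have hface' : arcFace (ω.2.mids[ω.2.firstHitG]'(by have := ω.2.length_arcs; omega),
      ω.2.mids[ω.2.firstHitG + 1]'(YBWalk.lt_length_of_lt_arcs hfh)) = some r := by
    rw [← ω.2.nth_eq_getElem, ← ω.2.nth_eq_getElem, ω.2.nth_firstHitG, (ω.2.exitSide_specG hr hfh).1]
    exact arcFace_side_side r _ _ (ω.2.exitSide_specG hr hfh).2.symm
  rw [hface'] at hface
  have hfc : ω.2.fc ω.2.firstHitG = r := (Option.some_injective _ hface).symm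
  obtain ⟨hs, ht, -⟩ := YBWalk.side_sIn hfh
  rw [hfc, ← ω.2.nth_eq_getElem, ω.2.nth_firstHitG] at hs
  rw [hfc, ← ω.2.nth_eq_getElem, (ω.2.exitSide_specG hr hfh).1] at ht
  exact ⟨hfc, r.side_injective hs, r.side_injective ht⟩

/-- The entry inner point of the first arc in `r` is `c₀`. [folklore] -/
private theorem vtx_c₀ (hr : RootedFace D a r) (h : ω.IsB2a) : ω.2.vtx (2 * ω.2.firstHitG + 1) = innerPt r ω.2.firstSideG := by
  rw [YBWalk.vtx_odd (ω.fh_lt h), YBWalk.ptIn, (ω.fc_fh hr h).1, (ω.fc_fh hr h).2.1]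

/-- The exit inner point of the first arc in `r` is `c₁`. [folklore] -/
private theorem vtx_c₁ (hr : RootedFace D a r) (h : ω.IsB2a) : ω.2.vtx (2 * ω.2.firstHitG + 2) = innerPt r (ω.2.exitSideG hr (ω.fh_lt h)) := by
  rw [YBWalk.vtx_even (ω.fh_lt h), YBWalk.ptOut, (ω.fc_fh hr h).1, (ω.fc_fh hr h).2.2]

/-- The last vertex of the walk polyline is the midpoint of the return side. [folklore] -/
private theorem vtx_E : ω.2.vtx (2 * ω.2.arcs.length + 1) = midPt (r.side ω.1) := YBWalk.vtx_last

/-- The faces of the excursion arcs are not `r`. [folklore] -/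
private theorem fc_ne (hr : RootedFace D a r) (h : ω.IsB2a) {i : ℕ} (h1 : ω.2.firstHitG < i) (h2 : i < ω.2.arcs.length) : ω.2.fc i ≠ r := by
  intro e
  have hface := (YBWalk.arcFace_arcAt h2).1
  rw [YBWalk.arcAt_eq h2, e, ← ω.2.nth_eq_getElem, ← ω.2.nth_eq_getElem] at hface
  exact ω.arcFace_ne_of_isB2a hr h h2 (by omega) hface

/-- The exit side of the last arc is determined by the final edge (general domain and root; the
tree's `YBWalk.side_sOut_last` is typed for rectangle walks). [cite: GlazmanManolescu2019, §1 (a walk crosses the sides of the rhombi it visits)] -/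
theorem _root_.Literature.Probability.RandomPlanarGeometry.SAW.YangBaxter.YBWalk.side_sOut_lastG {D : Set Face}
    {a z : MidEdge} {γ : YBWalk D a z} (hn : 0 < γ.arcs.length) :
    (γ.fc (γ.arcs.length - 1)).side (γ.sOut (γ.arcs.length - 1)) = z := by
  rw [(YBWalk.side_sIn (show γ.arcs.length - 1 < γ.arcs.length by omega)).2.1]
  have hl := γ.getElem_length_sub_one
  have e : γ.arcs.length - 1 + 1 = γ.mids.length - 1 := by have := γ.length_arcs; omega
  simp only [e]; exact hl

/-- The last vertex before the return: one unit outside the return side. [folklore] -/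
private theorem vtx_qlast (hr : RootedFace D a r) (h : ω.IsB2a) : ω.2.vtx (2 * ω.2.arcs.length) = midPt (r.side ω.1) - (ω.1).nIn := by
  have hn : 0 < ω.2.arcs.length := by have := ω.three_le hr h; omega
  have hlt : ω.2.arcs.length - 1 < ω.2.arcs.length := by omega
  have hside : (ω.2.fc (ω.2.arcs.length - 1)).side (ω.2.sOut (ω.2.arcs.length - 1)) = r.side ω.1 :=
    YBWalk.side_sOut_lastG hn
  have hne : ω.2.fc (ω.2.arcs.length - 1) ≠ r := ω.fc_ne hr h (by have := ω.three_le hr h; omega) hlt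
  have eν := nIn_eq_neg_of_side_eq hside hne
  rw [show 2 * ω.2.arcs.length = 2 * (ω.2.arcs.length - 1) + 2 by omega, YBWalk.vtx_even hlt, YBWalk.ptOut, innerPt_eq, hside]
  rw [show (ω.2.sOut (ω.2.arcs.length - 1)).nIn = -(ω.1).nIn from by rw [eν, neg_neg], ← sub_eq_add_neg]

/-- Midpoints of sides as base plus offset. [folklore] -/
private theorem midPt_side_eq (s : Side) : midPt (r.side s) = r.base + s.offset := midPt_side r s

end Excursion

end ΩG

/-! ### Lattice geometry of the exterior transport (mesh `4`) -/

/-- The centre of a face in the right-angle drawing of mesh `4`. [folklore] -/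
def Face.ctr (g : Face) : ℤ × ℤ := g.base + (2, 2)

/-- The lattice point `(u, v)` (a corner of the faces around it), drawn at `(4u, 4v)`. [folklore] -/
def cornerPt (q : ℤ × ℤ) : ℤ × ℤ := (4 * q.1, 4 * q.2)

/-- `q` is a corner of the face `g`. [cite: GlazmanManolescu2019, §1 (the faces of the square lattice and their corners)] -/
def IsCornerOf (q : ℤ × ℤ) (g : Face) : Prop := (q.1 = g.1 ∨ q.1 = g.1 + 1) ∧ (q.2 = g.2 ∨ q.2 = g.2 + 1)

/-- The shape of an inner point: one coordinate is the face centre's, the other is odd. [folklore] -/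
private theorem innerPt_shape (g : Face) (σ : Side) :
    ((innerPt g σ).1 = 4 * g.1 + 2 ∧ ((innerPt g σ).2 = 4 * g.2 + 1 ∨ (innerPt g σ).2 = 4 * g.2 + 3)) ∨
      ((innerPt g σ).2 = 4 * g.2 + 2 ∧ ((innerPt g σ).1 = 4 * g.1 + 1 ∨ (innerPt g σ).1 = 4 * g.1 + 3)) := by
  obtain ⟨k, j⟩ := g
  cases σ <;> simp [innerPt, Face.base, Side.inOff, Side.offset, Side.nIn]

/-- `x² + y² ≥ 9` from a coordinate of size `≥ 3`. [folklore] -/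
private theorem nine_le_sq_add_sq {x y : ℤ} (h : x ≤ -3 ∨ 3 ≤ x ∨ y ≤ -3 ∨ 3 ≤ y) : 9 ≤ x ^ 2 + y ^ 2 := by
  rcases h with h | h | h | h <;> nlinarith [sq_nonneg x, sq_nonneg y]

/-- `x² + y² ≥ 5` from coordinates of sizes `≥ 2` and `≥ 1`. [folklore] -/
private theorem five_le_sq_add_sq {x y : ℤ} (h : ((x ≤ -2 ∨ 2 ≤ x) ∧ (y ≤ -1 ∨ 1 ≤ y)) ∨ ((y ≤ -2 ∨ 2 ≤ y) ∧ (x ≤ -1 ∨ 1 ≤ x))) :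
    5 ≤ x ^ 2 + y ^ 2 := by
  rcases h with ⟨h1 | h1, h2 | h2⟩ | ⟨h1 | h1, h2 | h2⟩ <;> nlinarith [sq_nonneg x, sq_nonneg y]

/-- `x² + y² ≥ 1` from a nonzero coordinate. [folklore] -/
private theorem one_le_sq_add_sq {x y : ℤ} (h : x ≤ -1 ∨ 1 ≤ x ∨ y ≤ -1 ∨ 1 ≤ y) : 1 ≤ x ^ 2 + y ^ 2 := by
  rcases h with h | h | h | h <;> nlinarith [sq_nonneg x, sq_nonneg y]

/-- **An inner point of a face is at squared distance `≥ 9` from the centre of any OTHER face.**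
[folklore] -/
private theorem nine_le_distSq_innerPt_ctr {g g' : Face} (hg : g' ≠ g) (σ : Side) :
    9 ≤ ((innerPt g' σ).1 - (Face.ctr g).1) ^ 2 + ((innerPt g' σ).2 - (Face.ctr g).2) ^ 2 := by
  have hne : g'.1 ≠ g.1 ∨ g'.2 ≠ g.2 := by
    by_contra hc
    exact hg (Prod.ext (not_not.1 (not_or.1 hc).1) (not_not.1 (not_or.1 hc).2))
  have hc1 : (Face.ctr g).1 = 4 * g.1 + 2 := by simp [Face.ctr, Face.base]
  have hc2 : (Face.ctr g).2 = 4 * g.2 + 2 := by simp [Face.ctr, Face.base]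
  rw [hc1, hc2]
  refine nine_le_sq_add_sq ?_
  rcases innerPt_shape g' σ with ⟨h1, h2 | h2⟩ | ⟨h1, h2 | h2⟩ <;> omega

/-- **An inner point of a face is at squared distance `≥ 5` from every lattice corner.** [folklore] -/
private theorem five_le_distSq_innerPt_corner (g' : Face) (σ : Side) (q : ℤ × ℤ) :
    5 ≤ ((innerPt g' σ).1 - (cornerPt q).1) ^ 2 + ((innerPt g' σ).2 - (cornerPt q).2) ^ 2 := by
  simp only [cornerPt]
  refine five_le_sq_add_sq ?_
  rcases innerPt_shape g' σ with ⟨h1, h2 | h2⟩ | ⟨h1, h2 | h2⟩ <;> omega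

/-- **An inner point of a face is at squared distance `≥ 1` from every edge midpoint.** [folklore] -/
private theorem one_le_distSq_innerPt_midPt (g' : Face) (σ : Side) (e : MidEdge) :
    1 ≤ ((innerPt g' σ).1 - (midPt e).1) ^ 2 + ((innerPt g' σ).2 - (midPt e).2) ^ 2 := by
  refine one_le_sq_add_sq ?_
  rcases innerPt_shape g' σ with ⟨h1, h2 | h2⟩ | ⟨h1, h2 | h2⟩ <;> cases e <;> simp only [midPt] <;> omega

/-- Two inner points of one face are at squared distance `≤ 4`. [folklore] -/
private theorem distSq_innerPt_innerPt_le (f : Face) (s t : Side) :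
    ((innerPt f t).1 - (innerPt f s).1) ^ 2 + ((innerPt f t).2 - (innerPt f s).2) ^ 2 ≤ 4 := by
  obtain ⟨k, j⟩ := f
  cases s <;> cases t <;> simp [innerPt, Face.base, Side.inOff, Side.offset, Side.nIn]

/-- The rung from a face centre to one of its corners, seen from a far point. [folklore] -/
private theorem sdot_ctr_corner_pos {g : Face} {q : ℤ × ℤ} (hq : IsCornerOf q g) {P : ℤ × ℤ}
    (h9 : 9 ≤ (P.1 - (Face.ctr g).1) ^ 2 + (P.2 - (Face.ctr g).2) ^ 2)
    (h5 : 5 ≤ (P.1 - (cornerPt q).1) ^ 2 + (P.2 - (cornerPt q).2) ^ 2) : 0 < sdot (Face.ctr g) (cornerPt q) P := by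
  have hd : ((Face.ctr g).1 - (cornerPt q).1) ^ 2 + ((Face.ctr g).2 - (cornerPt q).2) ^ 2 = 8 := by
    obtain ⟨k, j⟩ := g
    rcases hq with ⟨h1 | h1, h2 | h2⟩ <;> simp [Face.ctr, Face.base, cornerPt, h1, h2] <;> ring
  unfold sdot
  nlinarith [hd, h9, h5]

/-- The rung from the midpoint of a side of `g` to the centre of `g`, seen from a far point. [folklore] -/
private theorem sdot_midPt_ctr_pos (g : Face) (s : Side) {P : ℤ × ℤ}
    (h9 : 9 ≤ (P.1 - (Face.ctr g).1) ^ 2 + (P.2 - (Face.ctr g).2) ^ 2)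
    (h1 : 1 ≤ (P.1 - (midPt (g.side s)).1) ^ 2 + (P.2 - (midPt (g.side s)).2) ^ 2) :
    0 < sdot (midPt (g.side s)) (Face.ctr g) P := by
  have hd : ((midPt (g.side s)).1 - (Face.ctr g).1) ^ 2 + ((midPt (g.side s)).2 - (Face.ctr g).2) ^ 2 = 4 := by
    rw [midPt_side]
    obtain ⟨k, j⟩ := g
    cases s <;> simp [Face.ctr, Face.base, Side.offset]
  unfold sdot
  nlinarith [hd, h9, h1]

/-- `Im(I·(p − q)) = p₁ − q₁`. [folklore] -/
private theorem im_I_mul_toC_sub (p q : ℤ × ℤ) : (I * (toC p - toC q)).im = ((p.1 - q.1 : ℤ) : ℝ) := by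
  rw [← toC_sub, Complex.mul_im, Complex.I_re, Complex.I_im, toC_re, Prod.fst_sub]; push_cast; ring

/-- `Im(−I·(p − q)) = q₁ − p₁`. [folklore] -/
private theorem im_negI_mul_toC_sub (p q : ℤ × ℤ) : (-I * (toC p - toC q)).im = ((-p.1 - -q.1 : ℤ) : ℝ) := by
  rw [← toC_sub, Complex.mul_im, Complex.neg_re, Complex.neg_im, Complex.I_re, Complex.I_im, toC_re, Prod.fst_sub]
  push_cast; ring

/-- `Im(1·(p − q)) = p₂ − q₂`. [folklore] -/
private theorem im_one_mul_toC_sub (p q : ℤ × ℤ) : ((1 : ℂ) * (toC p - toC q)).im = ((p.2 - q.2 : ℤ) : ℝ) := by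
  rw [← toC_sub, one_mul, toC_im, Prod.snd_sub, Int.cast_sub]

/-- `Im(−1·(p − q)) = q₂ − p₂`. [folklore] -/
private theorem im_negOne_mul_toC_sub (p q : ℤ × ℤ) : ((-1 : ℂ) * (toC p - toC q)).im = ((-p.2 - -q.2 : ℤ) : ℝ) := by
  rw [← toC_sub, neg_one_mul, Complex.neg_im, toC_im, Prod.snd_sub]; push_cast; ring

namespace ΩG

section Path

variable {D : Set Face} {a : MidEdge} {r : Face} (ω : ΩG D a r) (hr : RootedFace D a r)

/-- The exit side. [folklore] -/
def z1 (h : ω.IsB2a) : Side := ω.2.exitSideG hr (ω.fh_lt h)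

/-- The number of arcs from the first crossing on. [folklore] -/
def Mv : ℕ := ω.2.arcs.length - ω.2.firstHitG

/-- The tail points. [folklore] -/
def tailPt (h : ω.IsB2a) (i : ℕ) : ℤ × ℤ := r.base + (tailOffs ω.2.firstSideG (ω.z1 hr h) ω.1).getD i (0, 0)

/-- The length of the tail. [folklore] -/
def τ (h : ω.IsB2a) : ℕ := (tailOffs ω.2.firstSideG (ω.z1 hr h) ω.1).length

/-- **The open path of the excursion**: the midpoint of the first side, the polyline of the walk
from its first arc in `r` to the midpoint of the return side, then the tail inside `r`. [folklore] -/
def Qp (h : ω.IsB2a) (j : ℕ) : ℤ × ℤ :=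
  if j = 0 then midPt (r.side ω.2.firstSideG)
  else if j ≤ 2 * ω.Mv + 1 then ω.2.vtx (2 * ω.2.firstHitG + j)
  else ω.tailPt hr h (j - (2 * ω.Mv + 2))

variable {ω hr}

/-- The tail is nonempty. [folklore] -/
theorem τ_pos (h : ω.IsB2a) : 0 < ω.τ hr h := tailOffs_length_pos _ _ _
/-- The tail has at most two points. [folklore] -/
theorem τ_le (h : ω.IsB2a) : ω.τ hr h ≤ 2 := tailOffs_length_le _ _ _
/-- At least three arcs from the first crossing on. [folklore] -/
private theorem three_le_Mv (hr : RootedFace D a r) (h : ω.IsB2a) : 3 ≤ ω.Mv := by have := ω.three_le hr h; unfold Mv; omega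
/-- The arcs split at the first crossing. [folklore] -/
private theorem fh_add_Mv (h : ω.IsB2a) : ω.2.firstHitG + ω.Mv = ω.2.arcs.length := by
  have := ω.fh_lt h; unfold Mv; omega

/-- The open path starts at `m₀`. [folklore] -/
private theorem Qp_zero (h : ω.IsB2a) : ω.Qp hr h 0 = r.base + ω.2.firstSideG.offset := by
  rw [Qp, if_pos rfl, midPt_side]

/-- The walk part of the open path. [folklore] -/
private theorem Qp_mid (h : ω.IsB2a) {j : ℕ} (h1 : 1 ≤ j) (h2 : j ≤ 2 * ω.Mv + 1) :
    ω.Qp hr h j = ω.2.vtx (2 * ω.2.firstHitG + j) := by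
  rw [Qp, if_neg (by omega), if_pos h2]

/-- The second vertex of the open path is `c₀`. [folklore] -/
private theorem Qp_one (h : ω.IsB2a) : ω.Qp hr h 1 = r.base + ω.2.firstSideG.inOff := by
  rw [Qp_mid h le_rfl (by omega), ω.vtx_c₀ hr h, innerPt]

/-- The third vertex of the open path is `c₁`. [folklore] -/
private theorem Qp_two (h : ω.IsB2a) : ω.Qp hr h 2 = r.base + (ω.z1 hr h).inOff := by
  rw [Qp_mid h (by omega) (by have := three_le_Mv hr h; omega), ω.vtx_c₁ hr h, innerPt, z1]

/-- The walk part of the open path ends at the midpoint of the return side. [folklore] -/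
private theorem Qp_E (h : ω.IsB2a) : ω.Qp hr h (2 * ω.Mv + 1) = r.base + (ω.1).offset := by
  rw [Qp_mid h (by omega) le_rfl, show 2 * ω.2.firstHitG + (2 * ω.Mv + 1) = 2 * ω.2.arcs.length + 1 by
    have := fh_add_Mv h; omega, ω.vtx_E, midPt_side]

/-- The vertex before the return midpoint: one unit outside the return side. [folklore] -/
private theorem Qp_qlast (h : ω.IsB2a) : ω.Qp hr h (2 * ω.Mv) = r.base + ((ω.1).offset - (ω.1).nIn) := by
  rw [Qp_mid h (by have := three_le_Mv hr h; omega) (by omega),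
    show 2 * ω.2.firstHitG + 2 * ω.Mv = 2 * ω.2.arcs.length by have := fh_add_Mv h; omega,
    ω.vtx_qlast hr h, midPt_side, add_sub_assoc]

/-- The tail part of the open path. [folklore] -/
private theorem Qp_tail (h : ω.IsB2a) {i : ℕ} : ω.Qp hr h (2 * ω.Mv + 2 + i) = ω.tailPt hr h i := by
  rw [Qp, if_neg (by omega), if_neg (by omega)]; congr 1; omega

/-- Tail points are of corner type. [folklore] -/
private theorem tailPt_cornerType (h : ω.IsB2a) {i : ℕ} (hi : i < ω.τ hr h) :
    (ω.tailPt hr h i).1 % 2 = 1 ∧ (ω.tailPt hr h i).2 % 2 = 1 := by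
  apply base_add_cornerType
  apply tailOffs_mem
  rw [List.getD_eq_getElem?_getD, List.getElem?_eq_getElem hi, Option.getD_some]
  exact List.getElem_mem _

/-- Tail offsets are tail offsets. [folklore] -/
private theorem tailPt_off_mem (h : ω.IsB2a) {i : ℕ} (hi : i < ω.τ hr h) :
    (tailOffs ω.2.firstSideG (ω.z1 hr h) ω.1).getD i (0, 0) ∈ tailOffs ω.2.firstSideG (ω.z1 hr h) ω.1 := by
  rw [List.getD_eq_getElem?_getD, List.getElem?_eq_getElem hi, Option.getD_some]
  exact List.getElem_mem _

/-- Interior vertices of the walk part are inner points of faces of the walk. [folklore] -/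
private theorem vtx_eq_innerPt {j : ℕ} (h1 : 1 ≤ j) (h2 : j ≤ 2 * ω.2.arcs.length) :
    ∃ i, i < ω.2.arcs.length ∧ (2 * i + 1 = j ∨ 2 * i + 2 = j) ∧ ∃ σ : Side,
      ω.2.vtx j = innerPt (ω.2.fc i) σ ∧ (ω.2.fc i).side σ ∈ [ω.2.nth i, ω.2.nth (i + 1)] := by
  rcases YBWalk.index_cases (γ := ω.2) j (by omega) with h0 | ⟨i, hi, rfl⟩ | ⟨i, hi, rfl⟩ | h0
  · omega
  · refine ⟨i, hi, Or.inl rfl, ω.2.sIn i, YBWalk.vtx_odd hi, ?_⟩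
    rw [(YBWalk.side_sIn hi).1, ← ω.2.nth_eq_getElem]; simp
  · refine ⟨i, hi, Or.inr rfl, ω.2.sOut i, YBWalk.vtx_even hi, ?_⟩
    rw [(YBWalk.side_sIn hi).2.1, ← ω.2.nth_eq_getElem]; simp
  · omega

/-! #### Hopf's hypothesis for the open path -/

/-- A walk of class `B2a` has an arc. [folklore] -/
private theorem n_pos (hr : RootedFace D a r) (h : ω.IsB2a) : 0 < ω.2.arcs.length := by have := ω.three_le hr h; omega

/-- Consecutive tail vertices of the open path form a tail segment. [folklore] -/
private theorem tailSeg_mem (h : ω.IsB2a) {i : ℕ} (hi : i < ω.τ hr h) :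
    ∃ sg ∈ tailSegs ω.2.firstSideG (ω.z1 hr h) ω.1,
      ω.Qp hr h (2 * ω.Mv + 1 + i) = r.base + sg.1 ∧ ω.Qp hr h (2 * ω.Mv + 2 + i) = r.base + sg.2 := by
  have hτ := τ_le (ω := ω) (hr := hr) h
  unfold τ at hi hτ
  refine ⟨((ω.1.offset :: tailOffs ω.2.firstSideG (ω.z1 hr h) ω.1)[i]'(by simp; omega),
    (tailOffs ω.2.firstSideG (ω.z1 hr h) ω.1)[i]'hi), ?_, ?_, ?_⟩
  · unfold tailSegs
    rw [List.mem_iff_getElem]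
    exact ⟨i, by simp [List.length_zip]; omega, by simp [List.getElem_zip]⟩
  · rcases Nat.eq_zero_or_pos i with rfl | hpos
    · simp only [add_zero, List.getElem_cons_zero]; exact Qp_E h
    · obtain ⟨i', rfl⟩ : ∃ i', i = i' + 1 := ⟨i - 1, by omega⟩
      rw [show 2 * ω.Mv + 1 + (i' + 1) = 2 * ω.Mv + 2 + i' by ring, Qp_tail h, tailPt,
        List.getD_eq_getElem?_getD, List.getElem?_eq_getElem (by omega), Option.getD_some]
      simp
  · rw [Qp_tail h, tailPt, List.getD_eq_getElem?_getD, List.getElem?_eq_getElem hi, Option.getD_some]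

/-- Segment `0`: the first half-segment, from the other vertices. [folklore] -/
private theorem subt_k0 (h : ω.IsB2a) {j : ℕ} (hj2 : 2 ≤ j) (hj : j ≤ 2 * ω.Mv + ω.τ hr h + 1) :
    0 < sdot (ω.Qp hr h 0) (ω.Qp hr h 1) (ω.Qp hr h j) := by
  have hM := three_le_Mv hr h
  have hfM := fh_add_Mv (ω := ω) h
  have e1 : ω.Qp hr h 1 = ω.Qp hr h 0 + ω.2.firstSideG.nIn := by
    rw [Qp_one h, Qp_zero h, Side.inOff, add_assoc]
  rw [e1]
  refine sdot_half_pos _ ?_ ?_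
  · -- `Qp j ≠ m₀`
    rw [Qp_zero h, ← midPt_side]
    by_cases hjm : j ≤ 2 * ω.Mv + 1
    · rw [Qp_mid h (by omega) hjm]
      rcases hjm.lt_or_eq with hjm | rfl
      · obtain ⟨i, hi, -, σ, e, -⟩ := vtx_eq_innerPt (ω := ω) (j := 2 * ω.2.firstHitG + j) (by omega) (by omega)
        rw [e]; exact (midPt_ne_innerPt _ _ _).symm
      · rw [show 2 * ω.2.firstHitG + (2 * ω.Mv + 1) = 2 * ω.2.arcs.length + 1 by omega, ω.vtx_E]
        intro hh
        have := r.side_injective (midPt_injective hh)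
        exact (ω.firstSide_ne_fst h) this.symm
    · obtain ⟨i, rfl⟩ : ∃ i, j = 2 * ω.Mv + 2 + i := ⟨j - (2 * ω.Mv + 2), by omega⟩
      rw [Qp_tail h]
      exact cornerType_ne_midPt (tailPt_cornerType h (by omega)) _
  · -- `Qp j ≠ c₀`
    rw [← e1]
    by_cases hjm : j ≤ 2 * ω.Mv + 1
    · rw [Qp_mid h (by omega) hjm, Qp_mid h le_rfl (by omega)]
      intro hh
      have := YBWalk.vtx_injective (γ := ω.2) (by omega) (by omega) (n_pos hr h) hh
      omega
    · obtain ⟨i, rfl⟩ : ∃ i, j = 2 * ω.Mv + 2 + i := ⟨j - (2 * ω.Mv + 2), by omega⟩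
      rw [Qp_tail h, Qp_one h, ← innerPt]
      exact cornerType_ne_innerPt (tailPt_cornerType h (by omega)) _ _

/-- Segments of the walk part, from `m₀`. [folklore] -/
private theorem subt_kmid_j0 (h : ω.IsB2a) {k : ℕ} (hk1 : 1 ≤ k) (hk2 : k ≤ 2 * ω.Mv) :
    0 < sdot (ω.Qp hr h k) (ω.Qp hr h (k + 1)) (ω.Qp hr h 0) := by
  have hM := three_le_Mv hr h
  have hfM := fh_add_Mv (ω := ω) h
  rw [Qp_mid h hk1 (by omega), Qp_mid h (by omega) (by omega), Qp_zero h, ← midPt_side,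
    show 2 * ω.2.firstHitG + (k + 1) = 2 * ω.2.firstHitG + k + 1 by ring]
  -- the segment `[vtx K, vtx (K+1)]`, `K = 2 fh + k`
  rcases Nat.even_or_odd k with ⟨t, ht⟩ | ⟨t, ht⟩
  · -- `K` even: crossing segment or the final half-segment; `K = 2 i + 2` with `i = fh + t - 1`
    have ht1 : 1 ≤ t := by omega
    set i := ω.2.firstHitG + t - 1 with hi_def
    have hK : 2 * ω.2.firstHitG + k = 2 * i + 2 := by omega
    have hi : i < ω.2.arcs.length := by omega
    rw [hK]
    rcases Nat.lt_or_ge (i + 1) ω.2.arcs.length with hi1 | hi1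
    · -- crossing at `mids[i+1]`
      have eν : (ω.2.sIn (i + 1)).nIn = -(ω.2.sOut i).nIn :=
        nIn_eq_neg_of_side_eq (((YBWalk.side_sIn hi).2.1).trans ((YBWalk.side_sIn hi1).1).symm) (YBWalk.fc_succ_ne hi1)
      have ek : ω.2.vtx (2 * i + 2) = midPt (ω.2.mids[i + 1]'(YBWalk.lt_length_of_lt_arcs hi)) - (ω.2.sIn (i + 1)).nIn := by
        rw [YBWalk.vtx_even hi, YBWalk.ptOut, innerPt_eq, (YBWalk.side_sIn hi).2.1, eν, sub_neg_eq_add]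
      have ek1 : ω.2.vtx (2 * i + 2 + 1) = midPt (ω.2.mids[i + 1]'(YBWalk.lt_length_of_lt_arcs hi)) + (ω.2.sIn (i + 1)).nIn := by
        rw [show 2 * i + 2 + 1 = 2 * (i + 1) + 1 by ring, YBWalk.vtx_odd hi1, YBWalk.ptIn, innerPt_eq, (YBWalk.side_sIn hi1).1]
      rw [ek, ek1, sdot_cross_eq, Side.nIn_sq]
      have hne : ω.2.mids[i + 1]'(YBWalk.lt_length_of_lt_arcs hi) ≠ r.side ω.2.firstSideG := by
        rw [← ω.2.nth_eq_getElem, ← ω.2.nth_firstHitG]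
        intro hh; have := ω.2.nth_inj (by omega) (by omega) hh; omega
      have := one_lt_dist_midPt hne
      simp only [Prod.fst_sub, Prod.snd_sub] at this
      omega
    · -- final half-segment `[q_last, E]`
      have hi' : i + 1 = ω.2.arcs.length := by omega
      have e2 : 2 * i + 2 = 2 * ω.2.arcs.length := by omega
      rw [e2, ω.vtx_qlast hr h, ω.vtx_E]
      rw [show sdot (midPt (r.side ω.1) - ω.1.nIn) (midPt (r.side ω.1)) = sdot (midPt (r.side ω.1) - ω.1.nIn)
          (midPt (r.side ω.1) - ω.1.nIn + ω.1.nIn) from by rw [sub_add_cancel]]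
      refine sdot_half_pos _ ?_ ?_
      · rw [← ω.vtx_qlast hr h]
        obtain ⟨i', -, -, σ, e, -⟩ := vtx_eq_innerPt (ω := ω) (j := 2 * ω.2.arcs.length) (by omega) le_rfl
        rw [e]; exact midPt_ne_innerPt _ _ _
      · rw [sub_add_cancel]
        intro hh
        exact ω.firstSide_ne_fst h (r.side_injective (midPt_injective hh))
  · -- `K` odd: chord of the face `fc i`, `i = fh + t`
    set i := ω.2.firstHitG + t with hi_def
    have hK : 2 * ω.2.firstHitG + k = 2 * i + 1 := by omega
    have hi : i < ω.2.arcs.length := by omega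
    rw [hK, YBWalk.vtx_odd hi, show 2 * i + 1 + 1 = 2 * i + 2 by ring, YBWalk.vtx_even hi, YBWalk.ptIn, YBWalk.ptOut]
    exact sdot_midPt_pos _ (YBWalk.side_sIn hi).2.2 _

/-- Segments of the walk part, from vertices of the walk part. [folklore] -/
private theorem subt_kmid_jmid (h : ω.IsB2a) {k j : ℕ} (hk1 : 1 ≤ k) (hk2 : k ≤ 2 * ω.Mv) (hj1 : 1 ≤ j) (hj2 : j ≤ 2 * ω.Mv + 1)
    (h1 : j ≠ k) (h2 : j ≠ k + 1) : 0 < sdot (ω.Qp hr h k) (ω.Qp hr h (k + 1)) (ω.Qp hr h j) := by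
  have hfM := fh_add_Mv (ω := ω) h
  rw [Qp_mid h hk1 (by omega), Qp_mid h (by omega) (by omega), Qp_mid h hj1 hj2,
    show 2 * ω.2.firstHitG + (k + 1) = 2 * ω.2.firstHitG + k + 1 by ring]
  exact YBWalk.subtended (by omega) (by omega) (by omega) (by omega) (n_pos hr h)

/-- Segments of the walk part, from the tail points. [folklore] -/
private theorem subt_kmid_jtail (h : ω.IsB2a) (hc : Canon ω.2.firstSideG (ω.z1 hr h) ω.1) {k : ℕ} (hk1 : 1 ≤ k)
    (hk2 : k ≤ 2 * ω.Mv) {i' : ℕ} (hi' : i' < ω.τ hr h) :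
    0 < sdot (ω.Qp hr h k) (ω.Qp hr h (k + 1)) (ω.tailPt hr h i') := by
  have hM := three_le_Mv hr h
  have hfM := fh_add_Mv (ω := ω) h
  have hct := tailPt_cornerType (ω := ω) (hr := hr) h hi'
  rw [Qp_mid h hk1 (by omega), Qp_mid h (by omega) (by omega),
    show 2 * ω.2.firstHitG + (k + 1) = 2 * ω.2.firstHitG + k + 1 by ring]
  rcases Nat.even_or_odd k with ⟨t, ht⟩ | ⟨t, ht⟩
  · have ht1 : 1 ≤ t := by omega
    set i := ω.2.firstHitG + t - 1 with hi_def
    have hK : 2 * ω.2.firstHitG + k = 2 * i + 2 := by omega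
    have hi : i < ω.2.arcs.length := by omega
    rw [hK]
    rcases Nat.lt_or_ge (i + 1) ω.2.arcs.length with hi1 | hi1
    · have eν : (ω.2.sIn (i + 1)).nIn = -(ω.2.sOut i).nIn :=
        nIn_eq_neg_of_side_eq (((YBWalk.side_sIn hi).2.1).trans ((YBWalk.side_sIn hi1).1).symm) (YBWalk.fc_succ_ne hi1)
      have ek : ω.2.vtx (2 * i + 2) = midPt (ω.2.mids[i + 1]'(YBWalk.lt_length_of_lt_arcs hi)) - (ω.2.sIn (i + 1)).nIn := by
        rw [YBWalk.vtx_even hi, YBWalk.ptOut, innerPt_eq, (YBWalk.side_sIn hi).2.1, eν, sub_neg_eq_add]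
      have ek1 : ω.2.vtx (2 * i + 2 + 1) = midPt (ω.2.mids[i + 1]'(YBWalk.lt_length_of_lt_arcs hi)) + (ω.2.sIn (i + 1)).nIn := by
        rw [show 2 * i + 2 + 1 = 2 * (i + 1) + 1 by ring, YBWalk.vtx_odd hi1, YBWalk.ptIn, innerPt_eq, (YBWalk.side_sIn hi1).1]
      rw [ek, ek1, sdot_cross_eq, Side.nIn_sq]
      have := two_le_dist_cornerType_midPt hct (ω.2.mids[i + 1]'(YBWalk.lt_length_of_lt_arcs hi))
      omega
    · have e2 : 2 * i + 2 = 2 * ω.2.arcs.length := by omega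
      rw [e2, ω.vtx_qlast hr h, ω.vtx_E]
      rw [show sdot (midPt (r.side ω.1) - ω.1.nIn) (midPt (r.side ω.1)) = sdot (midPt (r.side ω.1) - ω.1.nIn)
          (midPt (r.side ω.1) - ω.1.nIn + ω.1.nIn) from by rw [sub_add_cancel]]
      refine sdot_half_pos _ ?_ ?_
      · rw [← ω.vtx_qlast hr h]
        obtain ⟨i'', -, -, σ, e, -⟩ := vtx_eq_innerPt (ω := ω) (j := 2 * ω.2.arcs.length) (by omega) le_rfl
        rw [e]; exact cornerType_ne_innerPt hct _ _
      · rw [sub_add_cancel]; exact cornerType_ne_midPt hct _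
  · set i := ω.2.firstHitG + t with hi_def
    have hK : 2 * ω.2.firstHitG + k = 2 * i + 1 := by omega
    have hi : i < ω.2.arcs.length := by omega
    rw [hK, YBWalk.vtx_odd hi, show 2 * i + 1 + 1 = 2 * i + 2 by ring, YBWalk.vtx_even hi, YBWalk.ptIn, YBWalk.ptOut]
    have hoff := tailPt_off_mem (ω := ω) (hr := hr) h hi'
    rcases Nat.eq_zero_or_pos t with rfl | htpos
    · -- the chord `[c₀, c₁]` of `r`
      have hi0 : i = ω.2.firstHitG := by omega
      simp only [hi0, (ω.fc_fh hr h).1, (ω.fc_fh hr h).2.1, (ω.fc_fh hr h).2.2]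
      rw [tailPt, innerPt, innerPt, add_comm r.base, add_comm r.base, add_comm r.base, sdot_add]
      exact ((table_local _ _ _ hc).2.2.1 i' (by have := τ_le (ω := ω) (hr := hr) h; omega) hi').2
    · -- a chord of a face of the excursion, `≠ r`
      have hne : ω.2.fc i ≠ r := ω.fc_ne hr h (by omega) hi
      rw [tailPt, innerPt, innerPt]
      have hmem := tailOffs_mem _ _ _ _ hoff
      refine sdot_pos_split' r (ω.2.fc i) (ω.2.sIn i).inOff_mem (ω.2.sOut i).inOff_mem (by omega) ?_
      intro d hd hg
      have hd0 : d ≠ (0, 0) := by rintro rfl; apply hne; rw [hg]; simp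
      refine table_corner_chord _ ?_ d hd hd0 _ _ (YBWalk.side_sIn hi).2.2
      generalize (tailOffs ω.snd.firstSideG (ω.z1 hr h) ω.fst).getD i' (0, 0) = p at hmem ⊢
      obtain ⟨u, v⟩ := p
      simp only at hmem
      rcases hmem with ⟨rfl | rfl, rfl | rfl⟩ <;> simp

/-- The number of tail points from the return midpoint on. [folklore] -/
private theorem tailPts_length (h : ω.IsB2a) : (tailPts ω.2.firstSideG (ω.z1 hr h) ω.1).length = ω.τ hr h + 1 := by
  simp [tailPts, τ]

/-- The tail vertices of the open path from the return midpoint on. [folklore] -/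
private theorem Qp_tailPts (h : ω.IsB2a) {i : ℕ} (hi : i ≤ ω.τ hr h) :
    ω.Qp hr h (2 * ω.Mv + 1 + i) = r.base + (tailPts ω.2.firstSideG (ω.z1 hr h) ω.1).getD i (0, 0) := by
  rcases Nat.eq_zero_or_pos i with rfl | hpos
  · rw [add_zero, Qp_E h]; simp [tailPts]
  · obtain ⟨i', rfl⟩ : ∃ i', i = i' + 1 := ⟨i - 1, by omega⟩
    rw [show 2 * ω.Mv + 1 + (i' + 1) = 2 * ω.Mv + 2 + i' by ring, Qp_tail h, tailPt]
    simp only [tailPts, List.getD_cons_succ]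

/-- The tail segments, from the other vertices. [folklore] -/
private theorem subt_ktail (h : ω.IsB2a) (hc : Canon ω.2.firstSideG (ω.z1 hr h) ω.1) {i' : ℕ} (hi' : i' < ω.τ hr h) {j : ℕ}
    (hj : j ≤ 2 * ω.Mv + ω.τ hr h + 1) (h1 : j ≠ 2 * ω.Mv + 1 + i') (h2 : j ≠ 2 * ω.Mv + 2 + i') :
    0 < sdot (ω.Qp hr h (2 * ω.Mv + 1 + i')) (ω.Qp hr h (2 * ω.Mv + 1 + i' + 1)) (ω.Qp hr h j) := by
  have hM := three_le_Mv hr h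
  have hfM := fh_add_Mv (ω := ω) h
  have hτ := τ_le (ω := ω) (hr := hr) h
  have hlen := tailPts_length (ω := ω) (hr := hr) h
  obtain ⟨t1, t2, t3, -, -⟩ := table_local _ _ _ hc
  rw [Qp_tailPts h hi'.le, show 2 * ω.Mv + 1 + i' + 1 = 2 * ω.Mv + 1 + (i' + 1) by ring, Qp_tailPts h (by omega)]
  rcases Nat.eq_zero_or_pos j with rfl | hjpos
  · -- from `m₀`
    rw [Qp_zero h, add_comm r.base, add_comm r.base, add_comm r.base, sdot_add]
    exact t1 i' (by omega) (by omega)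
  · by_cases hjm : j ≤ 2 * ω.Mv
    · -- from an inner point of the walk part
      rw [Qp_mid h (by omega) (by omega)]
      obtain ⟨i, hi, hpar, σ, e, hσ⟩ := vtx_eq_innerPt (ω := ω) (j := 2 * ω.2.firstHitG + j) (by omega) (by omega)
      rw [e, innerPt]
      -- the segment offsets
      obtain ⟨sg, hsg, e1, e2⟩ := tailSeg_mem (ω := ω) (hr := hr) h hi'
      rw [Qp_tailPts h hi'.le] at e1
      rw [show 2 * ω.Mv + 2 + i' = 2 * ω.Mv + 1 + (i' + 1) by ring, Qp_tailPts h (by omega)] at e2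
      have e1' := add_left_cancel e1
      have e2' := add_left_cancel e2
      rw [e1', e2']
      have hsgmem : (sg.1 = ω.1.offset ∨ sg.1 ∈ tailOffs ω.2.firstSideG (ω.z1 hr h) ω.1) ∧ sg.2 ∈ tailOffs ω.2.firstSideG (ω.z1 hr h) ω.1 := by
        unfold tailSegs at hsg
        have h1 := List.of_mem_zip hsg
        simp only [List.mem_cons] at h1
        exact h1
      have hu : 0 ≤ sg.1.1 ∧ sg.1.1 ≤ 4 ∧ 0 ≤ sg.1.2 ∧ sg.1.2 ≤ 4 := by
        rcases hsgmem.1 with e | hm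
        · rw [e]; cases ω.1 <;> simp [Side.offset]
        · have := tailOffs_mem _ _ _ _ hm; omega
      have hu' : 0 ≤ sg.2.1 ∧ sg.2.1 ≤ 4 ∧ 0 ≤ sg.2.2 ∧ sg.2.2 ≤ 4 := by
        have := tailOffs_mem _ _ _ _ hsgmem.2; omega
      refine sdot_pos_split r (ω.2.fc i) hu hu' σ.inOff_mem fun d hd hg => ?_
      refine table_tailSeg_inner _ _ _ hc sg hsg d hd σ ?_
      by_cases hd0 : d = (0, 0)
      · -- the face is `r`: the arc is the first one, `σ ∈ {z₀, z₁}`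
        right
        have hfc : ω.2.fc i = r := by rw [hg, hd0]; simp
        have hi0 : i = ω.2.firstHitG := by
          by_contra hne
          exact ω.fc_ne hr h (by omega) hi hfc
        subst hi0
        rw [hfc, ω.2.nth_firstHitG, (ω.2.exitSide_specG hr (ω.fh_lt h)).1] at hσ
        simp only [List.mem_cons, List.not_mem_nil, or_false] at hσ
        rcases hσ with hσ | hσ
        · left; exact r.side_injective hσ
        · right; exact r.side_injective hσ
      · left; exact hd0
    · -- from another tail point (or `E`)
      obtain ⟨j', rfl⟩ : ∃ j', j = 2 * ω.Mv + 1 + j' := ⟨j - (2 * ω.Mv + 1), by omega⟩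
      rw [Qp_tailPts h (by omega), add_comm r.base, add_comm r.base, add_comm r.base, sdot_add]
      exact t2 ⟨i', by omega⟩ ⟨j', by omega⟩ (by simp; omega) (by simp; omega) (by simp; omega) (by simp; omega)

/-- **Hopf's hypothesis for the open path of an excursion**: every segment is seen from every
other vertex under an angle `< π/2`. [folklore] -/
private theorem subtQ (h : ω.IsB2a) (hc : Canon ω.2.firstSideG (ω.z1 hr h) ω.1) {k j : ℕ}
    (hk : k ≤ 2 * ω.Mv + ω.τ hr h) (hj : j ≤ 2 * ω.Mv + ω.τ hr h + 1) (h1 : j ≠ k) (h2 : j ≠ k + 1) :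
    0 < sdot (ω.Qp hr h k) (ω.Qp hr h (k + 1)) (ω.Qp hr h j) := by
  have hM := three_le_Mv hr h
  have hτ := τ_le (ω := ω) (hr := hr) h
  have hτ0 := τ_pos (ω := ω) (hr := hr) h
  rcases Nat.eq_zero_or_pos k with rfl | hkpos
  · exact subt_k0 h (by omega) hj
  by_cases hkm : k ≤ 2 * ω.Mv
  · rcases Nat.eq_zero_or_pos j with rfl | hjpos
    · exact subt_kmid_j0 h hkpos hkm
    by_cases hjm : j ≤ 2 * ω.Mv + 1
    · exact subt_kmid_jmid h hkpos hkm hjpos hjm h1 h2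
    · obtain ⟨i', rfl⟩ : ∃ i', j = 2 * ω.Mv + 2 + i' := ⟨j - (2 * ω.Mv + 2), by omega⟩
      rw [Qp_tail h]
      exact subt_kmid_jtail h hc hkpos hkm (by omega)
  · obtain ⟨i', rfl⟩ : ∃ i', k = 2 * ω.Mv + 1 + i' := ⟨k - (2 * ω.Mv + 1), by omega⟩
    exact subt_ktail h hc (by omega) hj h1 (by omega)

/-! #### The total turning of the open path -/

variable (ω hr) in
/-- The complex open path. [folklore] -/
def qQ (h : ω.IsB2a) (j : ℕ) : ℂ := toC (ω.Qp hr h j)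

variable (ω hr) in
/-- Hopf's index `m`: the path has the vertices `0, …, m + 1`. [folklore] -/
def mQ (h : ω.IsB2a) : ℕ := 2 * ω.Mv + ω.τ hr h

variable (ω hr) in
/-- The exterior angle of the open path at its vertex `j + 1`. [folklore] -/
def extQ (h : ω.IsB2a) (j : ℕ) : ℝ :=
  ((Complex.arg (ω.qQ hr h (j + 2) - ω.qQ hr h (j + 1)) : Real.Angle) -
    (Complex.arg (ω.qQ hr h (j + 1) - ω.qQ hr h j) : Real.Angle)).toReal

/-- **Hopf's identity for the open path of an excursion.** [folklore] -/
private theorem hopfQ (h : ω.IsB2a) (hc : Canon ω.2.firstSideG (ω.z1 hr h) ω.1) :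
    ∑ j ∈ Finset.range (ω.mQ hr h), ω.extQ hr h j =
      ∑ i ∈ Finset.range (ω.mQ hr h), ((Complex.arg (ω.qQ hr h (ω.mQ hr h + 1) - ω.qQ hr h (i + 1)) : Real.Angle) -
          (Complex.arg (ω.qQ hr h (ω.mQ hr h + 1) - ω.qQ hr h i) : Real.Angle)).toReal +
        sweep (ω.qQ hr h 0) (fun k => ω.qQ hr h (k + 1)) (ω.mQ hr h) := by
  have := Hopf.hopf_open (ω.qQ hr h) (ω.mQ hr h) fun k j hk hj h1 h2 => by
    rw [qQ, qQ, qQ, ← toC_sub, ← toC_sub, re_toC_mul_conj]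
    have := ω.subtQ h hc (by unfold mQ at hk; exact hk) (by unfold mQ at hj; exact hj) h1 h2
    simp only [sdot] at this
    simp only [Prod.fst_sub, Prod.snd_sub]
    exact_mod_cast this
  unfold extQ
  rw [this, sweep]
  rfl

/-- The in-direction at the entry point of the arc `fh + t` is a positive multiple of the normal.
[folklore] -/
private theorem qQ_in (h : ω.IsB2a) {t : ℕ} (ht : t < ω.Mv) :
    ∃ c : ℝ, 0 < c ∧ ω.qQ hr h (2 * t + 1) - ω.qQ hr h (2 * t) = c * toC (ω.2.sIn (ω.2.firstHitG + t)).nIn := by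
  have hfM := fh_add_Mv (ω := ω) h
  rcases Nat.eq_zero_or_pos t with rfl | hpos
  · refine ⟨1, one_pos, ?_⟩
    rw [qQ, qQ, mul_zero, zero_add, Qp_one h, Qp_zero h, add_zero, (ω.fc_fh hr h).2.1, ← toC_sub, Side.inOff]
    push_cast; rw [one_mul]; congr 1; abel
  · have hi : ω.2.firstHitG + t < ω.2.arcs.length := by omega
    obtain ⟨c, hc, e⟩ := YBWalk.cvtx_in (γ := ω.2) hi
    refine ⟨c, hc, ?_⟩
    rw [qQ, qQ, Qp_mid h (by omega) (by omega), Qp_mid h (by omega) (by omega), ← YBWalk.cvtx, ← YBWalk.cvtx,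
      show 2 * ω.2.firstHitG + (2 * t + 1) = 2 * (ω.2.firstHitG + t) + 1 by ring,
      show 2 * ω.2.firstHitG + 2 * t = 2 * (ω.2.firstHitG + t) by ring, e]

/-- The chord of an arc in the open path. [folklore] -/
private theorem qQ_chord (h : ω.IsB2a) {t : ℕ} (ht : t < ω.Mv) :
    ω.qQ hr h (2 * t + 2) - ω.qQ hr h (2 * t + 1) = toC (chordVec (ω.2.sIn (ω.2.firstHitG + t)) (ω.2.sOut (ω.2.firstHitG + t))) := by
  have hfM := fh_add_Mv (ω := ω) h
  have hi : ω.2.firstHitG + t < ω.2.arcs.length := by omega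
  rw [qQ, qQ, Qp_mid h (by omega) (by omega), Qp_mid h (by omega) (by omega), ← YBWalk.cvtx, ← YBWalk.cvtx,
    show 2 * ω.2.firstHitG + (2 * t + 2) = 2 * (ω.2.firstHitG + t) + 2 by ring,
    show 2 * ω.2.firstHitG + (2 * t + 1) = 2 * (ω.2.firstHitG + t) + 1 by ring, YBWalk.cvtx_chord hi]

/-- The out-direction at the exit point of an arc is a positive multiple of the outward normal. [folklore] -/
private theorem qQ_out (h : ω.IsB2a) {t : ℕ} (ht : t < ω.Mv) :
    ∃ c : ℝ, 0 < c ∧ ω.qQ hr h (2 * t + 3) - ω.qQ hr h (2 * t + 2) = c * (-toC (ω.2.sOut (ω.2.firstHitG + t)).nIn) := by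
  have hfM := fh_add_Mv (ω := ω) h
  have hi : ω.2.firstHitG + t < ω.2.arcs.length := by omega
  obtain ⟨c, hc, e⟩ := YBWalk.cvtx_out (γ := ω.2) hi
  refine ⟨c, hc, ?_⟩
  rw [qQ, qQ, Qp_mid h (by omega) (by omega), Qp_mid h (by omega) (by omega), ← YBWalk.cvtx, ← YBWalk.cvtx,
    show 2 * ω.2.firstHitG + (2 * t + 3) = 2 * (ω.2.firstHitG + t) + 3 by ring,
    show 2 * ω.2.firstHitG + (2 * t + 2) = 2 * (ω.2.firstHitG + t) + 2 by ring, e]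

/-- **The turning of the walk part is its right-angle winding.** [folklore] -/
private theorem sum_extQ_walk (h : ω.IsB2a) :
    ∑ j ∈ Finset.range (2 * ω.Mv), ω.extQ hr h j =
      ∑ t ∈ Finset.range ω.Mv, arcTurn (π / 2) (ω.2.sIn (ω.2.firstHitG + t)) (ω.2.sOut (ω.2.firstHitG + t)) := by
  have hpair : ∀ (g : ℕ → ℝ) (n : ℕ), ∑ j ∈ Finset.range (2 * n), g j =
      ∑ i ∈ Finset.range n, (g (2 * i) + g (2 * i + 1)) := by
    intro g n
    induction n with
    | zero => simp
    | succ n ih => rw [show 2 * (n + 1) = 2 * n + 1 + 1 by ring, Finset.sum_range_succ, Finset.sum_range_succ, ih,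
        Finset.sum_range_succ]; ring
  rw [hpair]
  refine Finset.sum_congr rfl fun t ht => ?_
  rw [Finset.mem_range] at ht
  obtain ⟨c₁, hc₁, h₁⟩ := ω.qQ_in h ht
  obtain ⟨c₂, hc₂, h₂⟩ := ω.qQ_out h ht
  have hfM := fh_add_Mv (ω := ω) h
  have hst := (YBWalk.side_sIn (γ := ω.2) (i := ω.2.firstHitG + t) (by omega)).2.2
  unfold extQ
  rw [show 2 * t + 1 + 1 = 2 * t + 2 by ring, show 2 * t + 1 + 2 = 2 * t + 3 by ring, ω.qQ_chord h ht, h₁, h₂,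
    Complex.arg_real_mul _ hc₁, Complex.arg_real_mul _ hc₂]
  exact ext_angles_eq_arcTurn _ _ hst

/-- The winding of the excursion as a sum over its arcs. [folklore] -/
private theorem WE_eq_sum (h : ω.IsB2a) (Θ : ℤ → ℝ) :
    ω.WE Θ = ∑ t ∈ Finset.range (ω.Mv - 1),
      arcTurn (Θ (ω.2.fc (ω.2.firstHitG + 1 + t)).1) (ω.2.sIn (ω.2.firstHitG + 1 + t)) (ω.2.sOut (ω.2.firstHitG + 1 + t)) := by
  have hfM := fh_add_Mv (ω := ω) h
  unfold WE
  rw [List.sum_map_eq_sum_range_getD _ (origin, origin), List.length_drop]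
  rw [show ω.2.arcs.length - (ω.2.firstHitG + 1) = ω.Mv - 1 by omega]
  refine Finset.sum_congr rfl fun t ht => ?_
  rw [Finset.mem_range] at ht
  have hi : ω.2.firstHitG + 1 + t < ω.2.arcs.length := by omega
  rw [List.getD_eq_getElem?_getD, List.getElem?_drop, List.getElem?_eq_getElem (by omega), Option.getD_some]
  have := arcTurnOf_eq_arcTurn (Θ := Θ) (YBWalk.arcFace_arcAt hi).1
  rw [YBWalk.sIn, YBWalk.sOut]
  rw [YBWalk.arcAt, List.getD_eq_getElem?_getD, List.getElem?_eq_getElem hi, Option.getD_some] at this ⊢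
  exact this

/-- **The turning of the walk part**: the first arc plus the excursion. [folklore] -/
private theorem sum_extQ_walk_eq (h : ω.IsB2a) :
    ∑ j ∈ Finset.range (2 * ω.Mv), ω.extQ hr h j =
      arcTurn (π / 2) ω.2.firstSideG (ω.z1 hr h) + ω.WE (fun _ => π / 2) := by
  have hM := three_le_Mv hr h
  rw [ω.sum_extQ_walk h, ω.WE_eq_sum h, show ω.Mv = (ω.Mv - 1) + 1 from by omega, Finset.sum_range_succ',
    add_zero, (ω.fc_fh hr h).2.1, (ω.fc_fh hr h).2.2, z1, add_comm]
  congr 1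
  refine Finset.sum_congr (by congr 1) fun t _ => ?_
  rw [show ω.2.firstHitG + (t + 1) = ω.2.firstHitG + 1 + t by ring]

/-! #### The closed polygon of the excursion and the two swept angles -/

variable (ω hr) in
/-- **The closed polygon `J`**: the inner points of the excursion, closed through `r` by the chord
from the return side to the exit side (`2 Mv` vertices, `pJ (2 Mv) = pJ 0`). [folklore] -/
def pJ (h : ω.IsB2a) (k : ℕ) : ℂ :=
  if k = 2 * ω.Mv - 1 then toC (r.base + (ω.1).inOff) else ω.qQ hr h (k % (2 * ω.Mv) + 2)

variable (ω hr) in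
/-- The winding angle of `J` around `b`. [folklore] -/
def AJ (h : ω.IsB2a) (b : ℂ) : ℝ := sweep b (ω.pJ hr h) (2 * ω.Mv)

/-- The excursion part of `J`. [folklore] -/
private theorem pJ_lt (h : ω.IsB2a) {k : ℕ} (hk : k ≤ 2 * ω.Mv - 2) : ω.pJ hr h k = ω.qQ hr h (k + 2) := by
  have hM := three_le_Mv hr h
  rw [pJ, if_neg (by omega), Nat.mod_eq_of_lt (by omega)]

/-- The closing vertex of `J` is `c₂`. [folklore] -/
private theorem pJ_c₂ (h : ω.IsB2a) : ω.pJ hr h (2 * ω.Mv - 1) = toC (r.base + (ω.1).inOff) := by rw [pJ, if_pos rfl]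

/-- `J` returns to `c₁`. [folklore] -/
private theorem pJ_top (h : ω.IsB2a) : ω.pJ hr h (2 * ω.Mv) = ω.qQ hr h 2 := by
  have hM := three_le_Mv hr h
  rw [pJ, if_neg (by omega), Nat.mod_self]

/-- `J` is closed. [folklore] -/
private theorem pJ_closed (h : ω.IsB2a) : ω.pJ hr h (2 * ω.Mv) = ω.pJ hr h 0 := by
  rw [pJ_top h, pJ_lt h (by omega)]

/-- The winding angle of `J` split off its two closing steps. [folklore] -/
private theorem AJ_split (h : ω.IsB2a) (b : ℂ) :
    ω.AJ hr h b = ∑ k ∈ Finset.range (2 * ω.Mv - 2), angAt b (ω.qQ hr h (k + 2)) (ω.qQ hr h (k + 3)) +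
      angAt b (ω.qQ hr h (2 * ω.Mv)) (toC (r.base + (ω.1).inOff)) +
      angAt b (toC (r.base + (ω.1).inOff)) (ω.qQ hr h 2) := by
  have hM := three_le_Mv hr h
  rw [AJ, sweep, show 2 * ω.Mv = 2 * ω.Mv - 2 + 1 + 1 by omega, Finset.sum_range_succ, Finset.sum_range_succ,
    show 2 * ω.Mv - 2 + 1 + 1 = 2 * ω.Mv by omega, show 2 * ω.Mv - 2 + 1 = 2 * ω.Mv - 1 by omega, pJ_top h, pJ_c₂ h,
    pJ_lt h le_rfl, show 2 * ω.Mv - 2 + 2 = 2 * ω.Mv by omega]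
  congr 2
  refine Finset.sum_congr rfl fun k hk => ?_
  rw [Finset.mem_range] at hk
  rw [pJ_lt h (by omega), pJ_lt h (by omega)]

/-- A term of the sweep into a point is the angle at that point. [folklore] -/
private theorem toReal_into_eq_angAt {w P₀ P₁ : ℂ} (h0 : P₀ ≠ w) (h1 : P₁ ≠ w) :
    ((Complex.arg (w - P₁) : Real.Angle) - (Complex.arg (w - P₀) : Real.Angle)).toReal = angAt w P₀ P₁ := by
  unfold angAt
  congr 1
  rw [← neg_sub P₁ w, ← neg_sub P₀ w, Complex.arg_neg_coe_angle (sub_ne_zero.2 h1),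
    Complex.arg_neg_coe_angle (sub_ne_zero.2 h0)]
  abel

/-- The vertices of the open path are distinct (through Hopf's hypothesis). [folklore] -/
private theorem qQ_ne (h : ω.IsB2a) (hc : Canon ω.2.firstSideG (ω.z1 hr h) ω.1) {i j : ℕ} (hi : i ≤ ω.mQ hr h + 1)
    (hj : j ≤ ω.mQ hr h + 1) (hij : i ≠ j) : ω.qQ hr h i ≠ ω.qQ hr h j := by
  have hM := three_le_Mv hr h
  have hm : ω.mQ hr h = 2 * ω.Mv + ω.τ hr h := rfl
  intro e
  -- use a segment at `i` (or ending at `i`) seen from `j`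
  wlog hlt : i < j generalizing i j
  · exact this hj hi (Ne.symm hij) e.symm (by omega)
  by_cases hji : j = i + 1
  · subst hji
    rcases Nat.lt_or_ge (i + 1) (ω.mQ hr h + 1) with hlt' | hge
    · -- the segment `[q (i+1), q (i+2)]` seen from `q i = q (i+1)`
      have := ω.subtQ h hc (k := i + 1) (j := i) (by omega) (by omega) (by omega) (by omega)
      rw [qQ, qQ] at e
      rw [toC_injective e, sdot] at this
      simp at this
    · -- `i + 1` is the last vertex: the segment `[q (i-1), q i]` seen from `q (i+1) = q i`
      have := ω.subtQ h hc (k := i - 1) (j := i + 1) (by omega) hj (by omega) (by omega)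
      rw [qQ, qQ] at e
      rw [show i - 1 + 1 = i by omega, toC_injective e, sdot] at this
      simp at this
  · have := ω.subtQ h hc (k := i) (j := j) (by omega) hj (by omega) hji
    rw [qQ, qQ] at e
    rw [toC_injective e, sdot] at this
    simp at this

/-- **The swept angle from `m₀` in terms of the winding angle of `J`**: the terms along the
excursion are those of `J`; the remaining ones are local. [folklore] -/
private theorem S₂_eq (h : ω.IsB2a) :
    sweep (ω.qQ hr h 0) (fun k => ω.qQ hr h (k + 1)) (ω.mQ hr h) =
      ω.AJ hr h (ω.qQ hr h 0) +
        (angAt (ω.qQ hr h 0) (ω.qQ hr h 1) (ω.qQ hr h 2) -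
          angAt (ω.qQ hr h 0) (ω.qQ hr h (2 * ω.Mv)) (toC (r.base + (ω.1).inOff)) -
          angAt (ω.qQ hr h 0) (toC (r.base + (ω.1).inOff)) (ω.qQ hr h 2) +
          ∑ i ∈ Finset.range (ω.τ hr h + 1), angAt (ω.qQ hr h 0) (ω.qQ hr h (2 * ω.Mv + i)) (ω.qQ hr h (2 * ω.Mv + 1 + i))) := by
  have hM := three_le_Mv hr h
  set b := ω.qQ hr h 0
  set F : ℕ → ℝ := fun k => angAt b (ω.qQ hr h (k + 1)) (ω.qQ hr h (k + 1 + 1)) with hF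
  have h0 : sweep b (fun k => ω.qQ hr h (k + 1)) (ω.mQ hr h) = ∑ k ∈ Finset.range (ω.mQ hr h), F k := rfl
  have h1 : ∑ k ∈ Finset.range (ω.mQ hr h), F k =
      ∑ k ∈ Finset.range (2 * ω.Mv - 1), F k + ∑ i ∈ Finset.range (ω.τ hr h + 1), F (2 * ω.Mv - 1 + i) := by
    rw [mQ, show 2 * ω.Mv + ω.τ hr h = (2 * ω.Mv - 1) + (ω.τ hr h + 1) by omega, Finset.sum_range_add]
  have h2 : ∑ k ∈ Finset.range (2 * ω.Mv - 1), F k = F 0 + ∑ k ∈ Finset.range (2 * ω.Mv - 2), F (k + 1) := by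
    rw [show 2 * ω.Mv - 1 = 2 * ω.Mv - 2 + 1 by omega, Finset.sum_range_succ', add_comm]
  have h3 : ∑ k ∈ Finset.range (2 * ω.Mv - 2), F (k + 1) =
      ∑ k ∈ Finset.range (2 * ω.Mv - 2), angAt b (ω.qQ hr h (k + 2)) (ω.qQ hr h (k + 3)) := by
    refine Finset.sum_congr rfl fun k _ => ?_; simp only [hF]
  have h4 : ∑ i ∈ Finset.range (ω.τ hr h + 1), F (2 * ω.Mv - 1 + i) =
      ∑ i ∈ Finset.range (ω.τ hr h + 1), angAt b (ω.qQ hr h (2 * ω.Mv + i)) (ω.qQ hr h (2 * ω.Mv + 1 + i)) := by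
    refine Finset.sum_congr rfl fun i _ => ?_
    simp only [hF]
    rw [show 2 * ω.Mv - 1 + i + 1 = 2 * ω.Mv + i by omega, show 2 * ω.Mv + i + 1 = 2 * ω.Mv + 1 + i by omega]
  have hF0 : F 0 = angAt b (ω.qQ hr h 1) (ω.qQ hr h 2) := rfl
  rw [h0, h1, h2, h3, h4, hF0, ω.AJ_split h b]
  ring

/-- **The swept angle into `w` in terms of the winding angle of `J`.** [folklore] -/
private theorem S₁_eq (h : ω.IsB2a) (hc : Canon ω.2.firstSideG (ω.z1 hr h) ω.1) :
    ∑ i ∈ Finset.range (ω.mQ hr h), ((Complex.arg (ω.qQ hr h (ω.mQ hr h + 1) - ω.qQ hr h (i + 1)) : Real.Angle) -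
        (Complex.arg (ω.qQ hr h (ω.mQ hr h + 1) - ω.qQ hr h i) : Real.Angle)).toReal =
      ω.AJ hr h (ω.qQ hr h (ω.mQ hr h + 1)) +
        (angAt (ω.qQ hr h (ω.mQ hr h + 1)) (ω.qQ hr h 0) (ω.qQ hr h 1) +
          angAt (ω.qQ hr h (ω.mQ hr h + 1)) (ω.qQ hr h 1) (ω.qQ hr h 2) -
          angAt (ω.qQ hr h (ω.mQ hr h + 1)) (ω.qQ hr h (2 * ω.Mv)) (toC (r.base + (ω.1).inOff)) -
          angAt (ω.qQ hr h (ω.mQ hr h + 1)) (toC (r.base + (ω.1).inOff)) (ω.qQ hr h 2) +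
          ∑ i ∈ Finset.range (ω.τ hr h), angAt (ω.qQ hr h (ω.mQ hr h + 1)) (ω.qQ hr h (2 * ω.Mv + i))
            (ω.qQ hr h (2 * ω.Mv + 1 + i))) := by
  have hM := three_le_Mv hr h
  set w := ω.qQ hr h (ω.mQ hr h + 1)
  -- every term is an angle at `w`
  rw [Finset.sum_congr rfl fun i hi => toReal_into_eq_angAt
    (ω.qQ_ne h hc (by rw [Finset.mem_range] at hi; omega) le_rfl (by rw [Finset.mem_range] at hi; omega))
    (ω.qQ_ne h hc (by rw [Finset.mem_range] at hi; omega) le_rfl (by rw [Finset.mem_range] at hi; omega))]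
  set G : ℕ → ℝ := fun i => angAt w (ω.qQ hr h i) (ω.qQ hr h (i + 1)) with hG
  have h1 : ∑ i ∈ Finset.range (ω.mQ hr h), G i =
      ∑ i ∈ Finset.range (2 * ω.Mv), G i + ∑ i ∈ Finset.range (ω.τ hr h), G (2 * ω.Mv + i) := by
    rw [mQ, Finset.sum_range_add]
  have h2 : ∑ i ∈ Finset.range (2 * ω.Mv), G i = G 0 + G 1 + ∑ k ∈ Finset.range (2 * ω.Mv - 2), G (k + 2) := by
    have e : 2 * ω.Mv = 2 * ω.Mv - 2 + 1 + 1 := by omega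
    conv_lhs => rw [e, Finset.sum_range_succ', Finset.sum_range_succ']
    simp only [zero_add]
    ring
  have h3 : ∑ k ∈ Finset.range (2 * ω.Mv - 2), G (k + 2) =
      ∑ k ∈ Finset.range (2 * ω.Mv - 2), angAt w (ω.qQ hr h (k + 2)) (ω.qQ hr h (k + 3)) := by
    refine Finset.sum_congr rfl fun k _ => ?_; simp only [hG]
  have h4 : ∑ i ∈ Finset.range (ω.τ hr h), G (2 * ω.Mv + i) =
      ∑ i ∈ Finset.range (ω.τ hr h), angAt w (ω.qQ hr h (2 * ω.Mv + i)) (ω.qQ hr h (2 * ω.Mv + 1 + i)) := by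
    refine Finset.sum_congr rfl fun i _ => ?_
    simp only [hG]
    rw [show 2 * ω.Mv + i + 1 = 2 * ω.Mv + 1 + i by omega]
  have hG0 : G 0 = angAt w (ω.qQ hr h 0) (ω.qQ hr h 1) := rfl
  have hG1 : G 1 = angAt w (ω.qQ hr h 1) (ω.qQ hr h 2) := rfl
  show ∑ i ∈ Finset.range (ω.mQ hr h), G i = _
  rw [h1, h2, h3, h4, hG0, hG1, ω.AJ_split h w]
  ring

/-- **The total turning splits into the walk part and the tail.** [folklore] -/
private theorem T_eq (h : ω.IsB2a) :
    ∑ j ∈ Finset.range (ω.mQ hr h), ω.extQ hr h j =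
      arcTurn (π / 2) ω.2.firstSideG (ω.z1 hr h) + ω.WE (fun _ => π / 2) +
        ∑ i ∈ Finset.range (ω.τ hr h), ω.extQ hr h (2 * ω.Mv + i) := by
  rw [mQ, Finset.sum_range_add, ω.sum_extQ_walk_eq h]

/-! #### The winding angle of `J` vanishes at `m₀` and at `w` -/


variable (ω hr) in
/-- The vertices of `J` as lattice points. [folklore] -/
def pJpt (h : ω.IsB2a) (k : ℕ) : ℤ × ℤ :=
  if k = 2 * ω.Mv - 1 then r.base + (ω.1).inOff else ω.Qp hr h (k % (2 * ω.Mv) + 2)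

/-- The vertices of `J` are lattice points. [folklore] -/
private theorem pJ_eq_toC (h : ω.IsB2a) (k : ℕ) : ω.pJ hr h k = toC (ω.pJpt hr h k) := by
  unfold pJ pJpt qQ; split_ifs <;> rfl

/-- The excursion part of `J`, as lattice points. [folklore] -/
private theorem pJpt_lt (h : ω.IsB2a) {k : ℕ} (hk : k ≤ 2 * ω.Mv - 2) : ω.pJpt hr h k = ω.Qp hr h (k + 2) := by
  have hM := three_le_Mv hr h
  rw [pJpt, if_neg (by omega), Nat.mod_eq_of_lt (by omega)]

/-- The closing vertex of `J`, as a lattice point. [folklore] -/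
private theorem pJpt_c₂ (h : ω.IsB2a) : ω.pJpt hr h (2 * ω.Mv - 1) = r.base + (ω.1).inOff := by rw [pJpt, if_pos rfl]

/-- `J` returns to `c₁`, as lattice points. [folklore] -/
private theorem pJpt_top (h : ω.IsB2a) : ω.pJpt hr h (2 * ω.Mv) = ω.Qp hr h 2 := by
  have hM := three_le_Mv hr h
  rw [pJpt, if_neg (by omega), Nat.mod_self]

/-- The vertices of `J` are inner points: of faces of the excursion (`≠ r`), or `c₁`, `c₂`.
[folklore] -/
private theorem pJpt_cases (h : ω.IsB2a) {k : ℕ} (hk : k ≤ 2 * ω.Mv) :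
    (∃ i, ω.2.firstHitG < i ∧ i < ω.2.arcs.length ∧ ∃ σ, ω.pJpt hr h k = innerPt (ω.2.fc i) σ) ∨
      ω.pJpt hr h k = innerPt r (ω.z1 hr h) ∨ ω.pJpt hr h k = innerPt r ω.1 := by
  have hM := three_le_Mv hr h
  have hfM := fh_add_Mv (ω := ω) h
  rcases Nat.lt_or_ge k (2 * ω.Mv - 1) with hlt | hge
  · rw [pJpt_lt h (by omega)]
    rcases Nat.eq_zero_or_pos k with rfl | hpos
    · right; left; rw [zero_add, Qp_two h, innerPt]
    · left
      rw [Qp_mid h (by omega) (by omega)]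
      obtain ⟨i, hi, hpar, σ, e, -⟩ := vtx_eq_innerPt (ω := ω) (j := 2 * ω.2.firstHitG + (k + 2)) (by omega) (by omega)
      exact ⟨i, by omega, hi, σ, e⟩
  · rcases hge.lt_or_eq with hgt | heq
    · have : k = 2 * ω.Mv := by omega
      subst this
      right; left; rw [pJpt_top h, Qp_two h, innerPt]
    · right; right; rw [← heq, pJpt_c₂ h, innerPt]

/-- **The segments of `J` are seen under acute angles from the midpoints of the prefix** (including
`m₀`). [folklore] -/
private theorem sdot_pJpt_midPt (h : ω.IsB2a) {i : ℕ} (hi : i ≤ ω.2.firstHitG) {k : ℕ} (hk : k < 2 * ω.Mv) :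
    0 < sdot (ω.pJpt hr h k) (ω.pJpt hr h (k + 1)) (midPt (ω.2.nth i)) := by
  have hM := three_le_Mv hr h
  have hfM := fh_add_Mv (ω := ω) h
  rcases Nat.lt_or_ge k (2 * ω.Mv - 2) with hlt | hge
  · -- a segment of the excursion: `[vtx (2fh+k+2), vtx (2fh+k+3)]`
    rw [pJpt_lt h hlt.le, pJpt_lt h (by omega), Qp_mid h (by omega) (by omega), Qp_mid h (by omega) (by omega),
      show 2 * ω.2.firstHitG + (k + 1 + 2) = 2 * ω.2.firstHitG + (k + 2) + 1 by ring]
    rcases Nat.even_or_odd k with ⟨t, ht⟩ | ⟨t, ht⟩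
    · -- `K = 2 fh + k + 2` even: crossing at `mids[fh + t + 1]`
      set j := ω.2.firstHitG + t with hj_def
      have hK : 2 * ω.2.firstHitG + (k + 2) = 2 * j + 2 := by omega
      have hj : j < ω.2.arcs.length := by omega
      have hj1 : j + 1 < ω.2.arcs.length := by omega
      rw [hK]
      have eν : (ω.2.sIn (j + 1)).nIn = -(ω.2.sOut j).nIn :=
        nIn_eq_neg_of_side_eq (((YBWalk.side_sIn hj).2.1).trans ((YBWalk.side_sIn hj1).1).symm) (YBWalk.fc_succ_ne hj1)
      have ek : ω.2.vtx (2 * j + 2) = midPt (ω.2.mids[j + 1]'(YBWalk.lt_length_of_lt_arcs hj)) - (ω.2.sIn (j + 1)).nIn := by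
        rw [YBWalk.vtx_even hj, YBWalk.ptOut, innerPt_eq, (YBWalk.side_sIn hj).2.1, eν, sub_neg_eq_add]
      have ek1 : ω.2.vtx (2 * j + 2 + 1) = midPt (ω.2.mids[j + 1]'(YBWalk.lt_length_of_lt_arcs hj)) + (ω.2.sIn (j + 1)).nIn := by
        rw [show 2 * j + 2 + 1 = 2 * (j + 1) + 1 by ring, YBWalk.vtx_odd hj1, YBWalk.ptIn, innerPt_eq, (YBWalk.side_sIn hj1).1]
      rw [ek, ek1, sdot_cross_eq, Side.nIn_sq]
      have hne : ω.2.mids[j + 1]'(YBWalk.lt_length_of_lt_arcs hj) ≠ ω.2.nth i := by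
        rw [← ω.2.nth_eq_getElem]
        intro hh; have := ω.2.nth_inj (by omega) (by omega) hh; omega
      have := one_lt_dist_midPt hne
      simp only [Prod.fst_sub, Prod.snd_sub] at this
      omega
    · -- odd: a chord
      set j := ω.2.firstHitG + t + 1 with hj_def
      have hK : 2 * ω.2.firstHitG + (k + 2) = 2 * j + 1 := by omega
      have hj : j < ω.2.arcs.length := by omega
      rw [hK, YBWalk.vtx_odd hj, show 2 * j + 1 + 1 = 2 * j + 2 by ring, YBWalk.vtx_even hj, YBWalk.ptIn, YBWalk.ptOut]
      exact sdot_midPt_pos _ (YBWalk.side_sIn hj).2.2 _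
  · rcases Nat.lt_or_ge k (2 * ω.Mv - 1) with hlt' | hge'
    · -- the crossing at the return side: `[q_last, c₂]`
      have hk' : k = 2 * ω.Mv - 2 := by omega
      subst hk'
      rw [pJpt_lt h le_rfl, show 2 * ω.Mv - 2 + 2 = 2 * ω.Mv by omega, Qp_qlast h,
        show 2 * ω.Mv - 2 + 1 = 2 * ω.Mv - 1 by omega, pJpt_c₂ h, Side.inOff, ← add_assoc, ← midPt_side, add_sub_assoc', ← midPt_side]
      rw [sdot_cross_eq, Side.nIn_sq]
      have hne : r.side ω.1 ≠ ω.2.nth i := by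
        intro hh
        have := ω.2.nth_inj (i := ω.2.arcs.length) (j := i) le_rfl (by omega) (ω.2.nth_length.trans hh)
        omega
      have := one_lt_dist_midPt hne
      simp only [Prod.fst_sub, Prod.snd_sub] at this
      omega
    · -- the closing chord `[c₂, c₁]`
      have hk' : k = 2 * ω.Mv - 1 := by omega
      subst hk'
      rw [pJpt_c₂ h, show 2 * ω.Mv - 1 + 1 = 2 * ω.Mv by omega, pJpt_top h, Qp_two h, ← innerPt, ← innerPt]
      refine sdot_midPt_pos _ ?_ _
      have := (ω.2.sides_distinctG hr h.1).2.2
      rw [ω.returnSide_of_isB2a h] at this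
      exact this

/-- The vertices of `J`, precisely: entry/exit inner points of excursion arcs, or `c₁`, `c₂`.
[folklore] -/
private theorem pJpt_cases' (h : ω.IsB2a) {k : ℕ} (hk : k ≤ 2 * ω.Mv) :
    (∃ i, ω.2.firstHitG < i ∧ i < ω.2.arcs.length ∧
        (ω.pJpt hr h k = innerPt (ω.2.fc i) (ω.2.sIn i) ∨ ω.pJpt hr h k = innerPt (ω.2.fc i) (ω.2.sOut i))) ∨
      ω.pJpt hr h k = innerPt r (ω.z1 hr h) ∨ ω.pJpt hr h k = innerPt r ω.1 := by
  have hM := three_le_Mv hr h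
  have hfM := fh_add_Mv (ω := ω) h
  rcases Nat.lt_or_ge k (2 * ω.Mv - 1) with hlt | hge
  · rw [pJpt_lt h (by omega)]
    rcases Nat.eq_zero_or_pos k with rfl | hpos
    · right; left; rw [zero_add, Qp_two h, innerPt]
    · left
      rw [Qp_mid h (by omega) (by omega)]
      rcases YBWalk.index_cases (γ := ω.2) (2 * ω.2.firstHitG + (k + 2)) (by omega) with h0 | ⟨i, hi, e⟩ | ⟨i, hi, e⟩ | h0
      · omega
      · refine ⟨i, by omega, hi, Or.inl ?_⟩; rw [e, YBWalk.vtx_odd hi, YBWalk.ptIn]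
      · refine ⟨i, by omega, hi, Or.inr ?_⟩; rw [e, YBWalk.vtx_even hi, YBWalk.ptOut]
      · omega
  · rcases hge.lt_or_eq with hgt | heq
    · have : k = 2 * ω.Mv := by omega
      subst this
      right; left; rw [pJpt_top h, Qp_two h, innerPt]
    · right; right; rw [← heq, pJpt_c₂ h, innerPt]

/-- **The rungs of the prefix are seen under acute angles from the vertices of `J`.** [folklore] -/
private theorem sdot_rungP (h : ω.IsB2a) {i : ℕ} (hi : i < ω.2.firstHitG) {k : ℕ} (hk : k ≤ 2 * ω.Mv) :
    0 < sdot (midPt (ω.2.nth i)) (midPt (ω.2.nth (i + 1))) (ω.pJpt hr h k) := by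
  have hfM := fh_add_Mv (ω := ω) h
  have hi' : i < ω.2.arcs.length := by omega
  obtain ⟨hs, ht, hst⟩ := YBWalk.side_sIn (γ := ω.2) hi'
  rw [← ω.2.nth_eq_getElem] at hs
  rw [← ω.2.nth_eq_getElem] at ht
  rw [← hs, ← ht, midPt_side, midPt_side]
  have hfc : ω.2.fc i ≠ r := by
    intro e
    have := (YBWalk.arcFace_arcAt hi').1
    rw [YBWalk.arcAt_eq hi', e, ← ω.2.nth_eq_getElem, ← ω.2.nth_eq_getElem] at this
    exact ω.2.arcFace_ne_of_lt_firstHitG hi hi' this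
  have hoff : ∀ s : Side, 0 ≤ s.offset.1 ∧ s.offset.1 ≤ 4 ∧ 0 ≤ s.offset.2 ∧ s.offset.2 ≤ 4 := by
    intro s; cases s <;> simp [Side.offset]
  -- the generic step: a vertex `innerPt g σ` with the same-face exclusions
  have step : ∀ (g : Face) (σ : Side),
      (g = ω.2.fc i → σ ≠ ω.2.sIn i ∧ σ ≠ ω.2.sOut i ∧ arcKind (ω.2.sIn i) (ω.2.sOut i) ≠ .straight) →
      0 < sdot ((ω.2.fc i).base + (ω.2.sIn i).offset) ((ω.2.fc i).base + (ω.2.sOut i).offset) (innerPt g σ) := by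
    intro g σ hsame
    refine sdot_pos_split (ω.2.fc i) g (hoff _) (hoff _) σ.inOff_mem fun d hd hg => ?_
    refine table_rung_inner _ _ hst d hd σ ?_
    by_cases hd0 : d = (0, 0)
    · right; exact hsame (by rw [hg, hd0]; simp)
    · left; exact hd0
  rcases ω.pJpt_cases' h hk with ⟨i', hi'1, hi'2, e | e⟩ | e | e
  · rw [e]
    refine step _ _ fun hg => ?_
    obtain ⟨hopp, d1, d2, -, -⟩ := YBWalk.not_straight_of_two_arcs hi' hi'2 (by omega) hg
    exact ⟨d1, d2, arcKind_ne_straight hopp⟩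
  · rw [e]
    refine step _ _ fun hg => ?_
    obtain ⟨hopp, -, -, d3, d4⟩ := YBWalk.not_straight_of_two_arcs hi' hi'2 (by omega) hg
    exact ⟨d3, d4, arcKind_ne_straight hopp⟩
  · rw [e]; exact step _ _ fun hg => absurd hg.symm hfc
  · rw [e]; exact step _ _ fun hg => absurd hg.symm hfc

/-- **`J` does not wind around the root when a coordinate separates them**: if an integer
functional `φ` of the plane, the imaginary part of `c · (−)` up to an additive constant, is larger
at every vertex of `J` than at the midpoint of the root, then the winding angle of `J` around that
midpoint vanishes (the closed polygon lies in a half-plane not containing the base point, and its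
steps are seen from the root under angles `< π/2`). [folklore] -/
private theorem AJ_root_of_coord (h : ω.IsB2a) {c : ℂ} (hc : c ≠ 0) (φ : ℤ × ℤ → ℤ)
    (hφ : ∀ p q : ℤ × ℤ, (c * (toC p - toC q)).im = ((φ p - φ q : ℤ) : ℝ))
    (hlt : ∀ k ≤ 2 * ω.Mv, φ (midPt a) < φ (ω.pJpt hr h k)) : ω.AJ hr h (toC (midPt a)) = 0 := by
  refine sweep_eq_zero_of_halfPlane hc _ _ _ (ω.pJ_closed h) (fun k hk => ?_) (fun k hk => ?_) (fun k hk => ?_)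
  · rw [pJ_eq_toC]
    intro hh
    have e := congrArg φ (toC_injective hh)
    have h1 := hlt k hk
    rw [e] at h1
    exact lt_irrefl _ h1
  · rw [pJ_eq_toC, hφ]
    exact_mod_cast sub_nonneg.2 (hlt k hk).le
  · rw [pJ_eq_toC, pJ_eq_toC, re_seg]
    have h0 := ω.sdot_pJpt_midPt (hr := hr) h (Nat.zero_le _) hk
    rw [ω.2.nth_zero] at h0
    exact_mod_cast h0

/-- The vertices of `J` are inner points of faces of the domain. [folklore] -/
private theorem pJpt_eq_innerPt (h : ω.IsB2a) {k : ℕ} (hk : k ≤ 2 * ω.Mv) :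
    ∃ g ∈ D, ∃ σ : Side, ω.pJpt hr h k = innerPt g σ := by
  rcases ω.pJpt_cases' h hk with ⟨i', -, hi'2, e | e⟩ | e | e
  · exact ⟨_, (YBWalk.arcFace_arcAt hi'2).2, _, e⟩
  · exact ⟨_, (YBWalk.arcFace_arcAt hi'2).2, _, e⟩
  · exact ⟨_, hr.mem, _, e⟩
  · exact ⟨_, hr.mem, _, e⟩

/-- **The steps of `J` have squared length `≤ 4`** (crossing steps `2ν`, in-face chords between two
inner points). [folklore] -/
private theorem distSq_pJpt_succ_le (h : ω.IsB2a) {k : ℕ} (hk : k < 2 * ω.Mv) :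
    ((ω.pJpt hr h (k + 1)).1 - (ω.pJpt hr h k).1) ^ 2 + ((ω.pJpt hr h (k + 1)).2 - (ω.pJpt hr h k).2) ^ 2 ≤ 4 := by
  have hM := three_le_Mv hr h
  have hfM := fh_add_Mv (ω := ω) h
  rcases Nat.lt_or_ge k (2 * ω.Mv - 2) with hlt | hge
  · rw [pJpt_lt h hlt.le, pJpt_lt h (by omega), Qp_mid h (by omega) (by omega), Qp_mid h (by omega) (by omega),
      show 2 * ω.2.firstHitG + (k + 1 + 2) = 2 * ω.2.firstHitG + (k + 2) + 1 by ring]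
    rcases Nat.even_or_odd k with ⟨t, ht⟩ | ⟨t, ht⟩
    · set j := ω.2.firstHitG + t with hj_def
      have hK : 2 * ω.2.firstHitG + (k + 2) = 2 * j + 2 := by omega
      have hj : j < ω.2.arcs.length := by omega
      have hj1 : j + 1 < ω.2.arcs.length := by omega
      rw [hK]
      have eν : (ω.2.sIn (j + 1)).nIn = -(ω.2.sOut j).nIn :=
        nIn_eq_neg_of_side_eq (((YBWalk.side_sIn hj).2.1).trans ((YBWalk.side_sIn hj1).1).symm) (YBWalk.fc_succ_ne hj1)
      have ek : ω.2.vtx (2 * j + 2) = midPt (ω.2.mids[j + 1]'(YBWalk.lt_length_of_lt_arcs hj)) - (ω.2.sIn (j + 1)).nIn := by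
        rw [YBWalk.vtx_even hj, YBWalk.ptOut, innerPt_eq, (YBWalk.side_sIn hj).2.1, eν, sub_neg_eq_add]
      have ek1 : ω.2.vtx (2 * j + 2 + 1) = midPt (ω.2.mids[j + 1]'(YBWalk.lt_length_of_lt_arcs hj)) + (ω.2.sIn (j + 1)).nIn := by
        rw [show 2 * j + 2 + 1 = 2 * (j + 1) + 1 by ring, YBWalk.vtx_odd hj1, YBWalk.ptIn, innerPt_eq, (YBWalk.side_sIn hj1).1]
      rw [ek, ek1]
      have hν := Side.nIn_sq (ω.2.sIn (j + 1))
      simp only [Prod.fst_sub, Prod.snd_sub, Prod.fst_add, Prod.snd_add]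
      nlinarith [hν]
    · set j := ω.2.firstHitG + t + 1 with hj_def
      have hK : 2 * ω.2.firstHitG + (k + 2) = 2 * j + 1 := by omega
      have hj : j < ω.2.arcs.length := by omega
      rw [hK, YBWalk.vtx_odd hj, show 2 * j + 1 + 1 = 2 * j + 2 by ring, YBWalk.vtx_even hj, YBWalk.ptIn, YBWalk.ptOut]
      exact distSq_innerPt_innerPt_le _ _ _
  · rcases Nat.lt_or_ge k (2 * ω.Mv - 1) with hlt' | hge'
    · have hk' : k = 2 * ω.Mv - 2 := by omega
      subst hk'
      rw [pJpt_lt h le_rfl, show 2 * ω.Mv - 2 + 2 = 2 * ω.Mv by omega, Qp_qlast h,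
        show 2 * ω.Mv - 2 + 1 = 2 * ω.Mv - 1 by omega, pJpt_c₂ h, Side.inOff]
      have hν := Side.nIn_sq ω.1
      simp only [Prod.fst_sub, Prod.snd_sub, Prod.fst_add, Prod.snd_add]
      nlinarith [hν]
    · have hk' : k = 2 * ω.Mv - 1 := by omega
      subst hk'
      rw [pJpt_c₂ h, show 2 * ω.Mv - 1 + 1 = 2 * ω.Mv by omega, pJpt_top h, Qp_two h, ← innerPt, ← innerPt]
      exact distSq_innerPt_innerPt_le _ _ _

/-- **A far base point sees every step of `J` under an angle `< π/2`**: squared distance `≥ 5` to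
all vertices suffices, the steps having squared length `≤ 4`. [folklore] -/
private theorem sdot_pJpt_of_far (h : ω.IsB2a) (w : ℤ × ℤ)
    (hw : ∀ k ≤ 2 * ω.Mv, 5 ≤ ((ω.pJpt hr h k).1 - w.1) ^ 2 + ((ω.pJpt hr h k).2 - w.2) ^ 2) {k : ℕ}
    (hk : k < 2 * ω.Mv) : 0 < sdot (ω.pJpt hr h k) (ω.pJpt hr h (k + 1)) w := by
  have h1 := hw k hk.le
  have h2 := hw (k + 1) hk
  have h3 := ω.distSq_pJpt_succ_le (hr := hr) h hk
  unfold sdot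
  nlinarith [h1, h2, h3]

/-- **Transport of the winding angle of `J` between two integer base points** (all plaquettes of
the secant homotopy valid). [folklore] -/
private theorem AJ_eq_AJ_of_sdot (h : ω.IsB2a) (w w' : ℤ × ℤ)
    (hX : ∀ k < 2 * ω.Mv, 0 < sdot (ω.pJpt hr h k) (ω.pJpt hr h (k + 1)) w)
    (hY : ∀ k < 2 * ω.Mv, 0 < sdot (ω.pJpt hr h k) (ω.pJpt hr h (k + 1)) w')
    (hZ : ∀ k ≤ 2 * ω.Mv, 0 < sdot w w' (ω.pJpt hr h k)) :
    ω.AJ hr h (toC w) = ω.AJ hr h (toC w') := by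
  refine sweep_eq_sweep_of_closed _ _ _ _ (ω.pJ_closed h) (fun k hk => ?_) (fun k hk => ?_) (fun k hk => ?_)
  · rw [pJ_eq_toC, pJ_eq_toC, re_seg]; exact_mod_cast hX k hk
  · rw [pJ_eq_toC, pJ_eq_toC, re_seg]; exact_mod_cast hY k hk
  · rw [pJ_eq_toC, re_seg]; exact_mod_cast hZ k hk

/-- **The winding angle of `J` vanishes at a base point separated from `J` by a coordinate**
(general base point; the steps of `J` must be seen under acute angles). [folklore] -/
private theorem AJ_eq_zero_of_coord (h : ω.IsB2a) {c : ℂ} (hc : c ≠ 0) (φ : ℤ × ℤ → ℤ)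
    (hφ : ∀ p q : ℤ × ℤ, (c * (toC p - toC q)).im = ((φ p - φ q : ℤ) : ℝ)) (b : ℤ × ℤ)
    (hlt : ∀ k ≤ 2 * ω.Mv, φ b < φ (ω.pJpt hr h k))
    (hX : ∀ k < 2 * ω.Mv, 0 < sdot (ω.pJpt hr h k) (ω.pJpt hr h (k + 1)) b) : ω.AJ hr h (toC b) = 0 := by
  refine sweep_eq_zero_of_halfPlane hc _ _ _ (ω.pJ_closed h) (fun k hk => ?_) (fun k hk => ?_) (fun k hk => ?_)
  · rw [pJ_eq_toC]
    intro hh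
    have e := congrArg φ (toC_injective hh)
    have h1 := hlt k hk
    rw [e] at h1
    exact lt_irrefl _ h1
  · rw [pJ_eq_toC, hφ]
    exact_mod_cast sub_nonneg.2 (hlt k hk).le
  · rw [pJ_eq_toC, pJ_eq_toC, re_seg]
    exact_mod_cast hX k hk

/-- `J` is far from the centre of every face outside the domain. [folklore] -/
private theorem far_ctr (h : ω.IsB2a) {g : Face} (hg : g ∉ D) {k : ℕ} (hk : k ≤ 2 * ω.Mv) :
    9 ≤ ((ω.pJpt hr h k).1 - (Face.ctr g).1) ^ 2 + ((ω.pJpt hr h k).2 - (Face.ctr g).2) ^ 2 := by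
  obtain ⟨g', hg', σ, e⟩ := ω.pJpt_eq_innerPt (hr := hr) h hk
  rw [e]
  exact nine_le_distSq_innerPt_ctr (fun hh : g' = g => hg (by rw [← hh]; exact hg')) σ

/-- `J` is far from every lattice corner. [folklore] -/
private theorem far_corner (h : ω.IsB2a) (q : ℤ × ℤ) {k : ℕ} (hk : k ≤ 2 * ω.Mv) :
    5 ≤ ((ω.pJpt hr h k).1 - (cornerPt q).1) ^ 2 + ((ω.pJpt hr h k).2 - (cornerPt q).2) ^ 2 := by
  obtain ⟨g', -, σ, e⟩ := ω.pJpt_eq_innerPt (hr := hr) h hk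
  rw [e]
  exact five_le_distSq_innerPt_corner g' σ q

/-- `J` avoids every edge midpoint by at least `1`. [folklore] -/
private theorem far_midPt (h : ω.IsB2a) (e : MidEdge) {k : ℕ} (hk : k ≤ 2 * ω.Mv) :
    1 ≤ ((ω.pJpt hr h k).1 - (midPt e).1) ^ 2 + ((ω.pJpt hr h k).2 - (midPt e).2) ^ 2 := by
  obtain ⟨g', -, σ, e'⟩ := ω.pJpt_eq_innerPt (hr := hr) h hk
  rw [e']
  exact one_le_distSq_innerPt_midPt g' σ e

/-- **Transport from the centre of an exterior face to one of its corners.** [folklore] -/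
private theorem AJ_ctr_eq_AJ_corner (h : ω.IsB2a) {g : Face} (hg : g ∉ D) {q : ℤ × ℤ} (hq : IsCornerOf q g) :
    ω.AJ hr h (toC (Face.ctr g)) = ω.AJ hr h (toC (cornerPt q)) := by
  refine ω.AJ_eq_AJ_of_sdot (hr := hr) h _ _ (fun k hk => ?_) (fun k hk => ?_) (fun k hk => ?_)
  · exact ω.sdot_pJpt_of_far (hr := hr) h _ (fun k' hk' => le_trans (by norm_num) (ω.far_ctr (hr := hr) h hg hk')) hk
  · exact ω.sdot_pJpt_of_far (hr := hr) h _ (fun k' hk' => ω.far_corner (hr := hr) h q hk') hk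
  · exact sdot_ctr_corner_pos hq (ω.far_ctr (hr := hr) h hg hk) (ω.far_corner (hr := hr) h q hk)

/-- **Transport from the midpoint of the root to the centre of its exterior face.** [folklore] -/
private theorem AJ_root_eq_AJ_ctr (h : ω.IsB2a) {g : Face} (hg : g ∉ D) {s : Side} (hs : g.side s = a) :
    ω.AJ hr h (toC (midPt a)) = ω.AJ hr h (toC (Face.ctr g)) := by
  refine ω.AJ_eq_AJ_of_sdot (hr := hr) h _ _ (fun k hk => ?_) (fun k hk => ?_) (fun k hk => ?_)
  · have h0 := ω.sdot_pJpt_midPt (hr := hr) h (Nat.zero_le _) hk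
    rw [ω.2.nth_zero] at h0
    exact h0
  · exact ω.sdot_pJpt_of_far (hr := hr) h _ (fun k' hk' => le_trans (by norm_num) (ω.far_ctr (hr := hr) h hg hk')) hk
  · have hz := sdot_midPt_ctr_pos g s (ω.far_ctr (hr := hr) h hg hk) (ω.far_midPt (hr := hr) h (g.side s) hk)
    rw [hs] at hz
    exact hz

/-- **The winding angle of `J` vanishes at the centre of an exterior face beyond the domain.**
[folklore] -/
private theorem AJ_ctr_eq_zero_of_beyond (h : ω.IsB2a) {g : Face} (hg : g ∉ D)
    (hb : (∀ f ∈ D, g.1 < f.1) ∨ (∀ f ∈ D, f.1 < g.1) ∨ (∀ f ∈ D, g.2 < f.2) ∨ (∀ f ∈ D, f.2 < g.2)) :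
    ω.AJ hr h (toC (Face.ctr g)) = 0 := by
  have hX : ∀ k < 2 * ω.Mv, 0 < sdot (ω.pJpt hr h k) (ω.pJpt hr h (k + 1)) (Face.ctr g) := fun k hk =>
    ω.sdot_pJpt_of_far (hr := hr) h _ (fun k' hk' => le_trans (by norm_num) (ω.far_ctr (hr := hr) h hg hk')) hk
  have hin := fun k (hk : k ≤ 2 * ω.Mv) => ω.pJpt_eq_innerPt (hr := hr) h hk
  have hc1 : (Face.ctr g).1 = 4 * g.1 + 2 := by simp [Face.ctr, Face.base]
  have hc2 : (Face.ctr g).2 = 4 * g.2 + 2 := by simp [Face.ctr, Face.base]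
  rcases hb with hb | hb | hb | hb
  · refine ω.AJ_eq_zero_of_coord (hr := hr) h Complex.I_ne_zero (fun p => p.1) im_I_mul_toC_sub _ (fun k hk => ?_) hX
    obtain ⟨g', hg', σ, e⟩ := hin k hk
    have hs := innerPt_shape g' σ
    have := hb g' hg'
    simp only [e, hc1]
    omega
  · refine ω.AJ_eq_zero_of_coord (hr := hr) h (neg_ne_zero.2 Complex.I_ne_zero) (fun p => -p.1) im_negI_mul_toC_sub _
      (fun k hk => ?_) hX
    obtain ⟨g', hg', σ, e⟩ := hin k hk
    have hs := innerPt_shape g' σ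
    have := hb g' hg'
    simp only [e, hc1]
    omega
  · refine ω.AJ_eq_zero_of_coord (hr := hr) h one_ne_zero (fun p => p.2) im_one_mul_toC_sub _ (fun k hk => ?_) hX
    obtain ⟨g', hg', σ, e⟩ := hin k hk
    have hs := innerPt_shape g' σ
    have := hb g' hg'
    simp only [e, hc2]
    omega
  · refine ω.AJ_eq_zero_of_coord (hr := hr) h (neg_ne_zero.2 one_ne_zero) (fun p => -p.2) im_negOne_mul_toC_sub _
      (fun k hk => ?_) hX
    obtain ⟨g', hg', σ, e⟩ := hin k hk
    have hs := innerPt_shape g' σ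
    have := hb g' hg'
    simp only [e, hc2]
    omega

/-- **Transport of the winding angle of `J` along the prefix.** [folklore] -/
private theorem AJ_prefix_step (h : ω.IsB2a) {i : ℕ} (hi : i < ω.2.firstHitG) :
    ω.AJ hr h (toC (midPt (ω.2.nth i))) = ω.AJ hr h (toC (midPt (ω.2.nth (i + 1)))) := by
  refine sweep_eq_sweep_of_closed _ _ _ _ (ω.pJ_closed h) (fun k hk => ?_) (fun k hk => ?_) (fun k hk => ?_)
  · rw [pJ_eq_toC, pJ_eq_toC, re_seg]; exact_mod_cast ω.sdot_pJpt_midPt h hi.le hk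
  · rw [pJ_eq_toC, pJ_eq_toC, re_seg]; exact_mod_cast ω.sdot_pJpt_midPt h (by omega) hk
  · rw [pJ_eq_toC, re_seg]; exact_mod_cast ω.sdot_rungP h hi hk

variable (ω hr) in
/-- **The root is unwound**: no excursion polygon `J` (an excursion of a walk from the root `a`
outside a rhombus `r`, closed through `r`) winds around the midpoint of the root mid-edge `a` — the
planar-topology content of "walks start on the boundary of the domain". Discharged below for roots
on a supporting line of the domain and for roots joined to infinity by a chain of exterior faces.
[cite: GlazmanManolescu2019, §2.1 (walks start on ∂Rect)] -/
def _root_.Literature.Probability.RandomPlanarGeometry.SAW.YangBaxter.RootUnwound (D : Set Face) (a : MidEdge) : Prop :=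
  ∀ (r : Face) (hr : RootedFace D a r) (ω : ΩG D a r) (h : ω.IsB2a), ω.AJ hr h (toC (midPt a)) = 0

/-- **`J` does not wind around `m₀`** (transport from the root along the prefix). [folklore] -/
private theorem AJ_m₀ (hU : RootUnwound D a) (h : ω.IsB2a) : ω.AJ hr h (ω.qQ hr h 0) = 0 := by
  have key : ∀ i ≤ ω.2.firstHitG, ω.AJ hr h (toC (midPt (ω.2.nth i))) = 0 := by
    intro i hi
    induction i with
    | zero => rw [ω.2.nth_zero]; exact hU r hr ω h
    | succ i ih => rw [← ω.AJ_prefix_step h (by omega)]; exact ih (by omega)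
  have := key _ le_rfl
  rwa [ω.2.nth_firstHitG, midPt_side, ← Qp_zero h] at this

/-- The offset of `w` is a tail offset, of corner type. [folklore] -/
private theorem wOff_mem (z₀ z₁ z₂ : Side) : wOff z₀ z₁ z₂ ∈ tailOffs z₀ z₁ z₂ := by
  cases z₀ <;> cases z₁ <;> cases z₂ <;> decide

/-- The open path ends at `w`. [folklore] -/
private theorem qQ_w (h : ω.IsB2a) : ω.qQ hr h (ω.mQ hr h + 1) = toC (r.base + wOff ω.2.firstSideG (ω.z1 hr h) ω.1) := by
  rw [qQ, mQ, show 2 * ω.Mv + ω.τ hr h + 1 = 2 * ω.Mv + 2 + (ω.τ hr h - 1) by have := τ_pos (ω := ω) (hr := hr) h; omega,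
    Qp_tail h, tailPt, wOff, τ]

/-- **The segments of `J` are seen under acute angles from `w`.** [folklore] -/
private theorem sdot_pJpt_w (h : ω.IsB2a) (hc : Canon ω.2.firstSideG (ω.z1 hr h) ω.1) {k : ℕ} (hk : k < 2 * ω.Mv) :
    0 < sdot (ω.pJpt hr h k) (ω.pJpt hr h (k + 1)) (r.base + wOff ω.2.firstSideG (ω.z1 hr h) ω.1) := by
  have hM := three_le_Mv hr h
  have hfM := fh_add_Mv (ω := ω) h
  have hwm := tailOffs_mem _ _ _ _ (wOff_mem ω.2.firstSideG (ω.z1 hr h) ω.1)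
  have hct := base_add_cornerType r hwm
  rcases Nat.lt_or_ge k (2 * ω.Mv - 2) with hlt | hge
  · rw [pJpt_lt h hlt.le, pJpt_lt h (by omega), Qp_mid h (by omega) (by omega), Qp_mid h (by omega) (by omega),
      show 2 * ω.2.firstHitG + (k + 1 + 2) = 2 * ω.2.firstHitG + (k + 2) + 1 by ring]
    rcases Nat.even_or_odd k with ⟨t, ht⟩ | ⟨t, ht⟩
    · set j := ω.2.firstHitG + t with hj_def
      have hK : 2 * ω.2.firstHitG + (k + 2) = 2 * j + 2 := by omega
      have hj : j < ω.2.arcs.length := by omega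
      have hj1 : j + 1 < ω.2.arcs.length := by omega
      rw [hK]
      have eν : (ω.2.sIn (j + 1)).nIn = -(ω.2.sOut j).nIn :=
        nIn_eq_neg_of_side_eq (((YBWalk.side_sIn hj).2.1).trans ((YBWalk.side_sIn hj1).1).symm) (YBWalk.fc_succ_ne hj1)
      have ek : ω.2.vtx (2 * j + 2) = midPt (ω.2.mids[j + 1]'(YBWalk.lt_length_of_lt_arcs hj)) - (ω.2.sIn (j + 1)).nIn := by
        rw [YBWalk.vtx_even hj, YBWalk.ptOut, innerPt_eq, (YBWalk.side_sIn hj).2.1, eν, sub_neg_eq_add]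
      have ek1 : ω.2.vtx (2 * j + 2 + 1) = midPt (ω.2.mids[j + 1]'(YBWalk.lt_length_of_lt_arcs hj)) + (ω.2.sIn (j + 1)).nIn := by
        rw [show 2 * j + 2 + 1 = 2 * (j + 1) + 1 by ring, YBWalk.vtx_odd hj1, YBWalk.ptIn, innerPt_eq, (YBWalk.side_sIn hj1).1]
      rw [ek, ek1, sdot_cross_eq, Side.nIn_sq]
      have := two_le_dist_cornerType_midPt hct (ω.2.mids[j + 1]'(YBWalk.lt_length_of_lt_arcs hj))
      omega
    · set j := ω.2.firstHitG + t + 1 with hj_def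
      have hK : 2 * ω.2.firstHitG + (k + 2) = 2 * j + 1 := by omega
      have hj : j < ω.2.arcs.length := by omega
      rw [hK, YBWalk.vtx_odd hj, show 2 * j + 1 + 1 = 2 * j + 2 by ring, YBWalk.vtx_even hj, YBWalk.ptIn, YBWalk.ptOut,
        innerPt, innerPt]
      have hne : ω.2.fc j ≠ r := ω.fc_ne hr h (by omega) hj
      refine sdot_pos_split' r (ω.2.fc j) (ω.2.sIn j).inOff_mem (ω.2.sOut j).inOff_mem (by omega) fun d hd hg => ?_
      have hd0 : d ≠ (0, 0) := by rintro rfl; apply hne; rw [hg]; simp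
      refine table_corner_chord _ ?_ d hd hd0 _ _ (YBWalk.side_sIn hj).2.2
      generalize wOff ω.snd.firstSideG (ω.z1 hr h) ω.fst = p at hwm ⊢
      obtain ⟨u, v⟩ := p
      simp only at hwm
      rcases hwm with ⟨rfl | rfl, rfl | rfl⟩ <;> simp
  · rcases Nat.lt_or_ge k (2 * ω.Mv - 1) with hlt' | hge'
    · have hk' : k = 2 * ω.Mv - 2 := by omega
      subst hk'
      rw [pJpt_lt h le_rfl, show 2 * ω.Mv - 2 + 2 = 2 * ω.Mv by omega, Qp_qlast h,
        show 2 * ω.Mv - 2 + 1 = 2 * ω.Mv - 1 by omega, pJpt_c₂ h, Side.inOff, ← add_assoc, ← midPt_side, add_sub_assoc', ← midPt_side]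
      rw [sdot_cross_eq, Side.nIn_sq]
      have := two_le_dist_cornerType_midPt hct (r.side ω.1)
      omega
    · have hk' : k = 2 * ω.Mv - 1 := by omega
      subst hk'
      rw [pJpt_c₂ h, show 2 * ω.Mv - 1 + 1 = 2 * ω.Mv by omega, pJpt_top h, Qp_two h, add_comm r.base, add_comm r.base,
        add_comm r.base, sdot_add]
      exact (table_local _ _ _ hc).2.2.2.2

/-- **The rung `[m₀, w]` is seen under acute angles from the vertices of `J`.** [folklore] -/
private theorem sdot_rung_w (h : ω.IsB2a) (hc : Canon ω.2.firstSideG (ω.z1 hr h) ω.1) {k : ℕ} (hk : k ≤ 2 * ω.Mv) :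
    0 < sdot (r.base + ω.2.firstSideG.offset) (r.base + wOff ω.2.firstSideG (ω.z1 hr h) ω.1) (ω.pJpt hr h k) := by
  have hoff : ∀ s : Side, 0 ≤ s.offset.1 ∧ s.offset.1 ≤ 4 ∧ 0 ≤ s.offset.2 ∧ s.offset.2 ≤ 4 := by
    intro s; cases s <;> simp [Side.offset]
  have hwm := tailOffs_mem _ _ _ _ (wOff_mem ω.2.firstSideG (ω.z1 hr h) ω.1)
  have hw4 : 0 ≤ (wOff ω.2.firstSideG (ω.z1 hr h) ω.1).1 ∧ (wOff ω.2.firstSideG (ω.z1 hr h) ω.1).1 ≤ 4 ∧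
      0 ≤ (wOff ω.2.firstSideG (ω.z1 hr h) ω.1).2 ∧ (wOff ω.2.firstSideG (ω.z1 hr h) ω.1).2 ≤ 4 := by omega
  have step : ∀ (g : Face) (σ : Side), (g = r → σ = ω.z1 hr h ∨ σ = ω.1) →
      0 < sdot (r.base + ω.2.firstSideG.offset) (r.base + wOff ω.2.firstSideG (ω.z1 hr h) ω.1) (innerPt g σ) := by
    intro g σ hsame
    refine sdot_pos_split r g (hoff _) hw4 σ.inOff_mem fun d hd hg => ?_
    refine table_rung_w _ _ _ hc d hd σ ?_
    by_cases hd0 : d = (0, 0)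
    · right; exact hsame (by rw [hg, hd0]; simp)
    · left; exact hd0
  rcases ω.pJpt_cases' h hk with ⟨i', hi'1, hi'2, e | e⟩ | e | e
  · rw [e]; exact step _ _ fun hg => absurd hg (ω.fc_ne hr h hi'1 hi'2)
  · rw [e]; exact step _ _ fun hg => absurd hg (ω.fc_ne hr h hi'1 hi'2)
  · rw [e]; exact step _ _ fun _ => Or.inl rfl
  · rw [e]; exact step _ _ fun _ => Or.inr rfl

/-- **`J` does not wind around `w`.** [folklore] -/
private theorem AJ_w (hU : RootUnwound D a) (h : ω.IsB2a) (hc : Canon ω.2.firstSideG (ω.z1 hr h) ω.1) :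
    ω.AJ hr h (ω.qQ hr h (ω.mQ hr h + 1)) = 0 := by
  rw [← ω.AJ_m₀ hU h, qQ_w h, eq_comm, qQ, Qp_zero h]
  refine sweep_eq_sweep_of_closed _ _ _ _ (ω.pJ_closed h) (fun k hk => ?_) (fun k hk => ?_) (fun k hk => ?_)
  · rw [pJ_eq_toC, pJ_eq_toC, re_seg, ← midPt_side, ← ω.2.nth_firstHitG]
    exact_mod_cast ω.sdot_pJpt_midPt h le_rfl hk
  · rw [pJ_eq_toC, pJ_eq_toC, re_seg]; exact_mod_cast ω.sdot_pJpt_w h hc hk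
  · rw [pJ_eq_toC, re_seg]; exact_mod_cast ω.sdot_rung_w h hc hk

/-! #### Assembly: the right-angle winding of the excursion is the local constant -/

/-- The vertices of the open path from one unit outside the return side on. [folklore] -/
private theorem qQ_X (h : ω.IsB2a) {i : ℕ} (hi : i ≤ ω.τ hr h + 1) :
    ω.qQ hr h (2 * ω.Mv + i) = toC (r.base + Xo ω.2.firstSideG (ω.z1 hr h) ω.1 i) := by
  rcases Nat.eq_zero_or_pos i with rfl | hpos
  · rw [add_zero, qQ, Qp_qlast h, Xo, if_pos rfl]
  · obtain ⟨i', rfl⟩ : ∃ i', i = i' + 1 := ⟨i - 1, by omega⟩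
    rw [qQ, show 2 * ω.Mv + (i' + 1) = 2 * ω.Mv + 1 + i' by ring, Qp_tailPts h (by omega), Xo, if_neg (by omega),
      Nat.add_sub_cancel]

/-- **The right-angle winding of a canonical excursion is the local constant `Loc`.** [folklore] -/
private theorem WE_pi_div_two_eq_Loc (hU : RootUnwound D a) (h : ω.IsB2a) (hc : Canon ω.2.firstSideG (ω.z1 hr h) ω.1) :
    ω.WE (fun _ => π / 2) = Loc ω.2.firstSideG (ω.z1 hr h) ω.1 := by
  have hM := three_le_Mv hr h
  have key := ω.hopfQ h hc
  rw [ω.T_eq h, ω.S₂_eq h, ω.S₁_eq h hc, ω.AJ_m₀ hU h, ω.AJ_w hU h hc, zero_add, zero_add] at key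
  -- identify the points
  have e0 : ω.qQ hr h 0 = toC (r.base + ω.2.firstSideG.offset) := by rw [qQ, Qp_zero h]
  have e1 : ω.qQ hr h 1 = toC (r.base + ω.2.firstSideG.inOff) := by rw [qQ, Qp_one h]
  have e2 : ω.qQ hr h 2 = toC (r.base + (ω.z1 hr h).inOff) := by rw [qQ, Qp_two h]
  have eq : ω.qQ hr h (2 * ω.Mv) = toC (r.base + Xo ω.2.firstSideG (ω.z1 hr h) ω.1 0) := by
    have := ω.qQ_X (hr := hr) h (i := 0) (by omega); rwa [add_zero] at this
  have ew := ω.qQ_w (hr := hr) h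
  have hL₂ : (angAt (ω.qQ hr h 0) (ω.qQ hr h 1) (ω.qQ hr h 2) -
      angAt (ω.qQ hr h 0) (ω.qQ hr h (2 * ω.Mv)) (toC (r.base + ω.1.inOff)) -
      angAt (ω.qQ hr h 0) (toC (r.base + ω.1.inOff)) (ω.qQ hr h 2) +
      ∑ i ∈ Finset.range (ω.τ hr h + 1), angAt (ω.qQ hr h 0) (ω.qQ hr h (2 * ω.Mv + i)) (ω.qQ hr h (2 * ω.Mv + 1 + i))) =
      L₂off ω.2.firstSideG (ω.z1 hr h) ω.1 := by
    rw [L₂off, e0, e1, e2, eq, angAt_transl, angAt_transl, angAt_transl, τ]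
    congr 1
    refine Finset.sum_congr rfl fun i hi => ?_
    rw [Finset.mem_range] at hi
    rw [ω.qQ_X h (by unfold τ; omega), show 2 * ω.Mv + 1 + i = 2 * ω.Mv + (i + 1) by ring, ω.qQ_X h (by unfold τ; omega),
      angAt_transl]
  have hL₁ : (angAt (ω.qQ hr h (ω.mQ hr h + 1)) (ω.qQ hr h 0) (ω.qQ hr h 1) +
      angAt (ω.qQ hr h (ω.mQ hr h + 1)) (ω.qQ hr h 1) (ω.qQ hr h 2) -
      angAt (ω.qQ hr h (ω.mQ hr h + 1)) (ω.qQ hr h (2 * ω.Mv)) (toC (r.base + ω.1.inOff)) -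
      angAt (ω.qQ hr h (ω.mQ hr h + 1)) (toC (r.base + ω.1.inOff)) (ω.qQ hr h 2) +
      ∑ i ∈ Finset.range (ω.τ hr h), angAt (ω.qQ hr h (ω.mQ hr h + 1)) (ω.qQ hr h (2 * ω.Mv + i)) (ω.qQ hr h (2 * ω.Mv + 1 + i))) =
      L₁off ω.2.firstSideG (ω.z1 hr h) ω.1 := by
    rw [L₁off, ew, e0, e1, e2, eq, angAt_transl, angAt_transl, angAt_transl, angAt_transl, τ]
    congr 1
    refine Finset.sum_congr rfl fun i hi => ?_
    rw [Finset.mem_range] at hi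
    rw [ω.qQ_X h (by unfold τ; omega), show 2 * ω.Mv + 1 + i = 2 * ω.Mv + (i + 1) by ring, ω.qQ_X h (by unfold τ; omega),
      angAt_transl]
  have hT : ∑ i ∈ Finset.range (ω.τ hr h), ω.extQ hr h (2 * ω.Mv + i) = tailExtOff ω.2.firstSideG (ω.z1 hr h) ω.1 := by
    rw [tailExtOff, τ]
    refine Finset.sum_congr rfl fun i hi => ?_
    rw [Finset.mem_range] at hi
    unfold extQ
    rw [show 2 * ω.Mv + i + 2 = 2 * ω.Mv + (i + 2) by ring, show 2 * ω.Mv + i + 1 = 2 * ω.Mv + (i + 1) by ring,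
      ω.qQ_X h (by unfold τ; omega), ω.qQ_X h (by unfold τ; omega), ω.qQ_X h (by unfold τ; omega), ← toC_sub, ← toC_sub,
      add_sub_add_left_eq_sub, add_sub_add_left_eq_sub]
  rw [hL₂, hL₁, hT] at key
  rw [Loc]
  linarith

end Path

end ΩG

namespace ΩG

variable {D : Set Face} {a : MidEdge} {r : Face} (ω : ΩG D a r)

/-- **The winding of the excursion at general angles**: the right-angle winding plus the
potential difference of the return and exit sides. [folklore] -/
private theorem WE_eq_WE_pi_div_two_add (hr : RootedFace D a r) (h : ω.IsB2a) (Θ : ℤ → ℝ) :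
    ω.WE Θ = ω.WE (fun _ => π / 2) + (Θ r.1 - π / 2) * ((ω.1).slantInd - (ω.2.exitSideG hr (ω.fh_lt h)).slantInd) := by
  have hfh := ω.fh_lt h
  set X := ω.2.drop (ω.2.firstHitG + 1) (by omega) with hX
  have hXa : X.arcs = ω.2.arcs.drop (ω.2.firstHitG + 1) := YBWalk.drop_arcs _ _ _
  have hW : ∀ Θ' : ℤ → ℝ, ω.WE Θ' = X.winding Θ' := by
    intro Θ'; rw [WE, YBWalk.winding, hXa]
  have e1 : slantPot Θ (ω.2.nth (ω.2.firstHitG + 1)) = slantPot Θ (r.side (ω.2.exitSideG hr hfh)) := by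
    rw [(ω.2.exitSide_specG hr hfh).1]
  rw [hW, hW, YBWalk.winding_eq_winding_pi_div_two_add Θ X, e1, slantPot_side, slantPot_side]
  ring

/-- **The excursion winding of a walk of class `B2a`** (all orientations, all angles). [folklore] -/
private theorem WE_eq_excursionWinding (hr : RootedFace D a r) (hU : RootUnwound D a) (h : ω.IsB2a) (Θ : ℤ → ℝ) :
    ω.WE Θ = excursionWinding (Θ r.1) ω.2.firstSideG (ω.2.exitSideG hr (ω.fh_lt h)) ω.1 := by
  -- first at right angles, in both orientations
  have key : ∀ ω' : ΩG D a r, ∀ h' : ω'.IsB2a,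
      ω'.WE (fun _ => π / 2) = excursionWinding (π / 2) ω'.2.firstSideG (ω'.2.exitSideG hr (ω'.fh_lt h')) ω'.1 := by
    intro ω' h'
    have hd := ω'.2.sides_distinctG hr h'.1
    rw [ω'.returnSide_of_isB2a h'] at hd
    rcases canon_or_swap hd.1.symm hd.2.1.symm hd.2.2.symm with hc | hc
    · rw [ω'.WE_pi_div_two_eq_Loc hU h' hc]; unfold ΩG.z1; rw [Loc_eq hc]
    · -- the reversed walk is canonical
      have h'' := ω'.rev_isB2a hr h'
      have hc' : Canon (ω'.rev hr).2.firstSideG ((ω'.rev hr).z1 hr h'') (ω'.rev hr).1 := by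
        unfold ΩG.z1; rw [ω'.rev_firstSide hr h', ω'.rev_exitSide hr h', ω'.rev_fst hr h']; exact hc
      have e := (ω'.rev hr).WE_pi_div_two_eq_Loc hU h'' hc'
      unfold ΩG.z1 at e
      rw [ω'.rev_WE (fun _ => π / 2) hr h', ω'.rev_firstSide hr h', ω'.rev_exitSide hr h', ω'.rev_fst hr h',
        Loc_eq hc, excursionWinding_swap] at e
      linarith
  have hd := ω.2.sides_distinctG hr h.1
  rw [ω.returnSide_of_isB2a h] at hd
  rw [ω.WE_eq_WE_pi_div_two_add hr h Θ, key ω h,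
    excursionWinding_theta (Θ r.1) hd.1.symm hd.2.1.symm hd.2.2.symm]

end ΩG

/-- **The excursion windings from an unwound root**: the planar-topology input of the grouping
argument holds on every face domain for every root around which no excursion polygon winds.
[cite: GlazmanManolescu2019, Lemma 2.1 (proof); Glazman2015WeightedSAW, Lemma 3.1 (proof)] -/
theorem excursionWindingGen_of_rootUnwound {D : Set Face} {a : MidEdge} (hU : RootUnwound D a) :
    ExcursionWindingGen D a :=
  fun Θ _ _ hr ω h => ω.WE_eq_excursionWinding hr hU h Θ

/-- **Lemma 2.1 (CR) on a general finite face domain, for an unwound non-interior root.**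
[cite: GlazmanManolescu2019, Lemma 2.1] -/
theorem lem21_of_rootUnwound {D : Set Face} [Finite D] {a : MidEdge} (hU : RootUnwound D a) (Θ : ℤ → ℝ)
    (hΘ : ∀ k, Θ k ∈ Set.Icc (π / 3) (2 * π / 3)) (r : Face) (hr : RootedFace D a r) :
    parafermionOn D a Θ (r.side .E) - parafermionOn D a Θ (r.side .W) =
      Complex.exp ((Θ r.1 : ℝ) * Complex.I) * (parafermionOn D a Θ (r.side .S) - parafermionOn D a Θ (r.side .N)) :=
  lem21_of_excursionWindingGen (excursionWindingGen_of_rootUnwound hU) Θ hΘ r hr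

/-! ### Roots on a supporting line of the domain are unwound -/

/-- **A root on a supporting line of the domain**: all faces of `D` lie weakly on one side of the
lattice line carrying the root edge `a` (for a vertical edge `vert k j`, on the line `x = k`: all
faces in the columns `≥ k`, or all in the columns `< k`; similarly for a horizontal edge
`slant k j` and the rows). Every boundary mid-edge of a rectangle is such a root. [folklore] -/
def SupportingRoot (D : Set Face) : MidEdge → Prop
  | .vert k _ => (∀ f ∈ D, k ≤ f.1) ∨ (∀ f ∈ D, f.1 < k)
  | .slant _ j => (∀ f ∈ D, j ≤ f.2) ∨ (∀ f ∈ D, f.2 < j)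

/-- The inner points of a face lie strictly inside it (mesh `4`). [folklore] -/
private theorem innerPt_bounds (g : Face) (σ : Side) :
    4 * g.1 + 1 ≤ (innerPt g σ).1 ∧ (innerPt g σ).1 ≤ 4 * g.1 + 3 ∧
      4 * g.2 + 1 ≤ (innerPt g σ).2 ∧ (innerPt g σ).2 ≤ 4 * g.2 + 3 := by
  obtain ⟨k, j⟩ := g
  cases σ <;> simp [innerPt, Face.base, Side.inOff, Side.offset, Side.nIn]

/-- **Roots on a supporting line are unwound**: the excursion polygon `J` lies in the open
half-plane inward of the supporting line, which does not contain the midpoint of the root.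
[cite: GlazmanManolescu2019, Lemma 2.1 (proof); §2.1 (Rect_{T,L}: the root on the left side)] -/
theorem rootUnwound_of_supportingRoot {D : Set Face} {a : MidEdge} (hS : SupportingRoot D a) : RootUnwound D a := by
  intro r hr ω h
  have hin := fun k (hk : k ≤ 2 * ω.Mv) => ω.pJpt_eq_innerPt (hr := hr) h hk
  cases a with
  | vert k j =>
    rcases hS with hS | hS
    · refine ω.AJ_root_of_coord (hr := hr) h Complex.I_ne_zero (fun p => p.1) im_I_mul_toC_sub fun k' hk' => ?_
      obtain ⟨g, hg, σ, e⟩ := hin k' hk'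
      have hb := innerPt_bounds g σ
      have hk := hS g hg
      simp only [e, midPt]
      omega
    · refine ω.AJ_root_of_coord (hr := hr) h (neg_ne_zero.2 Complex.I_ne_zero) (fun p => -p.1) im_negI_mul_toC_sub
        fun k' hk' => ?_
      obtain ⟨g, hg, σ, e⟩ := hin k' hk'
      have hb := innerPt_bounds g σ
      have hk := hS g hg
      simp only [e, midPt]
      omega
  | slant k j =>
    rcases hS with hS | hS
    · refine ω.AJ_root_of_coord (hr := hr) h one_ne_zero (fun p => p.2) im_one_mul_toC_sub fun k' hk' => ?_
      obtain ⟨g, hg, σ, e⟩ := hin k' hk'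
      have hb := innerPt_bounds g σ
      have hk := hS g hg
      simp only [e, midPt]
      omega
    · refine ω.AJ_root_of_coord (hr := hr) h (neg_ne_zero.2 one_ne_zero) (fun p => -p.2) im_negOne_mul_toC_sub
        fun k' hk' => ?_
      obtain ⟨g, hg, σ, e⟩ := hin k' hk'
      have hb := innerPt_bounds g σ
      have hk := hS g hg
      simp only [e, midPt]
      omega

/-- **Lemma 2.1 (CR) on a general finite face domain, for a root on a supporting line**
(unconditional). [cite: GlazmanManolescu2019, Lemma 2.1] -/
theorem lem21_of_supportingRoot {D : Set Face} [Finite D] {a : MidEdge} (hS : SupportingRoot D a)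
    (ha : ¬(a.faces.1 ∈ D ∧ a.faces.2 ∈ D)) (Θ : ℤ → ℝ) (hΘ : ∀ k, Θ k ∈ Set.Icc (π / 3) (2 * π / 3))
    (r : Face) (hr : r ∈ D) :
    parafermionOn D a Θ (r.side .E) - parafermionOn D a Θ (r.side .W) =
      Complex.exp ((Θ r.1 : ℝ) * Complex.I) * (parafermionOn D a Θ (r.side .S) - parafermionOn D a Θ (r.side .N)) :=
  lem21_of_rootUnwound (rootUnwound_of_supportingRoot hS) Θ hΘ r ⟨hr, ha⟩

/-! ### Roots on the outer boundary are unwound: transport along a chain of exterior faces -/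

/-- **An exterior chain from the root to infinity**: faces `g 0, …, g n` NOT in `D`, the root `a`
a side of `g 0`, consecutive faces sharing a corner (king moves — the connectivity of the
complement dual to the edge-connectivity of the walks), and the last face beyond the domain (all
of `D` strictly to one side of it). Such a chain exists exactly when the face of `a` outside `D`
lies in the unbounded king-connected component of the complement of `D`, i.e. when `a` is on the
OUTER boundary of `D`; a root on the boundary of a hole of `D` has none. [cite: DuminilCopinSmirnov2012, Lemma 1 (a ∈ ∂Ω: the root on the outer boundary); GlazmanManolescu2019, §2.1 (walks start on ∂Rect_{T,L})] -/
structure ExteriorChain (D : Set Face) (a : MidEdge) (n : ℕ) (g : ℕ → Face) : Prop where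
  /-- the root is a side of the first face -/
  root : ∃ s : Side, (g 0).side s = a
  /-- the faces of the chain are outside the domain -/
  notMem : ∀ i ≤ n, g i ∉ D
  /-- consecutive faces share a corner -/
  linked : ∀ i < n, ∃ q : ℤ × ℤ, IsCornerOf q (g i) ∧ IsCornerOf q (g (i + 1))
  /-- the last face is beyond the domain -/
  beyond : (∀ f ∈ D, (g n).1 < f.1) ∨ (∀ f ∈ D, f.1 < (g n).1) ∨ (∀ f ∈ D, (g n).2 < f.2) ∨ (∀ f ∈ D, f.2 < (g n).2)

/-- **Outer-boundary root**: a root joined to infinity by an exterior chain. [cite: DuminilCopinSmirnov2012, Lemma 1 (a ∈ ∂Ω); GlazmanManolescu2019, §2.1 (walks from the boundary point 0)] -/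
def OuterRoot (D : Set Face) (a : MidEdge) : Prop := ∃ (n : ℕ) (g : ℕ → Face), ExteriorChain D a n g

/-- An outer root is not an interior mid-edge of the domain. [cite: GlazmanManolescu2019, §2.1 (the starting mid-edge lies on the boundary)] -/
theorem OuterRoot.not_interior {D : Set Face} {a : MidEdge} (hO : OuterRoot D a) : ¬(a.faces.1 ∈ D ∧ a.faces.2 ∈ D) := by
  obtain ⟨n, g, ⟨s, hs⟩, hD, -, -⟩ := hO
  have h0 := hD 0 (Nat.zero_le _)
  rcases (Face.exists_side_eq_iff (g 0) a).1 ⟨s, hs⟩ with e | e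
  · exact fun hh => h0 (e ▸ hh.1)
  · exact fun hh => h0 (e ▸ hh.2)

/-- **Outer roots are unwound**: the winding angle of every excursion polygon `J` vanishes at the
centre of the last face of the chain (half-plane), is transported unchanged from face centre to
shared corner to face centre along the chain (all plaquettes of the secant homotopy are valid: `J`
stays at squared distance `≥ 9` from exterior face centres and `≥ 5` from lattice corners, its
steps have squared length `≤ 4`), and finally from the centre of the exterior face of the root to
the midpoint of the root. [cite: GlazmanManolescu2019, Lemma 2.1 (proof: the winding of the grouped walks); Glazman2015WeightedSAW, Lemma 3.1 (proof)] -/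
theorem rootUnwound_of_outerRoot {D : Set Face} {a : MidEdge} (hO : OuterRoot D a) : RootUnwound D a := by
  obtain ⟨n, g, ⟨s, hs⟩, hD, hlink, hbey⟩ := hO
  intro r hr ω h
  have key : ∀ m ≤ n, ω.AJ hr h (toC (Face.ctr (g (n - m)))) = 0 := by
    intro m
    induction m with
    | zero =>
      intro _
      rw [Nat.sub_zero]
      exact ω.AJ_ctr_eq_zero_of_beyond (hr := hr) h (hD n le_rfl) hbey
    | succ m ih =>
      intro hm
      obtain ⟨q, hq1, hq2⟩ := hlink (n - (m + 1)) (by omega)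
      have e : n - (m + 1) + 1 = n - m := by omega
      rw [ω.AJ_ctr_eq_AJ_corner (hr := hr) h (hD _ (by omega)) hq1,
        ← ω.AJ_ctr_eq_AJ_corner (hr := hr) h (hD _ (by omega)) hq2, e]
      exact ih (by omega)
  have h0 := key n le_rfl
  rw [Nat.sub_self] at h0
  rw [ω.AJ_root_eq_AJ_ctr (hr := hr) h (hD 0 (Nat.zero_le _)) hs]
  exact h0

/-- **Glazman–Manolescu's Lemma 2.1 (CR) on an ARBITRARY finite face domain, at EVERY rhombus, for
EVERY root on the outer boundary** (unconditional): for all angle sequences `Θ` with values in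
`[π/3, 2π/3]`, `F(z_E) − F(z_W) = e^{iθ_r}(F(z_S) − F(z_N))` for the parafermionic observable
`F = parafermionOn D a Θ` of walks from `a`. [cite: GlazmanManolescu2019, Lemma 2.1] -/
theorem lem21_of_outerRoot {D : Set Face} [Finite D] {a : MidEdge} (hO : OuterRoot D a) (Θ : ℤ → ℝ)
    (hΘ : ∀ k, Θ k ∈ Set.Icc (π / 3) (2 * π / 3)) (r : Face) (hr : r ∈ D) :
    parafermionOn D a Θ (r.side .E) - parafermionOn D a Θ (r.side .W) =
      Complex.exp ((Θ r.1 : ℝ) * Complex.I) * (parafermionOn D a Θ (r.side .S) - parafermionOn D a Θ (r.side .N)) :=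
  lem21_of_rootUnwound (rootUnwound_of_outerRoot hO) Θ hΘ r ⟨hr, hO.not_interior⟩

/-! ### Consistency with the tree: the rectangle rooted at the origin -/

/-- The origin of `Rect_{T,L}` is an outer root: its exterior face `(−1, 0)` is beyond the
rectangle (chain of length `0`). [cite: GlazmanManolescu2019, §2.1] -/
theorem outerRoot_rect_origin (T L : ℕ) : OuterRoot (rect T L) origin :=
  ⟨0, fun _ => ((-1 : ℤ), (0 : ℤ)), ⟨.E, rfl⟩, fun i _ h => by simp [rect] at h, fun i hi => absurd hi (Nat.not_lt_zero _),
    Or.inl fun f hf => by have := hf.1; omega⟩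

/-- The general observable on the rectangle rooted at the origin is the tree's `parafermion`.
[cite: GlazmanManolescu2019, §2.1, eq. (2.1)] -/
theorem parafermionOn_rect (T L : ℕ) (Θ : ℤ → ℝ) (z : MidEdge) :
    parafermionOn (rect T L) origin Θ z = parafermion T L Θ z := by
  unfold parafermionOn parafermion
  exact Finset.sum_congr (by ext; simp) fun _ _ => rfl

/-- **The tree's Lemma 2.1 re-derived from the general-domain theorem** (consistency check; an
`example`, the named statement `GlazmanManolescu2019_lem21_holds` being in the tree).
[cite: GlazmanManolescu2019, Lemma 2.1] -/
example : GlazmanManolescu2019_lem21 := by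
  intro T L Θ hΘ f hf
  have := lem21_of_outerRoot (outerRoot_rect_origin T L) Θ hΘ f hf
  simpa only [parafermionOn_rect] using this

/-! ### The identity in the square frame (θ-dressed constant coefficients) on a general domain -/

/-- **The square-lattice parafermionic observable of a finite face domain `D` rooted at `a`**:
`F_sq(z) = Σ_{γ ⊂ D : a → z} w_Θ(γ) e^{−i(5/8)·wind_{π/2}(γ)}`, the winding read on the right-angle
tiling (the tree's `sqParafermion T L` is the case `D = Rect_{T,L}`, `a = 0`).
[cite: GlazmanManolescu2019, §2.1, eq. (2.1) (Θ ≡ π/2 in the winding only)] -/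
def sqParafermionOn (D : Set Face) [Finite D] (a : MidEdge) (Θ : ℤ → ℝ) (z : MidEdge) : ℂ :=
  ∑ γ : YBWalk D a z, γ.sqParaWeight Θ

/-- **`F_sq(z) = F_Θ(z) · e^{i(5/8)(κ_Θ(z) − κ_Θ(a))}`** (winding transfer, general root).
[cite: GlazmanManolescu2019, §2.1] -/
theorem sqParafermionOn_eq (D : Set Face) [Finite D] (a : MidEdge) (Θ : ℤ → ℝ) (z : MidEdge) :
    sqParafermionOn D a Θ z =
      parafermionOn D a Θ z * Complex.exp (((5 / 8 * (slantPot Θ z - slantPot Θ a) : ℝ) : ℂ) * Complex.I) := by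
  unfold sqParafermionOn parafermionOn
  rw [Finset.sum_mul]
  refine Finset.sum_congr rfl fun γ _ => ?_
  rw [γ.sqParaWeight_eq Θ]

/-- The potential vanishes on the vertical side `W`. [folklore] -/
private theorem slantPot_sideW (Θ : ℤ → ℝ) (f : Face) : slantPot Θ (f.side .W) = 0 := by
  rw [slantPot_side]; simp [Side.slantInd]

/-- The potential vanishes on the vertical side `E`. [folklore] -/
private theorem slantPot_sideE (Θ : ℤ → ℝ) (f : Face) : slantPot Θ (f.side .E) = 0 := by
  rw [slantPot_side]; simp [Side.slantInd]

/-- The potential is `θ_k − π/2` on the slanted side `S`. [folklore] -/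
private theorem slantPot_sideS (Θ : ℤ → ℝ) (f : Face) : slantPot Θ (f.side .S) = Θ f.1 - π / 2 := by
  rw [slantPot_side]; simp [Side.slantInd]

/-- The potential is `θ_k − π/2` on the slanted side `N`. [folklore] -/
private theorem slantPot_sideN (Θ : ℤ → ℝ) (f : Face) : slantPot Θ (f.side .N) = Θ f.1 - π / 2 := by
  rw [slantPot_side]; simp [Side.slantInd]

/-- **Winding transfer of the vertex relation**: (CR) for `F_Θ` at the rhombus `f = (k, j)` is the
square-frame relation `F_sq(z_E) − F_sq(z_W) = e^{i(3θ_k/8 + 5π/16)} (F_sq(z_S) − F_sq(z_N))` for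
`F_sq` (any root: the root phase `e^{−i(5/8)κ(a)}` is a common factor).
[cite: GlazmanManolescu2019, Lemma 2.1, eq. (2.2) (CR)] -/
theorem sqRelation_of_lem21 {D : Set Face} [Finite D] {a : MidEdge} (Θ : ℤ → ℝ) (f : Face)
    (h21 : parafermionOn D a Θ (f.side .E) - parafermionOn D a Θ (f.side .W) =
      Complex.exp ((Θ f.1 : ℝ) * Complex.I) * (parafermionOn D a Θ (f.side .S) - parafermionOn D a Θ (f.side .N))) :
    sqParafermionOn D a Θ (f.side .E) - sqParafermionOn D a Θ (f.side .W) =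
      Complex.exp (((3 / 8 * Θ f.1 + 5 * π / 16 : ℝ) : ℂ) * Complex.I) *
        (sqParafermionOn D a Θ (f.side .S) - sqParafermionOn D a Θ (f.side .N)) := by
  have he : Complex.exp (((Θ f.1 : ℝ) : ℂ) * Complex.I) =
      Complex.exp (((3 / 8 * Θ f.1 + 5 * π / 16 : ℝ) : ℂ) * Complex.I) *
        Complex.exp (((5 / 8 * (Θ f.1 - π / 2) : ℝ) : ℂ) * Complex.I) := by
    rw [← Complex.exp_add]
    congr 1
    push_cast
    ring
  have hsplit : Complex.exp (((5 / 8 * (Θ f.1 - π / 2 - slantPot Θ a) : ℝ) : ℂ) * Complex.I) =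
      Complex.exp (((5 / 8 * (Θ f.1 - π / 2) : ℝ) : ℂ) * Complex.I) *
        Complex.exp (((5 / 8 * (0 - slantPot Θ a) : ℝ) : ℂ) * Complex.I) := by
    rw [← Complex.exp_add]
    congr 1
    push_cast
    ring
  simp only [sqParafermionOn_eq, slantPot_sideW, slantPot_sideE, slantPot_sideS, slantPot_sideN]
  rw [hsplit, ← sub_mul, h21, he]
  ring

/-- **C-B2, square frame: the Yang–Baxter weights give the exact vertex identity with
`θ`-dressed constant coefficients on EVERY finite face domain, at EVERY face, for EVERY
outer-boundary root**: `F_sq(z_E) − F_sq(z_W) = e^{i(3θ_k/8 + 5π/16)} (F_sq(z_S) − F_sq(z_N))`.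
[cite: GlazmanManolescu2019, Lemma 2.1, eq. (2.2) (CR)] -/
theorem sqRelation_of_outerRoot {D : Set Face} [Finite D] {a : MidEdge} (hO : OuterRoot D a) (Θ : ℤ → ℝ)
    (hΘ : ∀ k, Θ k ∈ Set.Icc (π / 3) (2 * π / 3)) (f : Face) (hf : f ∈ D) :
    sqParafermionOn D a Θ (f.side .E) - sqParafermionOn D a Θ (f.side .W) =
      Complex.exp (((3 / 8 * Θ f.1 + 5 * π / 16 : ℝ) : ℂ) * Complex.I) *
        (sqParafermionOn D a Θ (f.side .S) - sqParafermionOn D a Θ (f.side .N)) :=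
  sqRelation_of_lem21 Θ f (lem21_of_outerRoot hO Θ hΘ f hf)

/-- **C-B2, one-parameter family** (constant angle `θ ∈ [π/3, 2π/3]`, coefficients
`(1, e^{i(3θ/8+5π/16)}, −1, −e^{i(3θ/8+5π/16)})` on `(z_E, z_N, z_W, z_S)`), every finite face domain,
every face, every outer root. [cite: GlazmanManolescu2019, Lemma 2.1, eq. (2.2) (CR)] -/
theorem sqRelation_const_of_outerRoot {D : Set Face} [Finite D] {a : MidEdge} (hO : OuterRoot D a) {θ : ℝ}
    (hθ : θ ∈ Set.Icc (π / 3) (2 * π / 3)) (f : Face) (hf : f ∈ D) :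
    sqParafermionOn D a (fun _ => θ) (f.side .E) - sqParafermionOn D a (fun _ => θ) (f.side .W) =
      Complex.exp (((3 / 8 * θ + 5 * π / 16 : ℝ) : ℂ) * Complex.I) *
        (sqParafermionOn D a (fun _ => θ) (f.side .S) - sqParafermionOn D a (fun _ => θ) (f.side .N)) :=
  sqRelation_of_outerRoot hO (fun _ => θ) (fun _ => hθ) f hf

/-- The same for roots on a supporting line (e.g. every boundary mid-edge of a rectangle).
[cite: GlazmanManolescu2019, Lemma 2.1, eq. (2.2) (CR)] -/
theorem sqRelation_of_supportingRoot {D : Set Face} [Finite D] {a : MidEdge} (hS : SupportingRoot D a)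
    (ha : ¬(a.faces.1 ∈ D ∧ a.faces.2 ∈ D)) (Θ : ℤ → ℝ) (hΘ : ∀ k, Θ k ∈ Set.Icc (π / 3) (2 * π / 3))
    (f : Face) (hf : f ∈ D) :
    sqParafermionOn D a Θ (f.side .E) - sqParafermionOn D a Θ (f.side .W) =
      Complex.exp (((3 / 8 * Θ f.1 + 5 * π / 16 : ℝ) : ℂ) * Complex.I) *
        (sqParafermionOn D a Θ (f.side .S) - sqParafermionOn D a Θ (f.side .N)) :=
  sqRelation_of_lem21 Θ f (lem21_of_supportingRoot hS ha Θ hΘ f hf)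

end Literature.Probability.RandomPlanarGeometry.SAW.YangBaxter

/-! ## C-B2 in the `PlaquetteWalk` vocabulary of the barrier catalogue

The bridge between the free-weight plaquette observable `gmObservable W t Dl a z`
(`Literature.Barriers.CriticalPhenomena.PlaquetteWalkSpinRigidity`) at the printed weights
`W = printedWeights θ` and phase `t = e^{−5iπ/16}` and the square-frame Yang–Baxter observable
`sqParafermionOn (dom Dl) a (fun _ => θ) z`, and the exact vertex relation with coefficients
`(1, r(θ), −1, −r(θ))`, `r(θ) = e^{i(3θ/8+5π/16)}`, at every face of every finite face list for every
outer root. -/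

namespace Literature.Barriers.CriticalPhenomena.PlaquetteWalk

open Literature.Probability.RandomPlanarGeometry.SAW.YangBaxter Complex

variable {D : Set Face} {a z : MidEdge}

/-- The kinds in a face via the filtered arc list. [folklore] -/
private theorem kindsL_eq_filterMap_filter (l : List MidEdge) (f : Face) :
    kindsL l f = ((arcsOf l).filter fun p => arcFace p = some f).filterMap arcKindOf := by
  unfold kindsL
  induction arcsOf l with
  | nil => simp
  | cons p A ih =>
    rw [List.filterMap_cons, List.filter_cons]
    by_cases hp : arcFace p = some f
    · simp only [hp, if_true, decide_true, List.filterMap_cons, ih]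
    · simp [hp, ih]

/-- The kind of an arc between two distinct sides. [folklore] -/
private theorem arcKind_cases {s u : Side} (hsu : s ≠ u) :
    arcKind s u = .corner ∨ arcKind s u = .coCorner ∨ arcKind s u = .straight := by
  revert hsu; cases s <;> cases u <;> simp [arcKind]

/-- The side pairs of a straight arc. [folklore] -/
private theorem straight_cases {s u : Side} (h : arcKind s u = .straight) :
    (s = .W ∧ u = .E) ∨ (s = .E ∧ u = .W) ∨ (s = .S ∧ u = .N) ∨ (s = .N ∧ u = .S) := by
  revert h; cases s <;> cases u <;> simp [arcKind]

/-- **A face never carries two straight arcs of a Yang–Baxter walk** (they would cross: axiom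
`noncross`). [cite: GlazmanManolescu2019, Fig. 1 (no crossing configuration)] -/
theorem not_two_straight (γ : YBWalk D a z) {f : Face} {p q : MidEdge × MidEdge}
    (hp : p ∈ arcsOf γ.mids) (hq : q ∈ arcsOf γ.mids) (hpq : p ≠ q)
    (hpf : arcFace p = some f) (hqf : arcFace q = some f) (hk : arcKindOf p = some .straight) : False := by
  obtain ⟨h11, h12, h21, h22⟩ := arcs_ends_ne γ hp hq hpq hpf hqf
  have hk' : arcKindOf q = some .straight := (arcKindOf_eq_of_face γ hp hq hpq hpf hqf) ▸ hk
  obtain ⟨s, u, -, hs, hu, hks⟩ := exists_sides_of_arcFace hpf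
  obtain ⟨s', u', -, hs', hu', hks'⟩ := exists_sides_of_arcFace hqf
  rw [hks, Option.some.injEq] at hk
  rw [hks', Option.some.injEq] at hk'
  have ep : p = (f.side s, f.side u) := Prod.ext hs.symm hu.symm
  have eq' : q = (f.side s', f.side u') := Prod.ext hs'.symm hu'.symm
  rw [ep] at hp h11 h12 h21 h22
  rw [eq'] at hq h11 h12 h21 h22
  have e1 : s ≠ s' := fun h => h11 (by rw [h])
  have e2 : s ≠ u' := fun h => h12 (by rw [h])
  have e3 : u ≠ s' := fun h => h21 (by rw [h])
  have e4 : u ≠ u' := fun h => h22 (by rw [h])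
  have hnc := γ.noncross f
  rcases straight_cases hk with ⟨rfl, rfl⟩ | ⟨rfl, rfl⟩ | ⟨rfl, rfl⟩ | ⟨rfl, rfl⟩ <;>
    rcases straight_cases hk' with ⟨rfl, rfl⟩ | ⟨rfl, rfl⟩ | ⟨rfl, rfl⟩ | ⟨rfl, rfl⟩ <;>
    first
    | exact (e1 rfl).elim
    | exact (e2 rfl).elim
    | exact hnc (Or.inl hp) (Or.inl hq)
    | exact hnc (Or.inl hp) (Or.inr hq)
    | exact hnc (Or.inr hp) (Or.inl hq)
    | exact hnc (Or.inr hp) (Or.inr hq)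
    | exact hnc (Or.inl hq) (Or.inl hp)
    | exact hnc (Or.inl hq) (Or.inr hp)
    | exact hnc (Or.inr hq) (Or.inl hp)
    | exact hnc (Or.inr hq) (Or.inr hp)

/-- **The local configurations of a Yang–Baxter walk** (Fig. 1): in every face the kinds are
`[]`, `[u₁]`, `[u₂]`, `[v]`, `[u₁, u₁]` or `[u₂, u₂]`. [cite: GlazmanManolescu2019, §1, Fig. 1] -/
theorem kindsL_shape (γ : YBWalk D a z) (f : Face) :
    kindsL γ.mids f = [] ∨ kindsL γ.mids f = [.corner] ∨ kindsL γ.mids f = [.coCorner] ∨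
      kindsL γ.mids f = [.straight] ∨ kindsL γ.mids f = [.corner, .corner] ∨
        kindsL γ.mids f = [.coCorner, .coCorner] := by
  rw [kindsL_eq_filterMap_filter]
  rcases filter_face_cases γ f with h | ⟨p, h, hpf⟩ | ⟨p, q, h, hpq, hpf, hqf, hk⟩
  · left; rw [h]; rfl
  · obtain ⟨s, u, hsu, -, -, hkp⟩ := exists_sides_of_arcFace hpf
    rw [h, List.filterMap_cons, hkp, List.filterMap_nil]
    rcases arcKind_cases hsu with e | e | e <;> simp [e]
  · have hp : p ∈ arcsOf γ.mids := by
      have : p ∈ (arcsOf γ.mids).filter fun p => arcFace p = some f := by rw [h]; simp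
      exact (List.mem_filter.1 this).1
    have hq : q ∈ arcsOf γ.mids := by
      have : q ∈ (arcsOf γ.mids).filter fun p => arcFace p = some f := by rw [h]; simp
      exact (List.mem_filter.1 this).1
    obtain ⟨s, u, hsu, -, -, hkp⟩ := exists_sides_of_arcFace hpf
    have hkq : arcKindOf q = some (arcKind s u) := hk ▸ hkp
    rw [h, List.filterMap_cons, hkp, List.filterMap_cons, hkq, List.filterMap_nil]
    rcases arcKind_cases hsu with e | e | e
    · simp [e]
    · simp [e]
    · exact (not_two_straight γ hp hq hpq hpf hqf (by rw [hkp, e])).elim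

/-- **The weight of a mid-edge list with local configurations of Fig. 1 is the product of the
printed local weights.** [cite: GlazmanManolescu2019, §1, eq. (1)] -/
theorem prod_localWeight_eq_mono (θ : ℝ) (l : List MidEdge)
    (hK : ∀ f, kindsL l f = [] ∨ kindsL l f = [.corner] ∨ kindsL l f = [.coCorner] ∨
      kindsL l f = [.straight] ∨ kindsL l f = [.corner, .corner] ∨ kindsL l f = [.coCorner, .coCorner]) :
    ∀ L : List Face, (L.map fun f => ((localWeight θ (kindsL l f) : ℝ) : ℂ)).prod =
      (printedWeights θ).mono (L.countP fun f => kindsL l f = [.corner]) (L.countP fun f => kindsL l f = [.coCorner])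
        (L.countP fun f => kindsL l f = [.straight]) (L.countP fun f => kindsL l f = [.corner, .corner])
        (L.countP fun f => kindsL l f = [.coCorner, .coCorner])
  | [] => by simp [CWeights.mono]
  | f :: L => by
    rw [List.map_cons, List.prod_cons, prod_localWeight_eq_mono θ l hK L]
    simp only [List.countP_cons]
    rcases hK f with h | h | h | h | h | h <;>
      simp [h, localWeight, CWeights.mono, printedWeights, pow_succ] <;> ring

/-- The visited faces as a finset are the deduplicated face list. [folklore] -/
private theorem facesVisited_eq_toFinset (γ : YBWalk D a z) : γ.facesVisited = (facesL γ.mids).toFinset := by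
  ext f
  simp [YBWalk.facesVisited, facesL]

/-- **The plaquette weight of the catalogue is the printed Yang–Baxter weight**:
`weightL (printedWeights θ) γ = w_θ(γ)`. [cite: GlazmanManolescu2019, §1, eq. (1)] -/
theorem weightL_printedWeights (θ : ℝ) (γ : YBWalk D a z) :
    weightL (printedWeights θ) γ.mids = ((γ.weight (fun _ => θ) : ℝ) : ℂ) := by
  have key := prod_localWeight_eq_mono θ γ.mids (kindsL_shape γ) (facesL γ.mids)
  have hnd : (facesL γ.mids).Nodup := List.nodup_dedup _
  rw [YBWalk.weight, Complex.ofReal_prod, facesVisited_eq_toFinset, List.prod_toFinset _ hnd]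
  unfold weightL cfgCount
  exact key.symm

/-- The right-angle arc rotation is `π/2` times the signed quarter turn. [folklore] -/
private theorem arcTurn_pi_div_two (s t : Side) : arcTurn (π / 2) s t = π / 2 * qTurn s t := by
  cases s <;> cases t <;> simp [arcTurn, qTurn] <;> ring

/-- The right-angle rotation of an arc is `π/2` times its quarter-turn count. [folklore] -/
private theorem arcTurnOf_pi_div_two (p : MidEdge × MidEdge) : arcTurnOf (fun _ => π / 2) p = π / 2 * qTurnOf p := by
  unfold arcTurnOf qTurnOf
  cases hf : arcFace p with
  | none => simp
  | some f =>
    cases h1 : f.sideOf p.1 with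
    | none => simp [h1]
    | some s =>
      cases h2 : f.sideOf p.2 with
      | none => simp [h1, h2]
      | some t => simp [h1, h2, arcTurn_pi_div_two]

/-- **The right-angle winding is `π/2` times the quarter-turn count.** [folklore] -/
private theorem winding_pi_div_two_eq (γ : YBWalk D a z) : γ.winding (fun _ => π / 2) = π / 2 * (quarterTurnsL γ.mids : ℝ) := by
  unfold YBWalk.winding quarterTurnsL
  rw [Int.cast_list_sum, List.map_map, ← List.sum_map_mul_left]
  congr 1
  refine List.map_congr_left fun p _ => ?_
  simp [Function.comp, arcTurnOf_pi_div_two]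

/-- **The phase `t^{q(γ)}` at `t = e^{−5iπ/16}` is the parafermionic factor `e^{−i(5/8)wind_{π/2}(γ)}`.**
[cite: GlazmanManolescu2019, §2.1, eq. (2.1)] -/
theorem tFiveEighths_zpow_eq (γ : YBWalk D a z) :
    tFiveEighths ^ quarterTurnsL γ.mids = Complex.exp ((-(5 / 8 * γ.winding (fun _ => π / 2)) : ℝ) * Complex.I) := by
  rw [winding_pi_div_two_eq, tFiveEighths, ← Complex.exp_int_mul]
  congr 1
  push_cast
  ring

/-- **Term by term**: the catalogue's summand is the square-frame parafermionic weight.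
[cite: GlazmanManolescu2019, §2.1, eq. (2.1)] -/
theorem weightL_mul_zpow_eq_sqParaWeight (θ : ℝ) (γ : YBWalk D a z) :
    weightL (printedWeights θ) γ.mids * tFiveEighths ^ quarterTurnsL γ.mids = γ.sqParaWeight fun _ => θ := by
  rw [weightL_printedWeights, tFiveEighths_zpow_eq, YBWalk.sqParaWeight]

/-- **The catalogue's observable at the printed weights IS the square-frame Yang–Baxter
observable.** [cite: GlazmanManolescu2019, §2.1, eq. (2.1)] -/
theorem gmObservable_printed_eq (θ : ℝ) (Dl : List Face) (a z : MidEdge) :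
    gmObservable (printedWeights θ) tFiveEighths Dl a z = sqParafermionOn (dom Dl) a (fun _ => θ) z := by
  unfold gmObservable sqParafermionOn
  exact Finset.sum_congr (by ext; simp) fun γ _ => weightL_mul_zpow_eq_sqParaWeight θ γ

/-- **The Yang–Baxter coefficient vector** `(c_E, c_N, c_W, c_S) = (1, r(θ), −1, −r(θ))`,
`r(θ) = e^{i(3θ/8 + 5π/16)}` (`ybRatio`). [cite: GlazmanManolescu2019, Lemma 2.1, eq. (2.2) (CR)] -/
def ybCoeff (θ : ℝ) : Fin 4 → ℂ := ![1, ybRatio θ, -1, -ybRatio θ]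

/-- **C-B2 (venture lane «pcv-sawmu», STRUCTURE.md §2): the printed Yang–Baxter weights carry the
exact vertex relation with coefficients `(1, r(θ), −1, −r(θ))` at EVERY face of EVERY finite face
list, for EVERY root on the OUTER boundary** — `Σ_s c_s F(z_s) = 0` for the catalogue's observable
`F = gmObservable (printedWeights θ) e^{−5iπ/16} Dl a`, all `θ ∈ [π/3, 2π/3]`. (Hole-boundary roots
are excluded by `OuterRoot`, as they must be: there the relation fails.)
[cite: GlazmanManolescu2019, Lemma 2.1, eq. (2.2) (CR)] -/
theorem vertexFunctional_printed_eq_zero {θ : ℝ} (hθ : θ ∈ Set.Icc (π / 3) (2 * π / 3)) (Dl : List Face)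
    (a : MidEdge) (hO : OuterRoot (dom Dl) a) (f₀ : Face) (hf : f₀ ∈ Dl) :
    vertexFunctional (printedWeights θ) tFiveEighths (ybCoeff θ) Dl a f₀ = 0 := by
  have key := sqRelation_const_of_outerRoot hO hθ f₀ (show f₀ ∈ dom Dl from hf)
  have hr : Complex.exp (((3 / 8 * θ + 5 * π / 16 : ℝ) : ℂ) * Complex.I) = ybRatio θ := by
    unfold ybRatio; congr 1; push_cast; ring
  rw [hr] at key
  unfold vertexFunctional
  simp only [Fin.sum_univ_four, gmObservable_printed_eq]
  have e0 : slotSide f₀ 0 = f₀.side .E := rfl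
  have e1 : slotSide f₀ 1 = f₀.side .N := rfl
  have e2 : slotSide f₀ 2 = f₀.side .W := rfl
  have e3 : slotSide f₀ 3 = f₀.side .S := rfl
  have c0 : ybCoeff θ 0 = 1 := rfl
  have c1 : ybCoeff θ 1 = ybRatio θ := rfl
  have c2 : ybCoeff θ 2 = -1 := rfl
  have c3 : ybCoeff θ 3 = -ybRatio θ := rfl
  rw [e0, e1, e2, e3, c0, c1, c2, c3]
  linear_combination key

/-- **Named statement C-B2** («YB identity on general domains», outer roots): for every
`θ ∈ [π/3, 2π/3]`, every finite face list `Dl`, every outer root `a` of `dom Dl` and every face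
`f₀ ∈ Dl`, the vertex functional of the printed weights with the Yang–Baxter coefficients vanishes.
[cite: GlazmanManolescu2019, Lemma 2.1] -/
def _root_.Literature.Barriers.CriticalPhenomena.PlaquetteWalkYBIdentityOuter : Prop :=
  ∀ θ : ℝ, θ ∈ Set.Icc (π / 3) (2 * π / 3) → ∀ (Dl : List Face) (a : MidEdge) (f₀ : Face),
    f₀ ∈ Dl → OuterRoot (dom Dl) a → vertexFunctional (printedWeights θ) tFiveEighths (ybCoeff θ) Dl a f₀ = 0

/-- **C-B2 holds.** [cite: GlazmanManolescu2019, Lemma 2.1] -/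
theorem _root_.Literature.Barriers.CriticalPhenomena.PlaquetteWalkYBIdentityOuter_holds : PlaquetteWalkYBIdentityOuter :=
  fun _ hθ Dl a f₀ hf hO => vertexFunctional_printed_eq_zero hθ Dl a hO f₀ hf

end Literature.Barriers.CriticalPhenomena.PlaquetteWalk
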